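/-
Copyright: statement-level skeleton of a published paper (lit-balaban cell, Phase-2 proof seat p39 gen 27). No proof claims
beyond what the kernel checks below.
-/
import Literature.MathematicalPhysics.QuantumFieldTheory.Balaban1983to89.B3Eq122FirstOrderWick

/-!
# Bałaban, *(Higgs)₂,₃ quantum fields in a finite volume. III*, CMP 88 (1983) [Balaban1983Higgs3], p. 417: PRINT'S RECURSION FOR
# THE MASS COUNTERTERM AT THE INDEX `(α,β) = (0,2)` — the two-point function (1.19) of the action (1.20) with the series `δm² =
# λδm²_{(0,1)} + λ²δm²_{(0,2)}` of (1.23) INSERTED (`e = 0`); its order-`λ²` coefficient DERIVED by one-sided dominated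
# differentiation and EVALUATED by Wick's theorem; the structure (1.21) at order `λ²` with the counterterm letters; and the
# defining equation `−δm²_{(0,2)} + Σ_{x∈T_ε}ε^dΣ^ε_{(0,2)}(x) = 0` SOLVED: `λ²δm²_{(0,2)}` = p26's `ct6`, the sunset ⑥'s
# counterterm; and the vacuum side (1.24) at `β = 1, 2` with the counterterm inserted

statement-level skeleton of published theorems with citation tags; proofs where landed; nothing here is a claim about the
Yang–Mills mass gap.

[cite: Balaban1983Higgs3, (1.19)–(1.22) p.416 (PDF 6); (1.23), the paragraph before it, and (1.24) p.417 (PDF 7); (1.6)–(1.7) p.413 (PDF 3)]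
[cite: GlimmJaffeQP1987, §8.3–8.5 (Gaussian integrals, integration by parts / Wick's theorem, Feynman graphs)].
Unit `lit-balaban-p39-g27` (Phase-2 proof seat p39, gen 27), free-target protocol G.5-34(d), ZERO head weight: OPTIONAL LOCATED MEMBER
of rows **B3.Eq1.23** and **B3.Eq1.19-1.22** of `HOME/lit-balaban-r15/ROWS-B3.md` (owner r15; heads `proved`); the successor brick
named at the close of this seat's gen 26 («the (0,2) index»); TAKING HOME/STATUS 2026-08-24T07:50:23Z, owner r15 g18 07:55:02Z
«WELCOME / NO OBJECTION» with two docstring asks, answered below ((i) THE CONDITION NAMED — §7; (ii) HONEST SCOPE AT WEIGHT 4 —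
the last paragraph). Sibling bricks (cited by name, nothing restated as a hypothesis): BRICK 1 `B3Eq122FirstOrderWick` (this seat,
gen 22, v1.2 — IMPORTED: the Gaussian weight, `ExpGrowth`, the trilinear Wick functional `integral_W_lin3`, the Wick-ordered
moments `integral_wick2_legs` … `integral_wick4_wick2_legs`, the order-`λ²` graph sums
`integral_V_sq_legs`/`integral_V_sq`/`integral_V_mul_legs` and the sunset dictionary `secondCoeff_eq_C0_sig6_C0` are the engine
here), BRICK 10 `B3Eq123RenormalizationConditions` (gen 25: THE WEIGHT-2 STEP of the recursion — `condition_01_iff`,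
`condition_20_iff`, `dm2One_eq_of_conditions`; its §10 is the `(0,1)` precursor of this file) and BRICK 11 `B3Eq119JointSmooth`
(gen 26: joint smoothness of (1.19) in `(e,λ)`, existence and symmetry of every mixed partial) — BOTH NOT IMPORTED (their farm
oleans were unbuilt at filing time, hub probe rc 75 `stale:unbuilt`, 2026-08-24T07:5xZ): the three small lemmas this file would
take from BRICK 10 are re-derived in this file's own shapes («= BRICK 10 … BY NAME once built»: `weight_counterterm_eq` = its
`weight_mass_add`; `expGrowth_V_add_massForm` ⊇ its `expGrowth_massForm`; `cum2_massForm_legs` = its `cov_massForm_legs`;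
`twoPointCt_eq` plays the part of its `twoPtJoint_zero_charge`/`weight_mul_exp_massCurve`; the lower bound of the shifted vertex
is kept PRIVATE (`neg_le_V_add_massForm` ≡ its `neg_le_V_massCurve`, statement-identical — to be replaced by the import when the
olean is built), p26's `B3Eq123Counterterms` ((1.22)/(1.23) typed: `SEData`, `sig1`, `sig6`, `delta`, `ct1`, `ct6`, `ct6_eq`,
`dm2Graph_add`, `dm2Graph_mul_delta` — consumed BY NAME) and r15's `B3Sect1TwoPoint` (`dm2Graph`, `dm2Coeff`, `dm2Of123`,
`idx123`, `dysonTerm` — the typed (1.21)/(1.23) bookkeeping).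

PDF held: `paper:balaban1983-higgs-2-3-quantum-fields-finite-volume` (journal page = PDF page + 410); pp. 416–417 read first-hand
for this file on the ×2 renders `run/shared/lean/pub/pub-balaban/b2b-balaban-ref1/pages/1983-cmp88-higgs23-III/1983-cmp88-higgs23-
III-p006-x2.png`, `…-p007-x2.png` (p. 417 re-read 2026-08-24T08:2xZ for this header).

THE PRINTED TEXT (verbatim). P. 416: *"G^ε_{ab}(x,x′) = ⟨φ_a(x)φ_b(x′)⟩^ε = (Z^ε)^{−1}∫dA∫dφ e^{−S^ε(A,φ)}φ_a(x)φ_b(x′), x, x′ ∈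
T_ε, (1.19) where S^ε(A,φ) is the lattice action of the model given by S^ε(A,φ) = ½⟨φ,(−Δ^ε_A + m²)φ⟩ + Σ_{x∈T_ε}ε^d(λ∣φ(x)∣⁴ +
½δm²∣φ(x)∣²) + ½⟨A,(−Δ^ε + μ₀²)A⟩, (1.20) … The function G^ε has a perturbative expansion of the following structure G^ε =
Σ_{n=0}^∞ C₀^ε[(−δm² + Σ^ε + ∂^{ε*}Σ₁^ε + Σ₁^{ε*}∂^ε + ∂^{ε*}Σ₂^ε∂^ε)C₀^ε]ⁿ, (1.21) where C₀^ε = (−Δ₀^ε + m²)^{−1} and Σ^ε, Σ₁^ε,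
Σ₂^ε are given by amputated, one-particle-irreducible graphs of the expansion of G^ε. … the only vertices are (1.6), (1.7) [with
δm² instead of δm²_l(x)], (1.8), and (1.10) … Let us write a few terms of the expansion of Σ^ε: Σ^ε(x−x′) =
−4(N+2)λC^ε_0(0)δ^ε(x−x′) + e²dC^ε(0)q²δ^ε(x−x′) + … + 4²(2N+4)λ²(C^ε_0(x−x′))³ + … (1.22) Here we did not write, and we will not
write in the future, combinatoric factors before the graphs, understanding that they are a part of the graphical description."*.
P. 417: *"The mass renormalization counterterm δm² is chosen in such a way that −δm² + Σ^ε is convergent. Of course this condition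
does not determine δm² uniquely, and usually it is defined as a solution of the equation −δm² + Σ_{x∈T_ε}ε^dΣ^ε(x) = 0. This
equation can be solved recursively if δm² and Σ^ε are expanded into power series in e, λ. In our case δm² will be defined by the
terms of order ≦ 4. More exactly we write δm² = Σ_{2≦α+2β≦4}e^αλ^βδm²_{(α,β)} and we insert this into Σ^ε. This gives us an
expansion of Σ^ε in coupling constants and we take a sum of terms of order ≦ 4: Σ_{2≦α+2β≦4}e^αλ^βΣ^ε_{(α,β)}. The counterterms
δm²_{(α,β)} are defined by the equations −δm²_{(α,β)} + Σ_{x∈T_ε}ε^dΣ^ε_{(α,β)}(x) = 0. It is convenient to write them in a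
different way. A term e^αλ^βΣ^ε_{(α,β)} can be written also as a sum of terms Σ^ε_G, the summation over a family of
one-particle-irreducible graphs with two external legs of scalar fields. The same for the term e^αλ^βδm²_{(α,β)}, and we define
δm²_G by the equation −δm²_G + Σ_{x∈T_ε}ε^dΣ^ε_G(x) = 0. … For example the expressions in (1.22) define the following
counterterms: δm² = −4(N+2)λC^ε_0(0) + e²dC^ε(0)q² + … + 4²(2N+4)λ²Σ_{x′∈T_ε}ε^d(C^ε_0(x−x′))³ + … (1.23) where δm²₁ denote a sum
of terms δm²_{(α,β)} of the order α + 2β = 2. Thus we have determined the counterterm δm²."*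

WHAT WAS IN THE TREE BEFORE. (1.23) and its defining equations TYPED (r15 `dm2Coeff`/`dm2Of123`/`dm2Graph`; p26 `ct1 … ct7`,
`dm2One`, `dm2Two`, `dm2_123`, `solves_123` — the displayed counterterms solve the equations BY DEFINITION of `dm2Graph` —, and
p26's `recursion_order_four`: the graded ansatz inserted into the DISPLAYED part of (1.22) is returned through order 4), for
SUPPLIED self-energy kernels. DERIVED from the measure (1.19)/(1.20): BRICK 1 (orders `λ`, `λ²` at `e = 0`, `δm² = 0`: ①, ⑥, the
local two-loop graph, the tadpole chain), BRICK 7 (order `e²`), BRICK 8 (`e²δm²`), BRICK 10 (THE WEIGHT-2 STEP of print's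
recursion: the counterterm inserted AS A SERIES, the equations at `(2,0)` and `(0,1)` read as renormalization conditions on the
derived two-point function and SOLVED, `δm²₁ = dm2One`), BRICK 11 (existence of every Taylor coefficient `∂^α_e∂^β_λG^{ct}(0,0)`).
NOT in the tree: ANY WEIGHT-4 STEP of the recursion on the derived function — an index with `α + 2β = 4`, where the inserted
LOWER-order counterterm feeds back into `Σ^ε_{(α,β)}` (print: *"we insert this into Σ^ε"*). This file does the index `(0,2)`
(order `λ²`, `e = 0`). Weight 4 is the first weight at which the recursion is genuinely recursive — the inserted weight-2
counterterms feed back into `Σ^ε_{(α,β)}`: at `(0,2)` the tadpole whose loop carries the `(0,1)`-corrected propagator (here), at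
`(4,0)` and `(2,1)` print's ⑦(δm²₁) — and `(0,2)` is the one weight-4 index all of whose graphs come from the vertices (1.6)/(1.7)
alone: the sunset ⑥ of (1.22), the local two-loop graph and the counterterm insertions (the latter two among print's "…").

THE SETTING = BRICK 1's: the model torus `T^{(j)}_η` of `B3WT223Instance` (print's `T_ε`, `η = ε`, volume element `w = η^d`, `c =
η⁻¹`), fields `φ : T → ℝ^N` (`Cfg`), the Gaussian weight `W(φ) = e^{−½⟨φ,(−Δ^η+m²)φ⟩}` (`weight … m2 0`: zero vector field = the
`e = 0` sector of (1.19), where `∫dA` integrates out of numerator and denominator alike), its propagator `C₀ = B3WTPropagator.G`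
(`B3WTCovariance`), `V(φ) = Σ_yη^d∣φ(y)∣⁴` (the vertex (1.6)), `Q(φ) = Σ_zη^d∣φ(z)∣²` (`massForm`; the vertex (1.7) is `½δm²·Q`),
legs `F = φ_a(x)φ_b(x′)` (`⟪φ x, e_a⟫` with `EuclideanSpace.basisFun`); in the docstrings below `W` abbreviates this weight
`weight C η w c m2 0` (written out in the statements). **THE COUNTERTERM OF (1.20) IS A MASS SHIFT, A SERIES IN `λ` IN THE
EXPONENT** (§1 `weight_counterterm_eq`; §6 `twoPointCt_eq`): with `δm² = λδ₁ + λ²δ₂` the scalar weight of (1.20) at `e = 0` is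
`W·exp(−[λ(V + ½δ₁Q) + λ²·½δ₂Q])`, so (1.19) with the series inserted is the family `G_{ab}(λ;x,x′) = ∫We^{−[λV₁+λ²κQ]}F ∕
∫We^{−[λV₁+λ²κQ]}`, `V₁ = V + ½δ₁Q ≥ −∣T∣η^dδ₁²/16` (private `neg_le_V_add_massForm`), `κ = δ₂/2` of either sign — differentiated
ONE-SIDEDLY at `λ = 0⁺` (the measure does not exist for `λ < 0`). Hypotheses throughout: `η^d > 0`, `m² > 0`; any level `j`, mesh,
dimension `d`, number of components `N`; `δ₁, δ₂ ∈ ℝ` arbitrary until §7.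

WHAT THIS FILE PROVES (theorems only; no definition, no named fact, no `sorry`; standard axioms).
* §1 `weight_counterterm_eq` (the factorization above), `weight_mul_exp_quarter_mass` (`W_{m²}·e^{(m²/4)Q} = W_{m²/2}`),
  `exp_neg_exponent_le` (for `0 ≤ λ ≤ 1` with `λ∣κ∣ ≤ m²/4` and `V ≥ −K`: `e^{−[λV+λ²κQ]} ≤ e^{K}·e^{(m²/4)Q}` — the quadratic
  exponent of either sign is absorbed by a quarter of the mass, so every majorant lives at mass `m²/2`).
* §2 **ONE-SIDED DOMINATED DIFFERENTIATION UNDER `∫dφ` FOR THE EXPONENT `λV₁ + λ²κQ`** (`integrable_moment`; `hasDerivAt_moment`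
  at `λ₀ > 0` by Mathlib's `hasDerivAt_integral_of_dominated_loc_of_deriv_le` on a ball inside the window;
  **`hasDerivWithinAt_moment_zero`** at `λ₀ = 0` WITHIN `[0,∞)` by dominated convergence of the difference quotients along `𝓝[>]0`
  — derivative `−∫W·V₁·g`, majorant `e^K·W_{m²/2}·(∣V₁∣ + ∣κ∣Q)∣g∣`).
* §3 THE NORMALIZED FAMILY (`hasDerivWithinAt_moment` on `[0,L)`, `moment_one_pos`, `moment_split`; **`hasDerivWithinAt_ratio`**:
  the quotient rule on the window, `G′(λ) = D₁(λ)`; **`hasDerivWithinAt_D1_zero`**: `D₁` is right-differentiable at `0` with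
  `G″(0⁺) = κ₃(F;V₁,V₁) − 2κ·κ₂(F;Q)` in joint cumulants of the free field — the SECOND one-sided `λ`-derivative of (1.19) along
  the counterterm curve EXISTS and has this form, proved here from scratch in one variable (BRICK 11's joint statement
  `iteratedDeriv_iteratedDerivWithin_twoPtCt_comm` is neither used nor restated)).
* §4 WICK'S THEOREM FOR THE MASS VERTEX (`integral_W_lin4`; per site `integral_normSq_legs`, `integral_normSq_normSq_legs`,
  `integral_normFour_normSq_legs` and their vacuum companions, from BRICK 1's Wick-ordered moments via `∣φ(z)∣² = :∣φ(z)∣²: +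
  N·C₀(z,z)` (`norm_sq_eq_wick2`) and BRICK 1's `norm_four_eq_wick`; summed over the torus: `integral_massForm_legs`,
  `integral_massForm_sq_legs`, `integral_V_massForm_legs` + vacuum versions — every Gaussian moment of `Q`, `Q²`, `V·Q` with and
  without the legs as a sum of graph values in `C₀`).
* §5 THE CONNECTED PARTS (`cum2_massForm_legs`: `κ₂(F;Q) = 2δ_{ab}Σ_zη^dC₀(x,z)C₀(x′,z)` — the mass insertion `C₀·Q·C₀`;
  `cum3_massForm_massForm_legs`: `κ₃(F;Q,Q) = δ_{ab}Σ_{y,z}η^{2d}4C₀(z,y)[C₀(x,y)C₀(z,x′) + C₀(x′,y)C₀(z,x)]` — the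
  insertion–insertion chain; `cum3_V_massForm_legs`: `κ₃(F;V,Q) = δ_{ab}Σ_{y,z}η^{2d}[8(N+2)C₀(z,y)²C₀(x,y)C₀(x′,y) +
  2(N+2)C₀(y,y)·4C₀(z,y)(…)]` — the mass insertion ON THE TADPOLE LOOP and the tadpole–insertion chains; `cum3_V_V_legs` = BRICK
  1's order-`λ²` graphs [⑥ + local two-loop (both placements) + tadpole chain]; every disconnected vacuum piece cancels — linked
  cluster at this order by explicit computation: `Z`-cleared polynomial identities closed by `linear_combination`).
* §6 **THE ORDER-`λ²` COEFFICIENT** (`integral_V1_sq_legs`, `integral_V1_legs` …; **`hasDerivWithinAt_D1_counterterm`**: the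
  right-derivative of `D₁` at `0` EVALUATED — `G″(0⁺) = δ_{ab}·{D₃ + δ₁·T + (δ₁²/4)·H − δ₂·Σ_zη^d·2C₀(x,z)C₀(x′,z)}` with `D₃` =
  BRICK 1's three graph families, `T` = the two `VQ` families, `H` = the `QQ` chain; a window exists (`exists_window`, private);
  `derivWithin_twoPointCt_eq` (on the window the derivative within `[0,∞)` IS `D₁`); **`iteratedDerivWithin_two_twoPointCt`:
  `iteratedDerivWithin 2 (λ ↦ G_{ab}(λ;x,x′)) (Set.Ici 0) 0 =` that value** — the `(α,β) = (0,2)` Taylor coefficient (times `2!`)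
  of (1.19) with the counterterm series inserted, in Mathlib's spelling; `twoPointCt_eq`: (1.20)'s own spelling `weight … (m2 +
  (λδ₁ + λ²δ₂)) 0 φ · e^{−λV}` of the same family).
* §7 **PRINT'S EQUATION AT `(0,2)` — r15's ask (i): THE CONDITION, NAMED.** The renormalization CONDITION is print's
  *"−δm²_{(α,β)} + Σ_{x∈T_ε}ε^dΣ^ε_{(α,β)}(x) = 0"* at `(α,β) = (0,2)`, typed EXACTLY as BRICK 10 typed the two weight-2
  conditions (`B3Eq123RenormalizationConditions.condition_01_iff`/`condition_20_iff`): r15's row-sum functional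
  `B3Sect1TwoPoint.dm2Graph ε^d K y = Σ_{y′}ε^dK(y,y′)` of the TOTAL order-`λ²` mass-type letter `K_{(0,2)} = λ²Σ^ε_{(0,2)} −
  λ²δ₂·δ^ε` of the bracket of (1.21), required to vanish at every `y`; `λ²Σ^ε_{(0,2)} = sig6 D + Λ·δ^ε` is NOT supplied but READ OFF
  the derived coefficient (§8): p26's typed sunset `sig6` and the LOOP-INSERTION letter `Λ(y) =
  λ²·4(N+2)Σ_zη^dC₀(z,y)²[4(N+2)C₀(z,z) + δ₁]` (the tadpole ① whose loop propagator carries the first-order correction — print's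
  *"we insert this into Σ^ε"* at work; graph by graph: the two-loop tadpole-on-tadpole graph and the tadpole with the vertex
  (1.7)·`δm²_{(0,1)}` on its loop). **`condition_02_iff`: the condition holds IFF `λ²δ₂ = ct6 D(y) + Λ(y)` for all `y`**
  (condition ⇔ value); `loopInsertion_eq_zero_at_dm2One`: AT PRINT'S `δm²_{(0,1)}` — `λδ₁ = ct1 D = −4(N+2)λC^ε_0(0)`, the
  solution of the `(0,1)` condition (BRICK 10 `condition_01_iff`, `dm2One_eq_of_conditions`) — `Λ ≡ 0` on the torus (`C₀(z,z) =
  C₀(0)`, `B3WTCovariance.G_diag_const`: the two graphs' counterterms `δm²_G` cancel); **`condition_02_iff_at_dm2One`: the `(0,2)`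
  condition holds IFF `λ²δm²_{(0,2)} = ct6 D`** — p26's `B3Eq123Counterterms.ct6`, and `ct6_value`: `=
  4²(2N+4)λ²Σ_{x′}ε^dC^ε_0(y,x′)³` (p26 `ct6_eq`), THE SIXTH DISPLAYED COUNTERTERM OF (1.23), here the END of a derivation from
  (1.19)/(1.20): CONDITION (print's equation on the derived self-energy) ⇒ VALUE (p26's typed `ct6`), not a definition. With BRICK
  10's `(0,1)` step this closes the pure-`λ` sector `{(0,1), (0,2)}` of *"δm² will be defined by the terms of order ≦ 4"*.
* §8 **THE STRUCTURE (1.21) AT ORDER `λ²` WITH THE COUNTERTERM LETTERS** (**`secondOrder_structure`**: `(λ²/2)·G″(0⁺) =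
  Σ_{y,y′}η^{2d}C₀(x,y)[sig6 D + (Λ − λ²δ₂)δ^ε](y,y′)C₀(y′,x′) + Σ_{y,z}η^{2d}C₀(x,y)X₁(y)C₀(y,z)X₁(z)C₀(z,x′)` per `δ_{ab}`, with
  `X₁(v) = −λ[4(N+2)C₀(v,v) + δ₁]` the diagonal of the DERIVED weight-2 letter `sig1 D − λδ₁δ^ε` of BRICK 10 §10 — the `n = 1`
  term with the order-`λ²` letters `λ²Σ^ε_{(0,2)} − λ²δm²_{(0,2)}` PLUS the `n = 2` term, the square of the weight-2 letter (the two
  orientations of every chain merge into `1/2!`; ⑥ by BRICK 1's `secondCoeff_eq_C0_sig6_C0`);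
  **`secondOrder_structure_at_dm2One`**: at print's `δm²_{(0,1)}` the letter `X₁`, hence the chain, and `Λ` VANISH IDENTICALLY and
  `(λ²/2)G″(0⁺) = C₀[sig6 D − λ²δ₂δ^ε]C₀` — of the order-`λ²` content only the displayed ⑥ and the counterterm remain, as
  (1.22)/(1.23) print it).
* §9 DICTIONARY (`dm2Of123_charge_zero`: r15's inserted series `dm2Of123 0 λ ε^d δm²_{(·,·)} = λ·δm²_{(0,1)} + λ²·δm²_{(0,2)}` —
  the curve of this file IS (1.23)'s series at `e = 0`; `letter01_diag`: `η^d·[sig1 D − λδ₁δ^ε] = diag X₁`; `n1_eq_dysonTerm_one`,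
  `chain_eq_dysonTerm_two_counterterm`, **`secondOrder_eq_dysonTerms`**: the matrix of `(λ²/2)G″(0⁺)` is `dysonTerm (η^dC₀)
  (η^d[sig6 D + (Λ − λ²δ₂)δ^ε]) 1 + dysonTerm (η^dC₀) (η^d[sig1 D − λδ₁δ^ε]) 2` in r15's (1.21) vocabulary `dysonTerm C₀ X n =
  C₀(XC₀)ⁿ`; `secondOrder_eq_dysonTerm_one_at_dm2One`: at print's `δm²₁` the `n = 1` term ALONE,
  `dysonTerm (η^dC₀) (η^d[sig6 D − λ²δ₂δ^ε]) 1`).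
* §10 **THE VACUUM SIDE — (1.24) AT `e = 0` WITH THE COUNTERTERM SERIES INSERTED** (print p. 417: *"E₁ = Σ_{1≤α+β≤n̄}
  (1/(α!β!))e^αλ^β(∂^{α+β}/∂e^α∂λ^β log∫dA∫dφ e^{−S^ε(A,φ)})∣_{e=λ=0} (1.24) … connected graphs without external legs (vacuum
  graphs)"*; BRICK 1 §13 did `δm² = 0`): `hasDerivWithinAt_logZct` (**β = 1**: `(d/dλ)log Z^{ct}∣_{0⁺} = −Σ_yη^d[N(N+2)C₀(y,y)² +
  (δ₁/2)N·C₀(y,y)]` — the "8" and the loop of the mass vertex (1.7)·`λδm²_{(0,1)}`), `derivWithin_logZct_eq` (on the window `(log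
  Z^{ct})′ = −⟨V₁ + λδ₂Q⟩_λ`), **`hasDerivWithinAt_firstDeriv_logZct` (β = 2: the right-derivative of `−⟨V₁ + λδ₂Q⟩_λ` at `0⁺` is
  `Var₀(V₁) − δ₂⟨Q⟩₀ =` basketball + bubble with two tadpole loops + `δ₁`·[bubble with one tadpole loop and one mass vertex] +
  `(δ₁²/4)`·[bubble of two mass vertices] − `δ₂·Σ_zη^dN·C₀(z,z)`**, every disconnected product cancelling — connected vacuum
  graphs, as printed; `iteratedDerivWithin_two_logZct`: the same coefficient in Mathlib's `iteratedDerivWithin 2 · (Set.Ici 0)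
  0`), `vacuum_secondOrder_at_dm2One` (AT PRINT'S `δm²_{(0,1)}` the three bubbles CANCEL, `4 − 8 + 4`: the order-`λ²` term of
  (1.24) is the basketball plus the loop of the vertex (1.7)·`λ²δm²_{(0,2)}` — the vacuum counterpart of
  `secondOrder_structure_at_dm2One`).

HONEST SCOPE — r15's ask (ii), AT WEIGHT 4. Print's weight-4 indices are `(4,0), (2,1), (0,2)` (`α + 2β = 4`; r15's `idx123` minus
BRICK 10's weight-2 pair and the weight-3 pair `(3,0), (1,1)`, odd in `e`, BRICK 10 §13 / BRICK 11 §9). OF THESE ONLY `(0,2)` IS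
DERIVED HERE, and only at `e = 0`. The indices `(4,0)` (order `e⁴`: ③, ⑤ and the undisplayed `e⁴`-graphs of (1.22)) and `(2,1)`
(order `e²λ`: ⑦(δm²₁) and undisplayed graphs) REMAIN p26's TYPED bookkeeping — `B3Eq123Counterterms.recursion_order_four` (the
graded ansatz returned through order 4 on the DISPLAYED part of (1.22)) and `solves_123` (the displayed counterterms solve the
displayed equations by definition of `dm2Graph`) — with the EXISTENCE (and Schwarz symmetry) of the Taylor coefficients
`∂⁴_eG^{ct}(0,0)`, `∂²_e∂_λG^{ct}(0,0)` of (1.19) supplied by BRICK 11 `B3Eq119JointSmooth`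
(`iteratedDeriv_iteratedDerivWithin_twoPtCt_comm`); their EVALUATION as graph sums (print's "…" of (1.22) hides one-particle-
irreducible `e⁴`- and `e²λ`-graphs that are not displayed) is NOT in the tree, and no statement of BRICK 11 is restated here as a
hypothesis. Further limits: the split of the derived coefficient into the `n = 1` and `n = 2` terms of (1.21) is done by MATCHING
the `n = 2` term with the square of the derived weight-2 letter (§8) — one-particle irreducibility as a notion on graphs is BRICKS
2–3 (`B3Eq121OnePIChains`, `B3OnePIGraphs`), not invoked; finite torus at fixed `ε = η`: nothing here is uniform in `ε`, and
*"−δm² + Σ^ε is convergent"* (the `ε → 0` statement) is not touched; `λ ≥ 0`, one-sided, throughout (orders `β ≤ 2` only, on both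
the two-point side and the vacuum side (1.24)); `e = 0` (no `Σ₁`, `Σ₂` letters, no vector field). Mathlib + the cited tree files
only.
-/

noncomputable section

open scoped BigOperators InnerProductSpace Topology

namespace Literature.MathematicalPhysics.QuantumFieldTheory.Balaban1983to89.B3Eq123IndexZeroTwo

open _root_.MeasureTheory _root_.Filter
open LatticeFieldCalculus B3WT223Instance B3WTPropagator B3WTCovariance B3WickVertexCalculus B3Eq123Counterterms
  B3Eq122FirstOrderWick
open B3Sect3ScalarSelfEnergy (Kernel)
open B3Sect1TwoPoint (dm2Graph dm2Coeff dm2Of123 idx123 idx123_eq dysonTerm)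

variable {P : Params} {j N : ℕ} (C : HiggsLattice.ChargeData N) (η w c m2 : ℝ)

/-! ## §0 Toolbox (file-local) -/

omit C η w c m2 in
/-- `∣e^{−u} − 1∣ ≤ ∣u∣·max(1, e^{−u})` (mean-value bound, one-sided in the sign of `u`). [folklore] -/
private theorem abs_exp_neg_sub_one_le_max (u : ℝ) : |Real.exp (-u) - 1| ≤ |u| * max 1 (Real.exp (-u)) := by
  rcases le_or_gt 0 u with hu | hu
  · have h1 : Real.exp (-u) ≤ 1 := Real.exp_le_one_iff.mpr (by linarith)
    have h2 : 1 - u ≤ Real.exp (-u) := by linarith [Real.add_one_le_exp (-u)]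
    rw [abs_of_nonpos (by linarith), abs_of_nonneg hu]
    calc -(Real.exp (-u) - 1) ≤ u := by linarith
      _ ≤ u * max 1 (Real.exp (-u)) := le_mul_of_one_le_right hu (le_max_left _ _)
  · have hx : 0 ≤ -u := by linarith
    have h1 : 1 ≤ Real.exp (-u) := Real.one_le_exp hx
    -- `e^{x} − 1 ≤ x e^{x}` for `x = −u ≥ 0`: from `1 − x ≤ e^{−x}` multiplied by `e^{x}`
    have h3 : Real.exp (-u) * (1 - -u) ≤ 1 := by
      have h4 : 1 - -u ≤ Real.exp (-(-u)) := by linarith [Real.add_one_le_exp (-(-u))]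
      have h5 : Real.exp (-u) * Real.exp (-(-u)) = 1 := by rw [← Real.exp_add]; simp
      nlinarith [Real.exp_pos (-u), h4, h5]
    rw [abs_of_nonneg (by linarith), abs_of_neg hu, max_eq_right h1]
    nlinarith [Real.exp_pos (-u)]

omit C η w c m2 in
/-- the absolute value of an observable of exponential-linear growth has exponential-linear growth. [folklore] -/
private theorem expGrowth_abs {g : Cfg P j N → ℝ} (hg : ExpGrowth g) : ExpGrowth (fun φ => |g φ|) := by
  obtain ⟨hc, K, κ, hK, hκ, hb⟩ := hg
  exact ⟨hc.abs, K, κ, hK, hκ, fun φ => by rw [abs_abs]; exact hb φ⟩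

omit C η c m2 in
/-- the mass term `Σ_yη^d∣φ(y)∣²` and the shifted interaction per unit `λ`, `Σ_yη^d∣φ(y)∣⁴ + ½δ₁Σ_yη^d∣φ(y)∣²`, are observables of
exponential-linear growth. [cite: Balaban1983Higgs3, (1.20) p.416] -/
theorem expGrowth_V_add_massForm (δ₁ : ℝ) :
    ExpGrowth (fun φ : Cfg P j N => (∑ y : Site P j, w * ‖φ y‖ ^ 4) + 1 / 2 * δ₁ * massForm w φ) ∧
      ExpGrowth (fun φ : Cfg P j N => massForm w φ) := by
  have hQ : ExpGrowth (fun φ : Cfg P j N => massForm w φ) := by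
    have h := ExpGrowth.sum (Finset.univ : Finset (Site P j))
      (f := fun x (φ : Cfg P j N) => w * ‖φ x‖ ^ 2) fun x _ => (ExpGrowth.norm_sq_apply x).const_mul w
    simpa only [massForm] using h
  exact ⟨(expGrowth_V (P := P) (j := j) (N := N) w).add (hQ.const_mul (1 / 2 * δ₁)), hQ⟩

omit C η c m2 in
/-- the shifted interaction per unit `λ` is bounded below: `Σ_yη^d(∣φ(y)∣⁴ + ½δ₁∣φ(y)∣²) ≥ −∣T∣η^dδ₁²/16`
(`t⁴ + ½δ₁t² ≥ −δ₁²/16`). [cite: Balaban1983Higgs3, (1.20) p.416] -/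
private theorem neg_le_V_add_massForm (hw : 0 ≤ w) (δ₁ : ℝ) (φ : Cfg P j N) :
    -(Fintype.card (Site P j) * w * (δ₁ ^ 2 / 16)) ≤ (∑ y : Site P j, w * ‖φ y‖ ^ 4) + 1 / 2 * δ₁ * massForm w φ := by
  unfold massForm
  have hy : ∀ y : Site P j, -(w * (δ₁ ^ 2 / 16)) ≤ w * ‖φ y‖ ^ 4 + 1 / 2 * δ₁ * (w * ‖φ y‖ ^ 2) := fun y => by
    have h : 0 ≤ w * (‖φ y‖ ^ 2 + δ₁ / 4) ^ 2 := mul_nonneg hw (sq_nonneg _)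
    nlinarith
  calc -(Fintype.card (Site P j) * w * (δ₁ ^ 2 / 16)) = ∑ _y : Site P j, -(w * (δ₁ ^ 2 / 16)) := by
        rw [Finset.sum_const, Finset.card_univ, nsmul_eq_mul]; ring
    _ ≤ ∑ y : Site P j, (w * ‖φ y‖ ^ 4 + 1 / 2 * δ₁ * (w * ‖φ y‖ ^ 2)) := Finset.sum_le_sum fun y _ => hy y
    _ = (∑ y : Site P j, w * ‖φ y‖ ^ 4) + 1 / 2 * δ₁ * ∑ y : Site P j, w * ‖φ y‖ ^ 2 := by
        rw [Finset.sum_add_distrib, Finset.mul_sum]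

/-! ## §1 The counterterm of (1.20) at `e = 0` is a mass shift; absorbing a quadratic exponent into the Gaussian weight -/

/-- **(1.20) AT `e = 0` WITH THE COUNTERTERM SERIES `δm² = λδ₁ + λ²δ₂` INSERTED**: the scalar weight
`e^{−½⟨φ,(−Δ^η+m²+λδ₁+λ²δ₂)φ⟩}e^{−λΣ_yη^d∣φ(y)∣⁴}` equals the free weight at mass `m²` times
`exp(−[λ(Σ_yη^d∣φ(y)∣⁴ + ½δ₁Σ_yη^d∣φ(y)∣²) + λ²·½δ₂Σ_yη^d∣φ(y)∣²])` — a quartic-plus-quadratic exponent, linear-plus-quadratic in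
`λ`. [cite: Balaban1983Higgs3, (1.20) p.416, (1.23) p.417] -/
theorem weight_counterterm_eq (lam δ₁ δ₂ : ℝ) (φ : Cfg P j N) :
    weight C η w c (m2 + (lam * δ₁ + lam ^ 2 * δ₂)) (0 : VecField P j ℝ) φ *
        Real.exp (-(lam * ∑ y : Site P j, w * ‖φ y‖ ^ 4)) =
      weight C η w c m2 (0 : VecField P j ℝ) φ * Real.exp (-(lam * ((∑ y : Site P j, w * ‖φ y‖ ^ 4) + 1 / 2 * δ₁ * massForm w φ)
        + lam ^ 2 * (1 / 2 * δ₂ * massForm w φ))) := by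
  simp only [weight, quadForm]
  rw [← Real.exp_add, ← Real.exp_add]
  congr 1
  ring

/-- the free weight at mass `m²` times `e^{(m²/4)Σ_yη^d∣φ(y)∣²}` is the free weight at HALF THE MASS — the majorant that absorbs the
quadratic part of the exponent for small `λ`. [cite: Balaban1983Higgs3, (1.20) p.416] -/
theorem weight_mul_exp_quarter_mass (φ : Cfg P j N) :
    weight C η w c m2 (0 : VecField P j ℝ) φ * Real.exp (m2 / 4 * massForm w φ) = weight C η w c (m2 / 2) (0 : VecField P j ℝ) φ := by
  simp only [weight, quadForm]
  rw [← Real.exp_add]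
  congr 1
  ring

/-- the exponent bound used in every domination below: for `V ≥ −K` (`K ≥ 0`), `0 ≤ λ ≤ 1`, `λ∣κ∣ ≤ m²/4`,
`e^{−(λV + λ²κQ)} ≤ e^{K}·e^{(m²/4)Q}` (`Q = Σ_yη^d∣φ(y)∣² ≥ 0`). [cite: Balaban1983Higgs3, (1.20) p.416] -/
theorem exp_neg_exponent_le (hw : 0 ≤ w) {V : Cfg P j N → ℝ} {K : ℝ} (hK : 0 ≤ K) (hVK : ∀ φ, -K ≤ V φ) {κ lam : ℝ}
    (hlam0 : 0 ≤ lam) (hlam1 : lam ≤ 1) (hlamκ : lam * |κ| ≤ m2 / 4) (φ : Cfg P j N) :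
    Real.exp (-(lam * V φ + lam ^ 2 * (κ * massForm w φ))) ≤ Real.exp K * Real.exp (m2 / 4 * massForm w φ) := by
  rw [← Real.exp_add]
  apply Real.exp_le_exp.mpr
  have hQ : 0 ≤ massForm w φ := massForm_nonneg hw φ
  have h1 : -(lam * V φ) ≤ K := by nlinarith [hVK φ]
  have h2 : -(lam ^ 2 * (κ * massForm w φ)) ≤ m2 / 4 * massForm w φ := by
    have h3 : lam ^ 2 * |κ| ≤ m2 / 4 := by
      have h5 : lam ^ 2 * |κ| ≤ lam * |κ| :=
        mul_le_mul_of_nonneg_right (by nlinarith) (abs_nonneg κ)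
      exact h5.trans hlamκ
    have h4 : -(lam ^ 2 * (κ * massForm w φ)) ≤ lam ^ 2 * |κ| * massForm w φ := by
      have h6 : 0 ≤ (|κ| + κ) * (lam ^ 2 * massForm w φ) :=
        mul_nonneg (by linarith [neg_abs_le κ]) (mul_nonneg (sq_nonneg lam) hQ)
      nlinarith
    have h7 : lam ^ 2 * |κ| * massForm w φ ≤ m2 / 4 * massForm w φ := mul_le_mul_of_nonneg_right h3 hQ
    linarith
  linarith


/-! ## §2 ONE-SIDED DIFFERENTIATION UNDER `∫dφ` FOR THE EXPONENT `λV + λ²κQ` (`V ≥ −K` of exponential-linear growth,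
`Q = Σ_yη^d∣φ(y)∣²`): the unnormalized moments `N_g(λ) = ∫W e^{−(λV+λ²κQ)} g` on `0 ≤ λ ≤ L` (`L ≤ 1`, `L∣κ∣ ≤ m²/4`) -/

section Moments


/-- the integrand of `N_g(λ)` is dominated by `e^{K}·W_{m²/2}·∣g∣` for `0 ≤ λ ≤ L`, hence integrable.
[cite: Balaban1983Higgs3, (1.19)–(1.20) p.416] [cite: GlimmJaffeQP1987, §8.4–8.5] -/
theorem integrable_moment (hw : 0 < w) (hm : 0 < m2) {V g : Cfg P j N → ℝ} (hV : ExpGrowth V) {K : ℝ} (hK : 0 ≤ K)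
    (hVK : ∀ φ, -K ≤ V φ) (hg : ExpGrowth g) {κ lam : ℝ} (hlam0 : 0 ≤ lam) (hlam1 : lam ≤ 1)
    (hlamκ : lam * |κ| ≤ m2 / 4) :
    Integrable (fun φ : Cfg P j N => weight C η w c m2 (0 : VecField P j ℝ) φ * (Real.exp (-(lam * V φ + lam ^ 2 * (κ * massForm w φ))) * g φ)) := by
  have hQ := (expGrowth_V_add_massForm (P := P) (j := j) (N := N) w 0).2
  have hmaj : Integrable (fun φ : Cfg P j N => weight C η w c (m2 / 2) (0 : VecField P j ℝ) φ * |g φ|) :=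
    (expGrowth_abs hg).integrable C η w c (m2 / 2) hw (by linarith)
  refine (hmaj.const_mul (Real.exp K)).mono' ?_ ?_
  · exact ((B3WT224Instance.continuous_weight C η w c m2 _).mul
      ((Real.continuous_exp.comp (((continuous_const.mul hV.1).add
        ((continuous_const.mul (continuous_const.mul hQ.1)))).neg)).mul hg.1)).aestronglyMeasurable
  · refine Filter.Eventually.of_forall fun φ => ?_
    have hexp := exp_neg_exponent_le w m2 hw.le hK hVK (κ := κ) hlam0 hlam1 hlamκ φ
    have hWpos : 0 < weight C η w c m2 (0 : VecField P j ℝ) φ := weight_pos _ φ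
    rw [Real.norm_eq_abs, abs_mul, abs_mul, abs_of_pos hWpos, abs_of_pos (Real.exp_pos _)]
    calc weight C η w c m2 (0 : VecField P j ℝ) φ * (Real.exp (-(lam * V φ + lam ^ 2 * (κ * massForm w φ))) * |g φ|)
        ≤ weight C η w c m2 (0 : VecField P j ℝ) φ * (Real.exp K * Real.exp (m2 / 4 * massForm w φ) * |g φ|) :=
          mul_le_mul_of_nonneg_left (mul_le_mul_of_nonneg_right hexp (abs_nonneg _)) hWpos.le
      _ = Real.exp K * (weight C η w c (m2 / 2) (0 : VecField P j ℝ) φ * |g φ|) := by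
          rw [← weight_mul_exp_quarter_mass C η w c m2 φ]; ring

/-- at `λ = 0` the moments are the free Gaussian integrals `∫W g`. [cite: Balaban1983Higgs3, (1.19) p.416] -/
theorem moment_zero (V g : Cfg P j N → ℝ) (κ : ℝ) :
    (∫ φ, weight C η w c m2 (0 : VecField P j ℝ) φ * (Real.exp (-((0 : ℝ) * V φ + (0 : ℝ) ^ 2 * (κ * massForm w φ))) * g φ)) = ∫ φ, weight C η w c m2 (0 : VecField P j ℝ) φ * g φ := by
  refine integral_congr_ae (Filter.Eventually.of_forall fun φ => ?_)
  show weight C η w c m2 (0 : VecField P j ℝ) φ * (Real.exp (-((0 : ℝ) * V φ + (0 : ℝ) ^ 2 * (κ * massForm w φ))) * g φ) = weight C η w c m2 (0 : VecField P j ℝ) φ * g φ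
  simp

/-- the pointwise derivative of the integrand in `λ`: `∂_λ e^{−(λV+λ²κQ)} = −(V + 2λκQ)e^{−(λV+λ²κQ)}`.
[cite: Balaban1983Higgs3, (1.20) p.416] -/
theorem hasDerivAt_exp_exponent (V : Cfg P j N → ℝ) (κ : ℝ) (φ : Cfg P j N) (lam : ℝ) :
    HasDerivAt (fun l : ℝ => Real.exp (-(l * V φ + l ^ 2 * (κ * massForm w φ))))
      (-(Real.exp (-(lam * V φ + lam ^ 2 * (κ * massForm w φ))) * (V φ + 2 * lam * (κ * massForm w φ)))) lam := by
  have h1 : HasDerivAt (fun l : ℝ => -(l * V φ + l ^ 2 * (κ * massForm w φ)))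
      (-(V φ + 2 * lam * (κ * massForm w φ))) lam := by
    have h := (((hasDerivAt_id lam).mul_const (V φ)).add ((hasDerivAt_pow 2 lam).mul_const (κ * massForm w φ))).neg
    refine h.congr_deriv ?_
    simp only [Nat.cast_ofNat, Nat.add_one_sub_one, pow_one, one_mul]
  have h2 := h1.exp
  refine h2.congr_deriv ?_
  ring

/-- **DIFFERENTIATION UNDER `∫dφ` AT `0 < λ₀ < L` (two-sided)**: `λ ↦ ∫We^{−(λV+λ²κQ)}g` has derivative
`−∫We^{−(λ₀V+λ₀²κQ)}(V + 2λ₀κQ)g` at `λ₀` — dominated differentiation on `(λ₀/2, L)` with the majorant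
`e^{K}·W_{m²/2}·(∣V∣ + 2∣κ∣Q)∣g∣` (the quadratic part of the exponent absorbed at half the mass).
[cite: Balaban1983Higgs3, (1.19)–(1.21) p.416] [cite: GlimmJaffeQP1987, §8.4–8.5] -/
theorem hasDerivAt_moment (hw : 0 < w) (hm : 0 < m2) {V g : Cfg P j N → ℝ} (hV : ExpGrowth V) {K : ℝ} (hK : 0 ≤ K)
    (hVK : ∀ φ, -K ≤ V φ) (hg : ExpGrowth g) {κ L lam0 : ℝ} (hL1 : L ≤ 1) (hLκ : L * |κ| ≤ m2 / 4)
    (hlam0 : 0 < lam0) (hlamL : lam0 < L) :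
    HasDerivAt (fun lam : ℝ => ∫ φ, weight C η w c m2 (0 : VecField P j ℝ) φ * (Real.exp (-(lam * V φ + lam ^ 2 * (κ * massForm w φ))) * g φ))
      (-(∫ φ, weight C η w c m2 (0 : VecField P j ℝ) φ * (Real.exp (-(lam0 * V φ + lam0 ^ 2 * (κ * massForm w φ)))
        * ((V φ + 2 * lam0 * (κ * massForm w φ)) * g φ)))) lam0 := by
  have hQ := (expGrowth_V_add_massForm (P := P) (j := j) (N := N) w 0).2
  have hWc : Continuous (fun φ : Cfg P j N => weight C η w c m2 (0 : VecField P j ℝ) φ) := B3WT224Instance.continuous_weight C η w c m2 _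
  have hexpc : ∀ lam : ℝ, Continuous (fun φ : Cfg P j N => Real.exp (-(lam * V φ + lam ^ 2 * (κ * massForm w φ)))) :=
    fun lam => Real.continuous_exp.comp (((continuous_const.mul hV.1).add
      ((continuous_const.mul (continuous_const.mul hQ.1)))).neg)
  have hcont : ∀ lam : ℝ, Continuous (fun φ : Cfg P j N =>
      weight C η w c m2 (0 : VecField P j ℝ) φ * (Real.exp (-(lam * V φ + lam ^ 2 * (κ * massForm w φ))) * g φ)) := fun lam =>
    hWc.mul ((hexpc lam).mul hg.1)
  have hcont' : ∀ lam : ℝ, Continuous (fun φ : Cfg P j N =>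
      weight C η w c m2 (0 : VecField P j ℝ) φ * (-(Real.exp (-(lam * V φ + lam ^ 2 * (κ * massForm w φ))))
        * ((V φ + 2 * lam * (κ * massForm w φ)) * g φ))) := fun lam =>
    hWc.mul ((hexpc lam).neg.mul ((hV.1.add (continuous_const.mul (continuous_const.mul hQ.1))).mul hg.1))
  -- the λ-independent majorant
  have hVQg : ExpGrowth (fun φ : Cfg P j N => (|V φ| + 2 * |κ| * massForm w φ) * |g φ|) :=
    ((expGrowth_abs hV).add (hQ.const_mul (2 * |κ|))).mul (expGrowth_abs hg)
  have hmaj : Integrable (fun φ : Cfg P j N => Real.exp K *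
      (weight C η w c (m2 / 2) (0 : VecField P j ℝ) φ * ((|V φ| + 2 * |κ| * massForm w φ) * |g φ|))) :=
    (hVQg.integrable C η w c (m2 / 2) hw (by linarith)).const_mul _
  have hs : Set.Ioo (lam0 / 2) L ∈ 𝓝 lam0 := Ioo_mem_nhds (by linarith) hlamL
  have hint := integrable_moment C η w c m2 hw hm hV hK hVK hg (κ := κ) hlam0.le (by linarith)
    (le_trans (mul_le_mul_of_nonneg_right hlamL.le (abs_nonneg κ)) hLκ)
  have h := hasDerivAt_integral_of_dominated_loc_of_deriv_le (μ := volume)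
    (bound := fun φ => Real.exp K *
      (weight C η w c (m2 / 2) (0 : VecField P j ℝ) φ * ((|V φ| + 2 * |κ| * massForm w φ) * |g φ|)))
    (F := fun lam φ => weight C η w c m2 (0 : VecField P j ℝ) φ * (Real.exp (-(lam * V φ + lam ^ 2 * (κ * massForm w φ))) * g φ))
    (F' := fun lam φ => weight C η w c m2 (0 : VecField P j ℝ) φ * (-(Real.exp (-(lam * V φ + lam ^ 2 * (κ * massForm w φ))))
        * ((V φ + 2 * lam * (κ * massForm w φ)) * g φ))) hs
    (Filter.Eventually.of_forall fun lam => (hcont lam).aestronglyMeasurable) hint (hcont' lam0).aestronglyMeasurable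
    ?_ hmaj ?_
  · have e : (∫ φ : Cfg P j N, weight C η w c m2 (0 : VecField P j ℝ) φ * (-(Real.exp (-(lam0 * V φ + lam0 ^ 2 * (κ * massForm w φ))))
        * ((V φ + 2 * lam0 * (κ * massForm w φ)) * g φ)))
        = -(∫ φ, weight C η w c m2 (0 : VecField P j ℝ) φ * (Real.exp (-(lam0 * V φ + lam0 ^ 2 * (κ * massForm w φ)))
            * ((V φ + 2 * lam0 * (κ * massForm w φ)) * g φ))) := by
      rw [← integral_neg]
      exact integral_congr_ae (Filter.Eventually.of_forall fun φ => by ring)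
    rw [← e]
    exact h.2
  · refine Filter.Eventually.of_forall fun φ lam hlam => ?_
    obtain ⟨hlaml, hlamu⟩ := hlam
    have hl0 : 0 ≤ lam := by linarith
    have hl1 : lam ≤ 1 := by linarith
    have hlκ : lam * |κ| ≤ m2 / 4 := le_trans (mul_le_mul_of_nonneg_right hlamu.le (abs_nonneg κ)) hLκ
    have hexp := exp_neg_exponent_le w m2 hw.le hK hVK (κ := κ) hl0 hl1 hlκ φ
    have hWpos : 0 < weight C η w c m2 (0 : VecField P j ℝ) φ := weight_pos _ φ
    have hQ0 : 0 ≤ massForm w φ := massForm_nonneg hw.le φ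
    have hfac : |V φ + 2 * lam * (κ * massForm w φ)| ≤ |V φ| + 2 * |κ| * massForm w φ := by
      have e1 : |2 * lam * (κ * massForm w φ)| = 2 * lam * (|κ| * massForm w φ) := by
        rw [show 2 * lam * (κ * massForm w φ) = (2 * lam * massForm w φ) * κ by ring, abs_mul,
          abs_of_nonneg (mul_nonneg (mul_nonneg zero_le_two hl0) hQ0)]
        ring
      calc |V φ + 2 * lam * (κ * massForm w φ)| ≤ |V φ| + |2 * lam * (κ * massForm w φ)| := abs_add_le _ _
        _ = |V φ| + 2 * lam * (|κ| * massForm w φ) := by rw [e1]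
        _ ≤ |V φ| + 2 * 1 * (|κ| * massForm w φ) := by
            have : 0 ≤ |κ| * massForm w φ := mul_nonneg (abs_nonneg κ) hQ0
            nlinarith
        _ = |V φ| + 2 * |κ| * massForm w φ := by ring
    rw [Real.norm_eq_abs, abs_mul, abs_mul, abs_neg, abs_mul, abs_of_pos hWpos, abs_of_pos (Real.exp_pos _)]
    calc weight C η w c m2 (0 : VecField P j ℝ) φ * (Real.exp (-(lam * V φ + lam ^ 2 * (κ * massForm w φ))) * (|V φ + 2 * lam * (κ * massForm w φ)| * |g φ|))
        ≤ weight C η w c m2 (0 : VecField P j ℝ) φ * ((Real.exp K * Real.exp (m2 / 4 * massForm w φ)) * ((|V φ| + 2 * |κ| * massForm w φ) * |g φ|)) := by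
          refine mul_le_mul_of_nonneg_left ?_ hWpos.le
          exact mul_le_mul hexp (mul_le_mul_of_nonneg_right hfac (abs_nonneg _))
            (mul_nonneg (abs_nonneg _) (abs_nonneg _)) (by positivity)
      _ = Real.exp K * (weight C η w c (m2 / 2) (0 : VecField P j ℝ) φ * ((|V φ| + 2 * |κ| * massForm w φ) * |g φ|)) := by
          rw [← weight_mul_exp_quarter_mass C η w c m2 φ]; ring
  · refine Filter.Eventually.of_forall fun φ lam _ => ?_
    have h2 := hasDerivAt_exp_exponent w V κ φ lam
    refine ((h2.mul_const (g φ)).const_mul (weight C η w c m2 (0 : VecField P j ℝ) φ)).congr_deriv ?_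
    ring

/-- **ONE-SIDED DIFFERENTIATION UNDER `∫dφ` AT `λ = 0⁺`**: `λ ↦ ∫We^{−(λV+λ²κQ)}g` (`λ ≥ 0`) has right-derivative `−∫WVg` at
`0` — dominated convergence of the difference quotients on `0 < λ < L` (`∣(e^{−u} − 1)/λ∣ ≤ (∣V∣ + ∣κ∣Q)·e^{K}e^{(m²/4)Q}`,
`u = λV + λ²κQ`); one-sided because `e^{−λV}` is not integrable for `λ < 0` when `V` is quartic.
[cite: Balaban1983Higgs3, (1.19)–(1.21) p.416] [cite: GlimmJaffeQP1987, §8.4–8.5] -/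
theorem hasDerivWithinAt_moment_zero (hw : 0 < w) (hm : 0 < m2) {V g : Cfg P j N → ℝ} (hV : ExpGrowth V) {K : ℝ}
    (hK : 0 ≤ K) (hVK : ∀ φ, -K ≤ V φ) (hg : ExpGrowth g) {κ L : ℝ} (hL0 : 0 < L) (hL1 : L ≤ 1)
    (hLκ : L * |κ| ≤ m2 / 4) :
    HasDerivWithinAt (fun lam : ℝ => ∫ φ, weight C η w c m2 (0 : VecField P j ℝ) φ * (Real.exp (-(lam * V φ + lam ^ 2 * (κ * massForm w φ))) * g φ))
      (-(∫ φ, weight C η w c m2 (0 : VecField P j ℝ) φ * (V φ * g φ))) (Set.Ici 0) 0 := by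
  have hQ := (expGrowth_V_add_massForm (P := P) (j := j) (N := N) w 0).2
  have hWg : Integrable (fun φ : Cfg P j N => weight C η w c m2 (0 : VecField P j ℝ) φ * g φ) := hg.integrable C η w c m2 hw hm
  have hWVg : Integrable (fun φ : Cfg P j N => weight C η w c m2 (0 : VecField P j ℝ) φ * (V φ * g φ)) := (hV.mul hg).integrable C η w c m2 hw hm
  have hIlam : ∀ lam : ℝ, 0 ≤ lam → lam < L →
      Integrable (fun φ : Cfg P j N => weight C η w c m2 (0 : VecField P j ℝ) φ * (Real.exp (-(lam * V φ + lam ^ 2 * (κ * massForm w φ))) * g φ)) :=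
    fun lam h0 hL => integrable_moment C η w c m2 hw hm hV hK hVK hg (κ := κ) h0 (by linarith)
      (le_trans (mul_le_mul_of_nonneg_right hL.le (abs_nonneg κ)) hLκ)
  have hI : Set.Ici (0 : ℝ) \ {0} = Set.Ioi 0 := by
    ext t
    simp only [Set.mem_sdiff, Set.mem_Ici, Set.mem_singleton_iff, Set.mem_Ioi]
    exact ⟨fun h => lt_of_le_of_ne h.1 (Ne.symm h.2), fun h => ⟨h.le, h.ne'⟩⟩
  rw [hasDerivWithinAt_iff_tendsto_slope, hI]
  have hsmall : Set.Ioo (0 : ℝ) L ∈ 𝓝[Set.Ioi (0 : ℝ)] 0 := Ioo_mem_nhdsGT hL0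
  -- the difference quotients as integrals (for `0 < λ < L`)
  have hslope : ∀ lam : ℝ, 0 < lam → lam < L →
      slope (fun lam : ℝ => ∫ φ, weight C η w c m2 (0 : VecField P j ℝ) φ * (Real.exp (-(lam * V φ + lam ^ 2 * (κ * massForm w φ))) * g φ)) 0 lam =
        ∫ φ, weight C η w c m2 (0 : VecField P j ℝ) φ * (g φ * ((Real.exp (-(lam * V φ + lam ^ 2 * (κ * massForm w φ))) - 1) / lam)) := by
    intro lam hlam hlamL
    rw [slope_def_field, sub_zero, moment_zero]
    rw [← integral_sub (hIlam lam hlam.le hlamL) hWg, ← integral_div]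
    refine integral_congr_ae (Filter.Eventually.of_forall fun φ => ?_)
    show (weight C η w c m2 (0 : VecField P j ℝ) φ * (Real.exp (-(lam * V φ + lam ^ 2 * (κ * massForm w φ))) * g φ) - weight C η w c m2 (0 : VecField P j ℝ) φ * g φ) / lam
      = weight C η w c m2 (0 : VecField P j ℝ) φ * (g φ * ((Real.exp (-(lam * V φ + lam ^ 2 * (κ * massForm w φ))) - 1) / lam))
    field_simp
  have hev : (fun lam => ∫ φ, weight C η w c m2 (0 : VecField P j ℝ) φ * (g φ * ((Real.exp (-(lam * V φ + lam ^ 2 * (κ * massForm w φ))) - 1) / lam)))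
      =ᶠ[𝓝[Set.Ioi (0 : ℝ)] 0]
      slope (fun lam : ℝ => ∫ φ, weight C η w c m2 (0 : VecField P j ℝ) φ * (Real.exp (-(lam * V φ + lam ^ 2 * (κ * massForm w φ))) * g φ)) 0 :=
    Filter.mem_of_superset hsmall fun lam hlam => (hslope lam hlam.1 hlam.2).symm
  refine Filter.Tendsto.congr' hev ?_
  have hlim : (-(∫ φ, weight C η w c m2 (0 : VecField P j ℝ) φ * (V φ * g φ))) = ∫ φ, weight C η w c m2 (0 : VecField P j ℝ) φ * (g φ * (-V φ)) := by
    rw [← integral_neg]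
    exact integral_congr_ae (Filter.Eventually.of_forall fun φ => by ring)
  rw [hlim]
  have hVQg : ExpGrowth (fun φ : Cfg P j N => (|V φ| + |κ| * massForm w φ) * |g φ|) :=
    ((expGrowth_abs hV).add (hQ.const_mul |κ|)).mul (expGrowth_abs hg)
  have hmaj : Integrable (fun φ : Cfg P j N => Real.exp K *
      (weight C η w c (m2 / 2) (0 : VecField P j ℝ) φ * ((|V φ| + |κ| * massForm w φ) * |g φ|))) :=
    (hVQg.integrable C η w c (m2 / 2) hw (by linarith)).const_mul _
  refine tendsto_integral_filter_of_dominated_convergence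
    (fun φ => Real.exp K * (weight C η w c (m2 / 2) (0 : VecField P j ℝ) φ * ((|V φ| + |κ| * massForm w φ) * |g φ|)))
    ?_ ?_ hmaj ?_
  · filter_upwards [hsmall] with lam _
    exact (hWg.aestronglyMeasurable.mul (((Real.continuous_exp.comp (((continuous_const.mul hV.1).add
      ((continuous_const.mul (continuous_const.mul hQ.1)))).neg)).sub continuous_const).div_const
        lam).aestronglyMeasurable).congr (Filter.Eventually.of_forall fun φ => by
        show weight C η w c m2 (0 : VecField P j ℝ) φ * g φ * ((Real.exp (-(lam * V φ + lam ^ 2 * (κ * massForm w φ))) - 1) / lam)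
          = weight C η w c m2 (0 : VecField P j ℝ) φ * (g φ * ((Real.exp (-(lam * V φ + lam ^ 2 * (κ * massForm w φ))) - 1) / lam))
        ring)
  · filter_upwards [hsmall] with lam hlam'
    obtain ⟨hlam, hlamL⟩ := hlam'
    refine Filter.Eventually.of_forall fun φ => ?_
    have hl1 : lam ≤ 1 := by linarith
    have hlκ : lam * |κ| ≤ m2 / 4 := le_trans (mul_le_mul_of_nonneg_right hlamL.le (abs_nonneg κ)) hLκ
    have hexp := exp_neg_exponent_le w m2 hw.le hK hVK (κ := κ) hlam.le hl1 hlκ φ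
    have hWpos : 0 < weight C η w c m2 (0 : VecField P j ℝ) φ := weight_pos _ φ
    have hQ0 : 0 ≤ massForm w φ := massForm_nonneg hw.le φ
    have hmax : max 1 (Real.exp (-(lam * V φ + lam ^ 2 * (κ * massForm w φ))))
        ≤ Real.exp K * Real.exp (m2 / 4 * massForm w φ) := by
      refine max_le ?_ hexp
      have h1 : 1 ≤ Real.exp K := Real.one_le_exp hK
      have h2 : 1 ≤ Real.exp (m2 / 4 * massForm w φ) := Real.one_le_exp (by positivity)
      nlinarith
    have hq : |(Real.exp (-(lam * V φ + lam ^ 2 * (κ * massForm w φ))) - 1) / lam|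
        ≤ (|V φ| + |κ| * massForm w φ) * (Real.exp K * Real.exp (m2 / 4 * massForm w φ)) := by
      rw [abs_div, abs_of_pos hlam, div_le_iff₀ hlam]
      have hu := abs_exp_neg_sub_one_le_max (lam * V φ + lam ^ 2 * (κ * massForm w φ))
      have hul : |lam * V φ + lam ^ 2 * (κ * massForm w φ)| ≤ lam * (|V φ| + |κ| * massForm w φ) := by
        calc |lam * V φ + lam ^ 2 * (κ * massForm w φ)| ≤ |lam * V φ| + |lam ^ 2 * (κ * massForm w φ)| := abs_add_le _ _
          _ = lam * |V φ| + lam ^ 2 * (|κ| * massForm w φ) := by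
              rw [abs_mul, abs_mul, abs_mul, abs_of_pos hlam, abs_of_nonneg (sq_nonneg lam), abs_of_nonneg hQ0]
          _ ≤ lam * |V φ| + lam * (|κ| * massForm w φ) := by
              have h0 : 0 ≤ |κ| * massForm w φ := mul_nonneg (abs_nonneg κ) hQ0
              have h2 : lam ^ 2 * (|κ| * massForm w φ) ≤ lam * (|κ| * massForm w φ) :=
                mul_le_mul_of_nonneg_right (by nlinarith) h0
              linarith
          _ = lam * (|V φ| + |κ| * massForm w φ) := by ring
      have hm0 : 0 ≤ max 1 (Real.exp (-(lam * V φ + lam ^ 2 * (κ * massForm w φ)))) := le_trans zero_le_one (le_max_left _ _)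
      calc |Real.exp (-(lam * V φ + lam ^ 2 * (κ * massForm w φ))) - 1|
          ≤ |lam * V φ + lam ^ 2 * (κ * massForm w φ)| * max 1 (Real.exp (-(lam * V φ + lam ^ 2 * (κ * massForm w φ)))) := hu
        _ ≤ (lam * (|V φ| + |κ| * massForm w φ)) * (Real.exp K * Real.exp (m2 / 4 * massForm w φ)) :=
            mul_le_mul hul hmax hm0 (by positivity)
        _ = (|V φ| + |κ| * massForm w φ) * (Real.exp K * Real.exp (m2 / 4 * massForm w φ)) * lam := by ring
    rw [Real.norm_eq_abs, abs_mul, abs_mul, abs_of_pos hWpos]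
    calc weight C η w c m2 (0 : VecField P j ℝ) φ * (|g φ| * |(Real.exp (-(lam * V φ + lam ^ 2 * (κ * massForm w φ))) - 1) / lam|)
        ≤ weight C η w c m2 (0 : VecField P j ℝ) φ * (|g φ| * ((|V φ| + |κ| * massForm w φ) * (Real.exp K * Real.exp (m2 / 4 * massForm w φ)))) :=
          mul_le_mul_of_nonneg_left (mul_le_mul_of_nonneg_left hq (abs_nonneg _)) hWpos.le
      _ = Real.exp K * (weight C η w c (m2 / 2) (0 : VecField P j ℝ) φ * ((|V φ| + |κ| * massForm w φ) * |g φ|)) := by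
          rw [← weight_mul_exp_quarter_mass C η w c m2 φ]; ring
  · refine Filter.Eventually.of_forall fun φ => ?_
    have hd : HasDerivAt (fun lam : ℝ => Real.exp (-(lam * V φ + lam ^ 2 * (κ * massForm w φ)))) (-V φ) 0 := by
      have h := hasDerivAt_exp_exponent w V κ φ 0
      refine h.congr_deriv ?_
      simp
    have ht : Tendsto (slope (fun lam : ℝ => Real.exp (-(lam * V φ + lam ^ 2 * (κ * massForm w φ)))) 0)
        (𝓝[Set.Ioi (0:ℝ)] 0) (𝓝 (-V φ)) := by
      have h := hasDerivAt_iff_tendsto_slope.mp hd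
      exact h.mono_left (nhdsWithin_mono _ fun t (ht : 0 < t) => ne_of_gt ht)
    have ht' : Tendsto (fun lam : ℝ => (Real.exp (-(lam * V φ + lam ^ 2 * (κ * massForm w φ))) - 1) / lam)
        (𝓝[Set.Ioi (0:ℝ)] 0) (𝓝 (-V φ)) := by
      refine ht.congr' (eventually_nhdsWithin_of_forall fun lam hlam => ?_)
      rw [slope_def_field, sub_zero]
      simp
    exact (ht'.const_mul (g φ)).const_mul (weight C η w c m2 (0 : VecField P j ℝ) φ)

end Moments


/-! ## §3 THE NORMALIZED FAMILY `G(λ) = N_F(λ)/N_1(λ)` ON `0 ≤ λ < L`: its derivative (quotient rule) and THE SECOND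
RIGHT-DERIVATIVE AT `λ = 0⁺` as a cumulant-type Gaussian expression -/

section Ratio


/-- the moments on the whole window `0 ≤ λ₀ < L`: right-derivative within `[0,∞)` (§2 combined; at `λ₀ = 0` the factor
`e^{−(λ₀V+λ₀²κQ)}(V + 2λ₀κQ)` is `V`). [cite: Balaban1983Higgs3, (1.19)–(1.21) p.416] [cite: GlimmJaffeQP1987, §8.4–8.5] -/
theorem hasDerivWithinAt_moment (hw : 0 < w) (hm : 0 < m2) {V g : Cfg P j N → ℝ} (hV : ExpGrowth V) {K : ℝ} (hK : 0 ≤ K)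
    (hVK : ∀ φ, -K ≤ V φ) (hg : ExpGrowth g) {κ L lam0 : ℝ} (hL1 : L ≤ 1) (hLκ : L * |κ| ≤ m2 / 4)
    (hlam0 : 0 ≤ lam0) (hlamL : lam0 < L) :
    HasDerivWithinAt (fun lam : ℝ => ∫ φ, weight C η w c m2 (0 : VecField P j ℝ) φ * (Real.exp (-(lam * V φ + lam ^ 2 * (κ * massForm w φ))) * g φ))
      (-(∫ φ, weight C η w c m2 (0 : VecField P j ℝ) φ * (Real.exp (-(lam0 * V φ + lam0 ^ 2 * (κ * massForm w φ)))
        * ((V φ + 2 * lam0 * (κ * massForm w φ)) * g φ)))) (Set.Ici 0) lam0 := by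
  rcases hlam0.eq_or_lt with h | h
  · subst h
    have h0 := hasDerivWithinAt_moment_zero C η w c m2 hw hm hV hK hVK hg (κ := κ) hlamL hL1 hLκ
    refine h0.congr_deriv ?_
    congr 1
    refine integral_congr_ae (Filter.Eventually.of_forall fun φ => ?_)
    show weight C η w c m2 (0 : VecField P j ℝ) φ * (V φ * g φ) = weight C η w c m2 (0 : VecField P j ℝ) φ * (Real.exp (-(0 * V φ + 0 ^ 2 * (κ * massForm w φ))) * ((V φ + 2 * 0 * (κ * massForm w φ)) * g φ))
    simp
  · exact (hasDerivAt_moment C η w c m2 hw hm hV hK hVK hg hL1 hLκ h hlamL).hasDerivWithinAt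

/-- the normalization `N_1(λ) = ∫We^{−(λV+λ²κQ)} > 0` on the window (positive continuous integrable integrand).
[cite: Balaban1983Higgs3, (1.19) p.416] -/
theorem moment_one_pos (hw : 0 < w) (hm : 0 < m2) {V : Cfg P j N → ℝ} (hV : ExpGrowth V) {K : ℝ} (hK : 0 ≤ K)
    (hVK : ∀ φ, -K ≤ V φ) {κ lam : ℝ} (hlam0 : 0 ≤ lam) (hlam1 : lam ≤ 1) (hlamκ : lam * |κ| ≤ m2 / 4) :
    0 < ∫ φ, weight C η w c m2 (0 : VecField P j ℝ) φ * (Real.exp (-(lam * V φ + lam ^ 2 * (κ * massForm w φ))) * 1) := by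
  have hQ := (expGrowth_V_add_massForm (P := P) (j := j) (N := N) w 0).2
  have hi := integrable_moment C η w c m2 hw hm hV hK hVK (ExpGrowth.const 1) (κ := κ) hlam0 hlam1 hlamκ
  have hptw : ∀ φ : Cfg P j N, 0 < weight C η w c m2 (0 : VecField P j ℝ) φ * (Real.exp (-(lam * V φ + lam ^ 2 * (κ * massForm w φ))) * 1) := fun φ =>
    mul_pos (weight_pos _ φ) (by rw [mul_one]; exact Real.exp_pos _)
  rw [integral_pos_iff_support_of_nonneg (fun φ => (hptw φ).le) hi]
  have hsupp : Function.support (fun φ : Cfg P j N =>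
      weight C η w c m2 (0 : VecField P j ℝ) φ * (Real.exp (-(lam * V φ + lam ^ 2 * (κ * massForm w φ))) * 1)) = Set.univ :=
    Set.eq_univ_iff_forall.mpr fun φ => Function.mem_support.mpr (hptw φ).ne'
  rw [hsupp]
  exact isOpen_univ.measure_pos volume Set.univ_nonempty

/-- linearity used to split the derivative integrand: `∫We^{−E}(V + 2λκQ)g = ∫We^{−E}Vg + 2λκ∫We^{−E}Qg` on the window.
[cite: Balaban1983Higgs3, (1.19) p.416] -/
theorem moment_split (hw : 0 < w) (hm : 0 < m2) {V g : Cfg P j N → ℝ} (hV : ExpGrowth V) {K : ℝ} (hK : 0 ≤ K)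
    (hVK : ∀ φ, -K ≤ V φ) (hg : ExpGrowth g) {κ lam : ℝ} (hlam0 : 0 ≤ lam) (hlam1 : lam ≤ 1) (hlamκ : lam * |κ| ≤ m2 / 4) :
    (∫ φ, weight C η w c m2 (0 : VecField P j ℝ) φ * (Real.exp (-(lam * V φ + lam ^ 2 * (κ * massForm w φ))) * ((V φ + 2 * lam * (κ * massForm w φ)) * g φ)))
      = (∫ φ, weight C η w c m2 (0 : VecField P j ℝ) φ * (Real.exp (-(lam * V φ + lam ^ 2 * (κ * massForm w φ))) * (V φ * g φ)))
        + 2 * lam * κ * ∫ φ, weight C η w c m2 (0 : VecField P j ℝ) φ * (Real.exp (-(lam * V φ + lam ^ 2 * (κ * massForm w φ))) * (massForm w φ * g φ)) := by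
  have hQ := (expGrowth_V_add_massForm (P := P) (j := j) (N := N) w 0).2
  have i1 := integrable_moment C η w c m2 hw hm hV hK hVK (hV.mul hg) (κ := κ) hlam0 hlam1 hlamκ
  have i2 := integrable_moment C η w c m2 hw hm hV hK hVK (hQ.mul hg) (κ := κ) hlam0 hlam1 hlamκ
  rw [← integral_const_mul, ← integral_add i1 (i2.const_mul _)]
  exact integral_congr_ae (Filter.Eventually.of_forall fun φ => by ring)

/-- **THE FIRST DERIVATIVE ON THE WINDOW (quotient rule)**: for `0 ≤ λ₀ < L` the normalized family
`G(λ) = ∫We^{−(λV+λ²κQ)}F / ∫We^{−(λV+λ²κQ)}` has the right-derivative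
`D₁(λ₀) = (−[N_{VF} + 2λ₀κN_{QF}]·N_1 + N_F·[N_V + 2λ₀κN_Q])/N_1²` (all moments at `λ₀`).
[cite: Balaban1983Higgs3, (1.19)–(1.21) p.416] [cite: GlimmJaffeQP1987, §8.4–8.5] -/
theorem hasDerivWithinAt_ratio (hw : 0 < w) (hm : 0 < m2) {V F : Cfg P j N → ℝ} (hV : ExpGrowth V) {K : ℝ} (hK : 0 ≤ K)
    (hVK : ∀ φ, -K ≤ V φ) (hF : ExpGrowth F) {κ L lam0 : ℝ} (hL1 : L ≤ 1) (hLκ : L * |κ| ≤ m2 / 4)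
    (hlam0 : 0 ≤ lam0) (hlamL : lam0 < L) :
    HasDerivWithinAt
      (fun lam : ℝ => (∫ φ, weight C η w c m2 (0 : VecField P j ℝ) φ * (Real.exp (-(lam * V φ + lam ^ 2 * (κ * massForm w φ))) * F φ))
        / ∫ φ, weight C η w c m2 (0 : VecField P j ℝ) φ * (Real.exp (-(lam * V φ + lam ^ 2 * (κ * massForm w φ))) * 1))
      (((-((∫ φ, weight C η w c m2 (0 : VecField P j ℝ) φ * (Real.exp (-(lam0 * V φ + lam0 ^ 2 * (κ * massForm w φ))) * (V φ * F φ)))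
            + 2 * lam0 * κ * ∫ φ, weight C η w c m2 (0 : VecField P j ℝ) φ * (Real.exp (-(lam0 * V φ + lam0 ^ 2 * (κ * massForm w φ))) * (massForm w φ * F φ))))
          * (∫ φ, weight C η w c m2 (0 : VecField P j ℝ) φ * (Real.exp (-(lam0 * V φ + lam0 ^ 2 * (κ * massForm w φ))) * 1))
        + (∫ φ, weight C η w c m2 (0 : VecField P j ℝ) φ * (Real.exp (-(lam0 * V φ + lam0 ^ 2 * (κ * massForm w φ))) * F φ))
          * ((∫ φ, weight C η w c m2 (0 : VecField P j ℝ) φ * (Real.exp (-(lam0 * V φ + lam0 ^ 2 * (κ * massForm w φ))) * (V φ * 1)))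
            + 2 * lam0 * κ * ∫ φ, weight C η w c m2 (0 : VecField P j ℝ) φ * (Real.exp (-(lam0 * V φ + lam0 ^ 2 * (κ * massForm w φ))) * (massForm w φ * 1))))
        / (∫ φ, weight C η w c m2 (0 : VecField P j ℝ) φ * (Real.exp (-(lam0 * V φ + lam0 ^ 2 * (κ * massForm w φ))) * 1)) ^ 2)
      (Set.Ici 0) lam0 := by
  have hlam1 : lam0 ≤ 1 := by linarith
  have hlamκ : lam0 * |κ| ≤ m2 / 4 := le_trans (mul_le_mul_of_nonneg_right hlamL.le (abs_nonneg κ)) hLκ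
  have hnum := hasDerivWithinAt_moment C η w c m2 hw hm hV hK hVK hF hL1 hLκ hlam0 hlamL (κ := κ)
  have hden := hasDerivWithinAt_moment C η w c m2 hw hm hV hK hVK (ExpGrowth.const 1) hL1 hLκ hlam0 hlamL
    (κ := κ)
  have hpos := moment_one_pos C η w c m2 hw hm hV hK hVK (κ := κ) hlam0 hlam1 hlamκ
  have h := hnum.div hden hpos.ne'
  refine h.congr_deriv ?_
  rw [moment_split C η w c m2 hw hm hV hK hVK hF hlam0 hlam1 hlamκ,
    moment_split C η w c m2 hw hm hV hK hVK (ExpGrowth.const 1) hlam0 hlam1 hlamκ]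
  ring

/-- **THE SECOND RIGHT-DERIVATIVE AT `λ = 0⁺`**: the quotient-rule expression `D₁(λ)` of `hasDerivWithinAt_ratio` is
right-differentiable at `0` with derivative the cumulant-type Gaussian expression
`E[V²F] − E[F]E[V²] − 2E[V]E[VF] + 2E[F]E[V]² − 2κ(E[QF] − E[F]E[Q])` (`E = Z^{−1}∫W·`): the second Taylor coefficient (times
`2!`) of the normalized family at `0⁺` — the third joint cumulant `⟨F;V;V⟩` of the linear part of the exponent and the covariance
`−2κ⟨F;Q⟩` of its quadratic part. [cite: Balaban1983Higgs3, (1.21) p.416] [cite: GlimmJaffeQP1987, §8.4–8.5] -/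
theorem hasDerivWithinAt_D1_zero (hw : 0 < w) (hm : 0 < m2) {V F : Cfg P j N → ℝ} (hV : ExpGrowth V) {K : ℝ} (hK : 0 ≤ K)
    (hVK : ∀ φ, -K ≤ V φ) (hF : ExpGrowth F) {κ L : ℝ} (hL0 : 0 < L) (hL1 : L ≤ 1) (hLκ : L * |κ| ≤ m2 / 4) :
    HasDerivWithinAt
      (fun lam : ℝ =>
        (((-((∫ φ, weight C η w c m2 (0 : VecField P j ℝ) φ * (Real.exp (-(lam * V φ + lam ^ 2 * (κ * massForm w φ))) * (V φ * F φ)))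
              + 2 * lam * κ * ∫ φ, weight C η w c m2 (0 : VecField P j ℝ) φ * (Real.exp (-(lam * V φ + lam ^ 2 * (κ * massForm w φ))) * (massForm w φ * F φ))))
            * (∫ φ, weight C η w c m2 (0 : VecField P j ℝ) φ * (Real.exp (-(lam * V φ + lam ^ 2 * (κ * massForm w φ))) * 1))
          + (∫ φ, weight C η w c m2 (0 : VecField P j ℝ) φ * (Real.exp (-(lam * V φ + lam ^ 2 * (κ * massForm w φ))) * F φ))
            * ((∫ φ, weight C η w c m2 (0 : VecField P j ℝ) φ * (Real.exp (-(lam * V φ + lam ^ 2 * (κ * massForm w φ))) * (V φ * 1)))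
              + 2 * lam * κ * ∫ φ, weight C η w c m2 (0 : VecField P j ℝ) φ * (Real.exp (-(lam * V φ + lam ^ 2 * (κ * massForm w φ))) * (massForm w φ * 1))))
          / (∫ φ, weight C η w c m2 (0 : VecField P j ℝ) φ * (Real.exp (-(lam * V φ + lam ^ 2 * (κ * massForm w φ))) * 1)) ^ 2))
      ((∫ φ, weight C η w c m2 (0 : VecField P j ℝ) φ * (V φ ^ 2 * F φ)) / (∫ φ, weight C η w c m2 (0 : VecField P j ℝ) φ)
        - (∫ φ, weight C η w c m2 (0 : VecField P j ℝ) φ * F φ) * (∫ φ, weight C η w c m2 (0 : VecField P j ℝ) φ * V φ ^ 2) / (∫ φ, weight C η w c m2 (0 : VecField P j ℝ) φ) ^ 2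
        - 2 * (∫ φ, weight C η w c m2 (0 : VecField P j ℝ) φ * V φ) * (∫ φ, weight C η w c m2 (0 : VecField P j ℝ) φ * (V φ * F φ)) / (∫ φ, weight C η w c m2 (0 : VecField P j ℝ) φ) ^ 2
        + 2 * (∫ φ, weight C η w c m2 (0 : VecField P j ℝ) φ * F φ) * (∫ φ, weight C η w c m2 (0 : VecField P j ℝ) φ * V φ) ^ 2 / (∫ φ, weight C η w c m2 (0 : VecField P j ℝ) φ) ^ 3
        - 2 * κ * ((∫ φ, weight C η w c m2 (0 : VecField P j ℝ) φ * (massForm w φ * F φ)) / (∫ φ, weight C η w c m2 (0 : VecField P j ℝ) φ)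
            - (∫ φ, weight C η w c m2 (0 : VecField P j ℝ) φ * F φ) * (∫ φ, weight C η w c m2 (0 : VecField P j ℝ) φ * massForm w φ) / (∫ φ, weight C η w c m2 (0 : VecField P j ℝ) φ) ^ 2))
      (Set.Ici 0) 0 := by
  have hQ := (expGrowth_V_add_massForm (P := P) (j := j) (N := N) w 0).2
  -- the six moments entering `D₁` and their right-derivatives at `0⁺`
  have hVF := hasDerivWithinAt_moment_zero C η w c m2 hw hm hV hK hVK (hV.mul hF) (κ := κ) hL0 hL1 hLκ
  have hQF := hasDerivWithinAt_moment_zero C η w c m2 hw hm hV hK hVK (hQ.mul hF) (κ := κ) hL0 hL1 hLκ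
  have h1 := hasDerivWithinAt_moment_zero C η w c m2 hw hm hV hK hVK (ExpGrowth.const 1) (κ := κ) hL0
    hL1 hLκ
  have hFd := hasDerivWithinAt_moment_zero C η w c m2 hw hm hV hK hVK hF (κ := κ) hL0 hL1 hLκ
  have hV1 := hasDerivWithinAt_moment_zero C η w c m2 hw hm hV hK hVK (hV.mul (ExpGrowth.const 1))
    (κ := κ) hL0 hL1 hLκ
  have hQ1 := hasDerivWithinAt_moment_zero C η w c m2 hw hm hV hK hVK (hQ.mul (ExpGrowth.const 1))
    (κ := κ) hL0 hL1 hLκ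
  have hlin : HasDerivWithinAt (fun lam : ℝ => 2 * lam * κ) (2 * κ) (Set.Ici 0) 0 := by
    have h := ((hasDerivAt_id (0 : ℝ)).const_mul 2).mul_const κ
    simpa using h.hasDerivWithinAt
  have hZ : 0 < ∫ φ, weight C η w c m2 (0 : VecField P j ℝ) φ := B3WT226Traces.Z_pos C η w c m2 hw hm
  have hden0 : (∫ φ : Cfg P j N, weight C η w c m2 (0 : VecField P j ℝ) φ * (Real.exp (-(0 * V φ + 0 ^ 2 * (κ * massForm w φ))) * 1)) = ∫ φ, weight C η w c m2 (0 : VecField P j ℝ) φ := by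
    rw [moment_zero]; simp only [mul_one]
  have hA := (hVF.add (hlin.mul hQF)).neg
  have hB := hV1.add (hlin.mul hQ1)
  have h := ((hA.mul h1).add (hFd.mul hB)).div (h1.pow 2) (by
    show (∫ φ : Cfg P j N, weight C η w c m2 (0 : VecField P j ℝ) φ * (Real.exp (-(0 * V φ + 0 ^ 2 * (κ * massForm w φ))) * 1)) ^ 2 ≠ 0
    rw [hden0]; exact pow_ne_zero 2 hZ.ne')
  refine h.congr_deriv ?_
  simp only [Pi.pow_apply, Pi.neg_apply, Pi.mul_apply, Pi.add_apply, moment_zero]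
  simp only [zero_mul, mul_zero, add_zero, mul_one]
  have e1 : (∫ φ : Cfg P j N, weight C η w c m2 (0 : VecField P j ℝ) φ * (V φ * (V φ * F φ))) = ∫ φ, weight C η w c m2 (0 : VecField P j ℝ) φ * (V φ ^ 2 * F φ) :=
    integral_congr_ae (Filter.Eventually.of_forall fun φ => by ring)
  have e2 : (∫ φ : Cfg P j N, weight C η w c m2 (0 : VecField P j ℝ) φ * (V φ * V φ)) = ∫ φ, weight C η w c m2 (0 : VecField P j ℝ) φ * V φ ^ 2 :=
    integral_congr_ae (Filter.Eventually.of_forall fun φ => by ring)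
  rw [e1, e2]
  set Z : ℝ := ∫ φ, weight C η w c m2 (0 : VecField P j ℝ) φ with hZdef
  set IF : ℝ := ∫ φ, weight C η w c m2 (0 : VecField P j ℝ) φ * F φ
  set IV : ℝ := ∫ φ, weight C η w c m2 (0 : VecField P j ℝ) φ * V φ
  set IVF : ℝ := ∫ φ, weight C η w c m2 (0 : VecField P j ℝ) φ * (V φ * F φ)
  set IV2F : ℝ := ∫ φ, weight C η w c m2 (0 : VecField P j ℝ) φ * (V φ ^ 2 * F φ)
  set IV2 : ℝ := ∫ φ, weight C η w c m2 (0 : VecField P j ℝ) φ * V φ ^ 2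
  set IQF : ℝ := ∫ φ, weight C η w c m2 (0 : VecField P j ℝ) φ * (massForm w φ * F φ)
  set IQ : ℝ := ∫ φ, weight C η w c m2 (0 : VecField P j ℝ) φ * massForm w φ
  have hZne : Z ≠ 0 := hZ.ne'
  field_simp
  ring

end Ratio


/-! ## §4 WICK'S THEOREM FOR THE MASS VERTEX `Σ_zη^d∣φ(z)∣²` (the counterterm vertex (1.7)) against the two legs, against the
quartic vertex and against itself — through BRICK 1's Wick-ordered kernels (`∣φ(z)∣² = :∣φ(z)∣²: + N·C(z,z)`) -/

section WickMass


/-- linearity of the Gaussian integral on four observables (bookkeeping helper). [cite: GlimmJaffeQP1987, §8.3] -/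
theorem integral_W_lin4 (hw : 0 < w) (hm : 0 < m2) {g₁ g₂ g₃ g₄ : Cfg P j N → ℝ} (h₁ : ExpGrowth g₁) (h₂ : ExpGrowth g₂)
    (h₃ : ExpGrowth g₃) (h₄ : ExpGrowth g₄) (c₁ c₂ c₃ c₄ : ℝ) :
    ∫ φ, weight C η w c m2 (0 : VecField P j ℝ) φ * (c₁ * g₁ φ + c₂ * g₂ φ + c₃ * g₃ φ + c₄ * g₄ φ)
      = c₁ * (∫ φ, weight C η w c m2 (0 : VecField P j ℝ) φ * g₁ φ) + c₂ * (∫ φ, weight C η w c m2 (0 : VecField P j ℝ) φ * g₂ φ) + c₃ * (∫ φ, weight C η w c m2 (0 : VecField P j ℝ) φ * g₃ φ) + c₄ * (∫ φ, weight C η w c m2 (0 : VecField P j ℝ) φ * g₄ φ) := by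
  have h123 : ExpGrowth (fun φ : Cfg P j N => c₁ * g₁ φ + c₂ * g₂ φ + c₃ * g₃ φ) :=
    ((h₁.const_mul c₁).add (h₂.const_mul c₂)).add (h₃.const_mul c₃)
  have i123 := h123.integrable C η w c m2 hw hm
  have i₄ := (h₄.const_mul c₄).integrable C η w c m2 hw hm
  have e : (fun φ : Cfg P j N => weight C η w c m2 (0 : VecField P j ℝ) φ * (c₁ * g₁ φ + c₂ * g₂ φ + c₃ * g₃ φ + c₄ * g₄ φ))
      = fun φ => weight C η w c m2 (0 : VecField P j ℝ) φ * (c₁ * g₁ φ + c₂ * g₂ φ + c₃ * g₃ φ) + weight C η w c m2 (0 : VecField P j ℝ) φ * (c₄ * g₄ φ) := by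
    funext φ; ring
  have e4 : (∫ φ : Cfg P j N, weight C η w c m2 (0 : VecField P j ℝ) φ * (c₄ * g₄ φ)) = c₄ * ∫ φ, weight C η w c m2 (0 : VecField P j ℝ) φ * g₄ φ := by
    rw [← integral_const_mul]; exact integral_congr_ae (Filter.Eventually.of_forall fun φ => by ring)
  rw [e, integral_add i123 i₄, integral_W_lin3 C η w c m2 hw hm h₁ h₂ h₃, e4]

/-- `∣φ(z)∣² = :∣φ(z)∣²: + N·C(z,z)`. [cite: GlimmJaffeQP1987, (9.1.5)] -/
theorem norm_sq_eq_wick2 (z : Site P j) (φ : Cfg P j N) : ‖φ z‖ ^ 2 = wick2 w c m2 z φ + N * G w c m2 z z := by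
  rw [wick2_def]; ring

omit C η c m2 in
/-- `∣φ(z)∣⁴` has exponential-linear growth. [cite: Balaban1983Higgs3, (1.20) p.416] -/
theorem expGrowth_norm_four (z : Site P j) : ExpGrowth (fun φ : Cfg P j N => ‖φ z‖ ^ 4) := by
  have e : (fun φ : Cfg P j N => ‖φ z‖ ^ 4) = fun φ => ‖φ z‖ ^ 2 * ‖φ z‖ ^ 2 := by funext φ; ring
  rw [e]; exact (ExpGrowth.norm_sq_apply z).mul (ExpGrowth.norm_sq_apply z)

/-- **THE MASS VERTEX AGAINST THE TWO (⟪φ x, 𝐞 a⟫_ℝ * ⟪φ x', 𝐞 b⟫_ℝ)**: `∫W∣φ(z)∣²φ_a(x)φ_b(x′) = Z·δ_{ab}·[N·C(z,z)C(x,x′) + 2C(x,z)C(x′,z)]` — the vacuum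
loop times the free line, plus the amputated mass insertion (both legs into the vertex). [cite: Balaban1983Higgs3, (1.21) p.416]
[cite: GlimmJaffeQP1987, Cor. 8.3.2] -/
theorem integral_normSq_legs (hw : 0 < w) (hm : 0 < m2) (a b : Fin N) (x x' z : Site P j) :
    ∫ φ, weight C η w c m2 (0 : VecField P j ℝ) φ * (‖φ z‖ ^ 2 * (⟪φ x, EuclideanSpace.basisFun (Fin N) ℝ a⟫_ℝ * ⟪φ x', EuclideanSpace.basisFun (Fin N) ℝ b⟫_ℝ))
      = (∫ φ, weight C η w c m2 (0 : VecField P j ℝ) φ) * ⟪EuclideanSpace.basisFun (Fin N) ℝ a, EuclideanSpace.basisFun (Fin N) ℝ b⟫_ℝ * (N * G w c m2 z z * G w c m2 x x' + 2 * (G w c m2 x z * G w c m2 x' z)) := by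
  have hF := expGrowth_legs (P := P) (j := j) a b x x'
  have h2z := expGrowth_wick2 (P := P) (j := j) (N := N) w c m2 z
  have e : (fun φ : Cfg P j N => weight C η w c m2 (0 : VecField P j ℝ) φ * (‖φ z‖ ^ 2 * (⟪φ x, EuclideanSpace.basisFun (Fin N) ℝ a⟫_ℝ * ⟪φ x', EuclideanSpace.basisFun (Fin N) ℝ b⟫_ℝ)))
      = fun φ => weight C η w c m2 (0 : VecField P j ℝ) φ * (1 * (wick2 w c m2 z φ * (⟪φ x, EuclideanSpace.basisFun (Fin N) ℝ a⟫_ℝ * ⟪φ x', EuclideanSpace.basisFun (Fin N) ℝ b⟫_ℝ)) + (N * G w c m2 z z) * (⟪φ x, EuclideanSpace.basisFun (Fin N) ℝ a⟫_ℝ * ⟪φ x', EuclideanSpace.basisFun (Fin N) ℝ b⟫_ℝ)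
          + 0 * (1 : ℝ)) := by
    funext φ; rw [norm_sq_eq_wick2 w c m2 z φ]; ring
  rw [show (∫ φ, weight C η w c m2 (0 : VecField P j ℝ) φ * (‖φ z‖ ^ 2 * (⟪φ x, EuclideanSpace.basisFun (Fin N) ℝ a⟫_ℝ * ⟪φ x', EuclideanSpace.basisFun (Fin N) ℝ b⟫_ℝ)))
      = ∫ φ, (fun φ : Cfg P j N => weight C η w c m2 (0 : VecField P j ℝ) φ * (‖φ z‖ ^ 2 * (⟪φ x, EuclideanSpace.basisFun (Fin N) ℝ a⟫_ℝ * ⟪φ x', EuclideanSpace.basisFun (Fin N) ℝ b⟫_ℝ))) φ from rfl, e,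
    integral_W_lin3 C η w c m2 hw hm (h2z.mul hF) hF (ExpGrowth.const 1),
    integral_wick2_legs C η w c m2 hw hm a b x x' z, integral_legs C η w c m2 hw hm a b x x']
  ring

/-- `∫W∣φ(z)∣² = Z·N·C(z,z)` (the vacuum loop). [cite: GlimmJaffeQP1987, Cor. 8.3.2] -/
theorem integral_normSq (hw : 0 < w) (hm : 0 < m2) (z : Site P j) :
    ∫ φ, weight C η w c m2 (0 : VecField P j ℝ) φ * ‖φ z‖ ^ 2 = (∫ φ, weight C η w c m2 (0 : VecField P j ℝ) φ) * (N * G w c m2 z z) := by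
  have h2z := expGrowth_wick2 (P := P) (j := j) (N := N) w c m2 z
  have e : (fun φ : Cfg P j N => weight C η w c m2 (0 : VecField P j ℝ) φ * ‖φ z‖ ^ 2)
      = fun φ => weight C η w c m2 (0 : VecField P j ℝ) φ * (1 * wick2 w c m2 z φ + (N * G w c m2 z z) * (1 : ℝ) + 0 * (1 : ℝ)) := by
    funext φ; rw [norm_sq_eq_wick2 w c m2 z φ]; ring
  rw [show (∫ φ, weight C η w c m2 (0 : VecField P j ℝ) φ * ‖φ z‖ ^ 2) = ∫ φ, (fun φ : Cfg P j N => weight C η w c m2 (0 : VecField P j ℝ) φ * ‖φ z‖ ^ 2) φ from rfl, e,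
    integral_W_lin3 C η w c m2 hw hm h2z (ExpGrowth.const 1) (ExpGrowth.const 1),
    integral_wick2 C η w c m2 hw hm z]
  simp only [mul_one, mul_zero, add_zero, zero_mul, zero_add]
  ring

/-- **TWO MASS VERTICES AGAINST THE TWO (⟪φ x, 𝐞 a⟫_ℝ * ⟪φ x', 𝐞 b⟫_ℝ)**: `∫W∣φ(y)∣²∣φ(z)∣²φ_a(x)φ_b(x′) = Z·δ_{ab}·[2N·C(z,y)²C(x,x′) + 4C(z,y)(C(x,y)C(z,x′)
+ C(x′,y)C(z,x)) + N·C(z,z)·2C(x,y)C(x′,y) + N·C(y,y)·2C(x,z)C(x′,z) + N²C(y,y)C(z,z)C(x,x′)]` — bubble × free line, the CHAIN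
`x → y → z → x′` (both orientations), a loop times a mass insertion (two placements), two loops times the free line.
[cite: Balaban1983Higgs3, (1.21) p.416] [cite: GlimmJaffeQP1987, Prop. 8.3.1] -/
theorem integral_normSq_normSq_legs (hw : 0 < w) (hm : 0 < m2) (a b : Fin N) (x x' y z : Site P j) :
    ∫ φ, weight C η w c m2 (0 : VecField P j ℝ) φ * (‖φ y‖ ^ 2 * (‖φ z‖ ^ 2 * (⟪φ x, EuclideanSpace.basisFun (Fin N) ℝ a⟫_ℝ * ⟪φ x', EuclideanSpace.basisFun (Fin N) ℝ b⟫_ℝ)))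
      = (∫ φ, weight C η w c m2 (0 : VecField P j ℝ) φ) * ⟪EuclideanSpace.basisFun (Fin N) ℝ a, EuclideanSpace.basisFun (Fin N) ℝ b⟫_ℝ *
        (2 * N * G w c m2 z y ^ 2 * G w c m2 x x'
          + 4 * G w c m2 z y * (G w c m2 x y * G w c m2 z x' + G w c m2 x' y * G w c m2 z x)
          + N * G w c m2 z z * (2 * (G w c m2 x y * G w c m2 x' y))
          + N * G w c m2 y y * (2 * (G w c m2 x z * G w c m2 x' z))
          + N * G w c m2 y y * (N * G w c m2 z z) * G w c m2 x x') := by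
  have hF := expGrowth_legs (P := P) (j := j) a b x x'
  have h2y := expGrowth_wick2 (P := P) (j := j) (N := N) w c m2 y
  have h2z := expGrowth_wick2 (P := P) (j := j) (N := N) w c m2 z
  have e : (fun φ : Cfg P j N => weight C η w c m2 (0 : VecField P j ℝ) φ * (‖φ y‖ ^ 2 * (‖φ z‖ ^ 2 * (⟪φ x, EuclideanSpace.basisFun (Fin N) ℝ a⟫_ℝ * ⟪φ x', EuclideanSpace.basisFun (Fin N) ℝ b⟫_ℝ))))
      = fun φ => weight C η w c m2 (0 : VecField P j ℝ) φ * (1 * (wick2 w c m2 y φ * (wick2 w c m2 z φ * (⟪φ x, EuclideanSpace.basisFun (Fin N) ℝ a⟫_ℝ * ⟪φ x', EuclideanSpace.basisFun (Fin N) ℝ b⟫_ℝ)))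
          + (N * G w c m2 z z) * (wick2 w c m2 y φ * (⟪φ x, EuclideanSpace.basisFun (Fin N) ℝ a⟫_ℝ * ⟪φ x', EuclideanSpace.basisFun (Fin N) ℝ b⟫_ℝ))
          + (N * G w c m2 y y) * (wick2 w c m2 z φ * (⟪φ x, EuclideanSpace.basisFun (Fin N) ℝ a⟫_ℝ * ⟪φ x', EuclideanSpace.basisFun (Fin N) ℝ b⟫_ℝ))
          + (N * G w c m2 y y * (N * G w c m2 z z)) * (⟪φ x, EuclideanSpace.basisFun (Fin N) ℝ a⟫_ℝ * ⟪φ x', EuclideanSpace.basisFun (Fin N) ℝ b⟫_ℝ)) := by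
    funext φ
    rw [norm_sq_eq_wick2 w c m2 y φ, norm_sq_eq_wick2 w c m2 z φ]; ring
  rw [show (∫ φ, weight C η w c m2 (0 : VecField P j ℝ) φ * (‖φ y‖ ^ 2 * (‖φ z‖ ^ 2 * (⟪φ x, EuclideanSpace.basisFun (Fin N) ℝ a⟫_ℝ * ⟪φ x', EuclideanSpace.basisFun (Fin N) ℝ b⟫_ℝ))))
      = ∫ φ, (fun φ : Cfg P j N => weight C η w c m2 (0 : VecField P j ℝ) φ * (‖φ y‖ ^ 2 * (‖φ z‖ ^ 2 * (⟪φ x, EuclideanSpace.basisFun (Fin N) ℝ a⟫_ℝ * ⟪φ x', EuclideanSpace.basisFun (Fin N) ℝ b⟫_ℝ)))) φ from rfl, e,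
    integral_W_lin4 C η w c m2 hw hm (h2y.mul (h2z.mul hF)) (h2y.mul hF) (h2z.mul hF) hF,
    integral_wick2_wick2_legs C η w c m2 hw hm a b x x' y z, integral_wick2_legs C η w c m2 hw hm a b x x' y,
    integral_wick2_legs C η w c m2 hw hm a b x x' z, integral_legs C η w c m2 hw hm a b x x']
  ring

/-- two mass vertices in the vacuum: `∫W∣φ(y)∣²∣φ(z)∣² = Z·[2N·C(z,y)² + N²C(y,y)C(z,z)]` (bubble + two loops).
[cite: GlimmJaffeQP1987, Prop. 8.3.1] -/
theorem integral_normSq_normSq (hw : 0 < w) (hm : 0 < m2) (y z : Site P j) :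
    ∫ φ, weight C η w c m2 (0 : VecField P j ℝ) φ * (‖φ y‖ ^ 2 * ‖φ z‖ ^ 2)
      = (∫ φ, weight C η w c m2 (0 : VecField P j ℝ) φ) * (2 * N * G w c m2 z y ^ 2 + N * G w c m2 y y * (N * G w c m2 z z)) := by
  have h2y := expGrowth_wick2 (P := P) (j := j) (N := N) w c m2 y
  have h2z := expGrowth_wick2 (P := P) (j := j) (N := N) w c m2 z
  have e : (fun φ : Cfg P j N => weight C η w c m2 (0 : VecField P j ℝ) φ * (‖φ y‖ ^ 2 * ‖φ z‖ ^ 2))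
      = fun φ => weight C η w c m2 (0 : VecField P j ℝ) φ * (1 * (wick2 w c m2 y φ * wick2 w c m2 z φ) + (N * G w c m2 z z) * wick2 w c m2 y φ
          + (N * G w c m2 y y) * wick2 w c m2 z φ + (N * G w c m2 y y * (N * G w c m2 z z)) * (1 : ℝ)) := by
    funext φ
    rw [norm_sq_eq_wick2 w c m2 y φ, norm_sq_eq_wick2 w c m2 z φ]; ring
  rw [show (∫ φ, weight C η w c m2 (0 : VecField P j ℝ) φ * (‖φ y‖ ^ 2 * ‖φ z‖ ^ 2)) = ∫ φ, (fun φ : Cfg P j N => weight C η w c m2 (0 : VecField P j ℝ) φ * (‖φ y‖ ^ 2 * ‖φ z‖ ^ 2)) φ from rfl, e,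
    integral_W_lin4 C η w c m2 hw hm (h2y.mul h2z) h2y h2z (ExpGrowth.const 1),
    integral_wick2_wick2 C η w c m2 hw hm y z, integral_wick2 C η w c m2 hw hm y, integral_wick2 C η w c m2 hw hm z]
  simp only [mul_one, mul_zero, add_zero]
  ring

/-- **THE QUARTIC VERTEX AND THE MASS VERTEX AGAINST THE TWO (⟪φ x, 𝐞 a⟫_ℝ * ⟪φ x', 𝐞 b⟫_ℝ)**: `∫W∣φ(y)∣⁴∣φ(z)∣²φ_a(x)φ_b(x′) = Z·δ_{ab}·[8(N+2)C(z,y)²C(x,y)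
C(x′,y)` (THE TADPOLE WHOSE LOOP CARRIES THE MASS INSERTION: the four legs of `:∣φ(y)∣⁴:` into the external legs and into the two legs
of `:∣φ(z)∣²:`) `+ 2(N+2)C(y,y)·[2N·C(z,y)²C(x,x′) + 4C(z,y)(C(x,y)C(z,x′)+C(x′,y)C(z,x))]` (bubble × free line, CHAIN tadpole–mass
insertion) `+ 2(N+2)C(y,y)·N·C(z,z)·2C(x,y)C(x′,y) + N(N+2)C(y,y)²·2C(x,z)C(x′,z) + N(N+2)C(y,y)²·N·C(z,z)·C(x,x′)]` (disconnected
loops). [cite: Balaban1983Higgs3, (1.21)–(1.22) p.416] [cite: GlimmJaffeQP1987, Prop. 8.3.1] -/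
theorem integral_normFour_normSq_legs (hw : 0 < w) (hm : 0 < m2) (a b : Fin N) (x x' y z : Site P j) :
    ∫ φ, weight C η w c m2 (0 : VecField P j ℝ) φ * (‖φ y‖ ^ 4 * (‖φ z‖ ^ 2 * (⟪φ x, EuclideanSpace.basisFun (Fin N) ℝ a⟫_ℝ * ⟪φ x', EuclideanSpace.basisFun (Fin N) ℝ b⟫_ℝ)))
      = (∫ φ, weight C η w c m2 (0 : VecField P j ℝ) φ) * ⟪EuclideanSpace.basisFun (Fin N) ℝ a, EuclideanSpace.basisFun (Fin N) ℝ b⟫_ℝ *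
        (8 * (N + 2) * G w c m2 z y ^ 2 * (G w c m2 x y * G w c m2 x' y)
          + 2 * (N + 2) * G w c m2 y y * (2 * N * G w c m2 z y ^ 2 * G w c m2 x x'
            + 4 * G w c m2 z y * (G w c m2 x y * G w c m2 z x' + G w c m2 x' y * G w c m2 z x))
          + 2 * (N + 2) * G w c m2 y y * (N * G w c m2 z z) * (2 * (G w c m2 x y * G w c m2 x' y))
          + N * (N + 2) * G w c m2 y y ^ 2 * (2 * (G w c m2 x z * G w c m2 x' z))
          + N * (N + 2) * G w c m2 y y ^ 2 * (N * G w c m2 z z) * G w c m2 x x') := by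
  have hF := expGrowth_legs (P := P) (j := j) a b x x'
  have h4y := expGrowth_wick4 (P := P) (j := j) (N := N) w c m2 y
  have h2y := expGrowth_wick2 (P := P) (j := j) (N := N) w c m2 y
  have h2z := expGrowth_wick2 (P := P) (j := j) (N := N) w c m2 z
  have hn2z : ExpGrowth (fun φ : Cfg P j N => ‖φ z‖ ^ 2) := ExpGrowth.norm_sq_apply z
  -- level A: expand the quartic vertex at `y`
  have eA : (fun φ : Cfg P j N => weight C η w c m2 (0 : VecField P j ℝ) φ * (‖φ y‖ ^ 4 * (‖φ z‖ ^ 2 * (⟪φ x, EuclideanSpace.basisFun (Fin N) ℝ a⟫_ℝ * ⟪φ x', EuclideanSpace.basisFun (Fin N) ℝ b⟫_ℝ))))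
      = fun φ => weight C η w c m2 (0 : VecField P j ℝ) φ * (1 * (wick4 w c m2 y φ * (‖φ z‖ ^ 2 * (⟪φ x, EuclideanSpace.basisFun (Fin N) ℝ a⟫_ℝ * ⟪φ x', EuclideanSpace.basisFun (Fin N) ℝ b⟫_ℝ)))
        + 2 * (N + 2) * G w c m2 y y * (wick2 w c m2 y φ * (‖φ z‖ ^ 2 * (⟪φ x, EuclideanSpace.basisFun (Fin N) ℝ a⟫_ℝ * ⟪φ x', EuclideanSpace.basisFun (Fin N) ℝ b⟫_ℝ)))
        + N * (N + 2) * G w c m2 y y ^ 2 * (‖φ z‖ ^ 2 * (⟪φ x, EuclideanSpace.basisFun (Fin N) ℝ a⟫_ℝ * ⟪φ x', EuclideanSpace.basisFun (Fin N) ℝ b⟫_ℝ))) := by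
    funext φ; rw [norm_four_eq_wick w c m2 y φ]; ring
  rw [show (∫ φ, weight C η w c m2 (0 : VecField P j ℝ) φ * (‖φ y‖ ^ 4 * (‖φ z‖ ^ 2 * (⟪φ x, EuclideanSpace.basisFun (Fin N) ℝ a⟫_ℝ * ⟪φ x', EuclideanSpace.basisFun (Fin N) ℝ b⟫_ℝ))))
      = ∫ φ, (fun φ : Cfg P j N => weight C η w c m2 (0 : VecField P j ℝ) φ * (‖φ y‖ ^ 4 * (‖φ z‖ ^ 2 * (⟪φ x, EuclideanSpace.basisFun (Fin N) ℝ a⟫_ℝ * ⟪φ x', EuclideanSpace.basisFun (Fin N) ℝ b⟫_ℝ)))) φ from rfl,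
    eA, integral_W_lin3 C η w c m2 hw hm (h4y.mul (hn2z.mul hF)) (h2y.mul (hn2z.mul hF)) (hn2z.mul hF)]
  -- level B: expand the mass vertex at `z` inside the two Wick-ordered pieces
  have eB1 : (fun φ : Cfg P j N => weight C η w c m2 (0 : VecField P j ℝ) φ * (wick4 w c m2 y φ * (‖φ z‖ ^ 2 * (⟪φ x, EuclideanSpace.basisFun (Fin N) ℝ a⟫_ℝ * ⟪φ x', EuclideanSpace.basisFun (Fin N) ℝ b⟫_ℝ))))
      = fun φ => weight C η w c m2 (0 : VecField P j ℝ) φ * (1 * (wick4 w c m2 y φ * (wick2 w c m2 z φ * (⟪φ x, EuclideanSpace.basisFun (Fin N) ℝ a⟫_ℝ * ⟪φ x', EuclideanSpace.basisFun (Fin N) ℝ b⟫_ℝ)))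
        + (N * G w c m2 z z) * (wick4 w c m2 y φ * (⟪φ x, EuclideanSpace.basisFun (Fin N) ℝ a⟫_ℝ * ⟪φ x', EuclideanSpace.basisFun (Fin N) ℝ b⟫_ℝ)) + 0 * (1 : ℝ)) := by
    funext φ; rw [norm_sq_eq_wick2 w c m2 z φ]; ring
  have eB2 : (fun φ : Cfg P j N => weight C η w c m2 (0 : VecField P j ℝ) φ * (wick2 w c m2 y φ * (‖φ z‖ ^ 2 * (⟪φ x, EuclideanSpace.basisFun (Fin N) ℝ a⟫_ℝ * ⟪φ x', EuclideanSpace.basisFun (Fin N) ℝ b⟫_ℝ))))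
      = fun φ => weight C η w c m2 (0 : VecField P j ℝ) φ * (1 * (wick2 w c m2 y φ * (wick2 w c m2 z φ * (⟪φ x, EuclideanSpace.basisFun (Fin N) ℝ a⟫_ℝ * ⟪φ x', EuclideanSpace.basisFun (Fin N) ℝ b⟫_ℝ)))
        + (N * G w c m2 z z) * (wick2 w c m2 y φ * (⟪φ x, EuclideanSpace.basisFun (Fin N) ℝ a⟫_ℝ * ⟪φ x', EuclideanSpace.basisFun (Fin N) ℝ b⟫_ℝ)) + 0 * (1 : ℝ)) := by
    funext φ; rw [norm_sq_eq_wick2 w c m2 z φ]; ring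
  rw [show (∫ φ, weight C η w c m2 (0 : VecField P j ℝ) φ * (wick4 w c m2 y φ * (‖φ z‖ ^ 2 * (⟪φ x, EuclideanSpace.basisFun (Fin N) ℝ a⟫_ℝ * ⟪φ x', EuclideanSpace.basisFun (Fin N) ℝ b⟫_ℝ))))
      = ∫ φ, (fun φ : Cfg P j N => weight C η w c m2 (0 : VecField P j ℝ) φ * (wick4 w c m2 y φ * (‖φ z‖ ^ 2 * (⟪φ x, EuclideanSpace.basisFun (Fin N) ℝ a⟫_ℝ * ⟪φ x', EuclideanSpace.basisFun (Fin N) ℝ b⟫_ℝ)))) φ from rfl, eB1,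
    integral_W_lin3 C η w c m2 hw hm (h4y.mul (h2z.mul hF)) (h4y.mul hF) (ExpGrowth.const 1),
    show (∫ φ, weight C η w c m2 (0 : VecField P j ℝ) φ * (wick2 w c m2 y φ * (‖φ z‖ ^ 2 * (⟪φ x, EuclideanSpace.basisFun (Fin N) ℝ a⟫_ℝ * ⟪φ x', EuclideanSpace.basisFun (Fin N) ℝ b⟫_ℝ))))
      = ∫ φ, (fun φ : Cfg P j N => weight C η w c m2 (0 : VecField P j ℝ) φ * (wick2 w c m2 y φ * (‖φ z‖ ^ 2 * (⟪φ x, EuclideanSpace.basisFun (Fin N) ℝ a⟫_ℝ * ⟪φ x', EuclideanSpace.basisFun (Fin N) ℝ b⟫_ℝ)))) φ from rfl, eB2,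
    integral_W_lin3 C η w c m2 hw hm (h2y.mul (h2z.mul hF)) (h2y.mul hF) (ExpGrowth.const 1),
    integral_wick4_wick2_legs C η w c m2 hw hm a b x x' y z, integral_wick4_legs C η w c m2 hw hm a b x x' y,
    integral_wick2_wick2_legs C η w c m2 hw hm a b x x' y z, integral_wick2_legs C η w c m2 hw hm a b x x' y,
    integral_normSq_legs C η w c m2 hw hm a b x x' z]
  ring

/-- the quartic and the mass vertex in the vacuum: `∫W∣φ(y)∣⁴∣φ(z)∣² = Z·[2(N+2)C(y,y)·2N·C(z,y)² + N(N+2)C(y,y)²·N·C(z,z)]` (bubble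
with a tadpole factor; disconnected loops). [cite: GlimmJaffeQP1987, Prop. 8.3.1] -/
theorem integral_normFour_normSq (hw : 0 < w) (hm : 0 < m2) (y z : Site P j) :
    ∫ φ, weight C η w c m2 (0 : VecField P j ℝ) φ * (‖φ y‖ ^ 4 * ‖φ z‖ ^ 2)
      = (∫ φ, weight C η w c m2 (0 : VecField P j ℝ) φ) * (2 * (N + 2) * G w c m2 y y * (2 * N * G w c m2 z y ^ 2)
          + N * (N + 2) * G w c m2 y y ^ 2 * (N * G w c m2 z z)) := by
  have h4y := expGrowth_wick4 (P := P) (j := j) (N := N) w c m2 y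
  have h2y := expGrowth_wick2 (P := P) (j := j) (N := N) w c m2 y
  have h2z := expGrowth_wick2 (P := P) (j := j) (N := N) w c m2 z
  have hn2z : ExpGrowth (fun φ : Cfg P j N => ‖φ z‖ ^ 2) := ExpGrowth.norm_sq_apply z
  have eA : (fun φ : Cfg P j N => weight C η w c m2 (0 : VecField P j ℝ) φ * (‖φ y‖ ^ 4 * ‖φ z‖ ^ 2))
      = fun φ => weight C η w c m2 (0 : VecField P j ℝ) φ * (1 * (wick4 w c m2 y φ * ‖φ z‖ ^ 2) + 2 * (N + 2) * G w c m2 y y * (wick2 w c m2 y φ * ‖φ z‖ ^ 2)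
        + N * (N + 2) * G w c m2 y y ^ 2 * ‖φ z‖ ^ 2) := by
    funext φ; rw [norm_four_eq_wick w c m2 y φ]; ring
  rw [show (∫ φ, weight C η w c m2 (0 : VecField P j ℝ) φ * (‖φ y‖ ^ 4 * ‖φ z‖ ^ 2)) = ∫ φ, (fun φ : Cfg P j N => weight C η w c m2 (0 : VecField P j ℝ) φ * (‖φ y‖ ^ 4 * ‖φ z‖ ^ 2)) φ from rfl,
    eA, integral_W_lin3 C η w c m2 hw hm (h4y.mul hn2z) (h2y.mul hn2z) hn2z]
  have eB1 : (fun φ : Cfg P j N => weight C η w c m2 (0 : VecField P j ℝ) φ * (wick4 w c m2 y φ * ‖φ z‖ ^ 2))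
      = fun φ => weight C η w c m2 (0 : VecField P j ℝ) φ * (1 * (wick4 w c m2 y φ * wick2 w c m2 z φ) + (N * G w c m2 z z) * wick4 w c m2 y φ + 0 * (1 : ℝ)) := by
    funext φ; rw [norm_sq_eq_wick2 w c m2 z φ]; ring
  have eB2 : (fun φ : Cfg P j N => weight C η w c m2 (0 : VecField P j ℝ) φ * (wick2 w c m2 y φ * ‖φ z‖ ^ 2))
      = fun φ => weight C η w c m2 (0 : VecField P j ℝ) φ * (1 * (wick2 w c m2 y φ * wick2 w c m2 z φ) + (N * G w c m2 z z) * wick2 w c m2 y φ + 0 * (1 : ℝ)) := by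
    funext φ; rw [norm_sq_eq_wick2 w c m2 z φ]; ring
  rw [show (∫ φ, weight C η w c m2 (0 : VecField P j ℝ) φ * (wick4 w c m2 y φ * ‖φ z‖ ^ 2)) = ∫ φ, (fun φ : Cfg P j N => weight C η w c m2 (0 : VecField P j ℝ) φ * (wick4 w c m2 y φ * ‖φ z‖ ^ 2)) φ
      from rfl, eB1, integral_W_lin3 C η w c m2 hw hm (h4y.mul h2z) h4y (ExpGrowth.const 1),
    show (∫ φ, weight C η w c m2 (0 : VecField P j ℝ) φ * (wick2 w c m2 y φ * ‖φ z‖ ^ 2)) = ∫ φ, (fun φ : Cfg P j N => weight C η w c m2 (0 : VecField P j ℝ) φ * (wick2 w c m2 y φ * ‖φ z‖ ^ 2)) φ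
      from rfl, eB2, integral_W_lin3 C η w c m2 hw hm (h2y.mul h2z) h2y (ExpGrowth.const 1),
    integral_wick4_wick2 C η w c m2 hw hm y z, integral_wick4 C η w c m2 hw hm y, integral_wick2_wick2 C η w c m2 hw hm y z,
    integral_wick2 C η w c m2 hw hm y, integral_normSq C η w c m2 hw hm z]
  ring

end WickMass


/-! ### the moments of `Q = Σ_zη^d∣φ(z)∣²`, `Q²`, `V·Q` (`V = Σ_yη^d∣φ(y)∣⁴`) with and without the legs, organised by graph -/

section MassMoments

/-- `∫W·Q·φ_a(x)φ_b(x′) = Z·δ_{ab}·[C(x,x′)Σ_zη^dN·C(z,z) + Σ_zη^d2C(x,z)C(x′,z)]` (vacuum loops × free line + the mass insertion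
`2(C₀⋆C₀)(x,x′)`). [cite: Balaban1983Higgs3, (1.21) p.416] [cite: GlimmJaffeQP1987, Cor. 8.3.2] -/
theorem integral_massForm_legs (hw : 0 < w) (hm : 0 < m2) (a b : Fin N) (x x' : Site P j) :
    ∫ φ, weight C η w c m2 (0 : VecField P j ℝ) φ * (massForm w φ * (⟪φ x, EuclideanSpace.basisFun (Fin N) ℝ a⟫_ℝ * ⟪φ x', EuclideanSpace.basisFun (Fin N) ℝ b⟫_ℝ))
      = (∫ φ, weight C η w c m2 (0 : VecField P j ℝ) φ) * ⟪EuclideanSpace.basisFun (Fin N) ℝ a, EuclideanSpace.basisFun (Fin N) ℝ b⟫_ℝ *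
        (G w c m2 x x' * (∑ z : Site P j, w * (N * G w c m2 z z)) + ∑ z : Site P j, w * (2 * (G w c m2 x z * G w c m2 x' z))) := by
  have hi : ∀ z : Site P j, Integrable (fun φ : Cfg P j N => weight C η w c m2 (0 : VecField P j ℝ) φ * (w * (‖φ z‖ ^ 2 * (⟪φ x, EuclideanSpace.basisFun (Fin N) ℝ a⟫_ℝ * ⟪φ x', EuclideanSpace.basisFun (Fin N) ℝ b⟫_ℝ)))) := fun z =>
    (((ExpGrowth.norm_sq_apply z).mul (expGrowth_legs a b x x')).const_mul w).integrable C η w c m2 hw hm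
  have e1 : (fun φ : Cfg P j N => weight C η w c m2 (0 : VecField P j ℝ) φ * (massForm w φ * (⟪φ x, EuclideanSpace.basisFun (Fin N) ℝ a⟫_ℝ * ⟪φ x', EuclideanSpace.basisFun (Fin N) ℝ b⟫_ℝ)))
      = fun φ => ∑ z : Site P j, weight C η w c m2 (0 : VecField P j ℝ) φ * (w * (‖φ z‖ ^ 2 * (⟪φ x, EuclideanSpace.basisFun (Fin N) ℝ a⟫_ℝ * ⟪φ x', EuclideanSpace.basisFun (Fin N) ℝ b⟫_ℝ))) := by
    funext φ; rw [massForm, Finset.sum_mul, Finset.mul_sum]; exact Finset.sum_congr rfl fun z _ => by ring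
  rw [e1, integral_finsetSum _ (fun z _ => hi z)]
  simp only [Finset.mul_sum, mul_add, ← Finset.sum_add_distrib]
  refine Finset.sum_congr rfl fun z _ => ?_
  have e2 : (fun φ : Cfg P j N => weight C η w c m2 (0 : VecField P j ℝ) φ * (w * (‖φ z‖ ^ 2 * (⟪φ x, EuclideanSpace.basisFun (Fin N) ℝ a⟫_ℝ * ⟪φ x', EuclideanSpace.basisFun (Fin N) ℝ b⟫_ℝ))))
      = fun φ => w * (weight C η w c m2 (0 : VecField P j ℝ) φ * (‖φ z‖ ^ 2 * (⟪φ x, EuclideanSpace.basisFun (Fin N) ℝ a⟫_ℝ * ⟪φ x', EuclideanSpace.basisFun (Fin N) ℝ b⟫_ℝ))) := by funext φ; ring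
  rw [e2, integral_const_mul, integral_normSq_legs C η w c m2 hw hm a b x x' z]
  ring

/-- `∫W·Q = Z·Σ_zη^dN·C(z,z)`. [cite: GlimmJaffeQP1987, Cor. 8.3.2] -/
theorem integral_massForm (hw : 0 < w) (hm : 0 < m2) :
    ∫ φ, weight C η w c m2 (0 : VecField P j ℝ) φ * massForm w φ = (∫ φ, weight C η w c m2 (0 : VecField P j ℝ) φ) * ∑ z : Site P j, w * (N * G w c m2 z z) := by
  have hi : ∀ z : Site P j, Integrable (fun φ : Cfg P j N => weight C η w c m2 (0 : VecField P j ℝ) φ * (w * ‖φ z‖ ^ 2)) := fun z =>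
    ((ExpGrowth.norm_sq_apply z).const_mul w).integrable C η w c m2 hw hm
  have e1 : (fun φ : Cfg P j N => weight C η w c m2 (0 : VecField P j ℝ) φ * massForm w φ) = fun φ => ∑ z : Site P j, weight C η w c m2 (0 : VecField P j ℝ) φ * (w * ‖φ z‖ ^ 2) := by
    funext φ; rw [massForm, Finset.mul_sum]
  rw [e1, integral_finsetSum _ (fun z _ => hi z), Finset.mul_sum]
  refine Finset.sum_congr rfl fun z _ => ?_
  have e2 : (fun φ : Cfg P j N => weight C η w c m2 (0 : VecField P j ℝ) φ * (w * ‖φ z‖ ^ 2)) = fun φ => w * (weight C η w c m2 (0 : VecField P j ℝ) φ * ‖φ z‖ ^ 2) := by funext φ; ring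
  rw [e2, integral_const_mul, integral_normSq C η w c m2 hw hm z]
  ring

/-- `∫W·Q²·φ_a(x)φ_b(x′)` organised by graph: bubble × free line, the CHAIN `Σ_{y,z}η^{2d}4C(z,y)(C(x,y)C(z,x′) + C(x′,y)C(z,x))`,
loop × mass insertion (two placements), loops² × free line. [cite: Balaban1983Higgs3, (1.21) p.416] [cite: GlimmJaffeQP1987, Prop. 8.3.1] -/
theorem integral_massForm_sq_legs (hw : 0 < w) (hm : 0 < m2) (a b : Fin N) (x x' : Site P j) :
    ∫ φ, weight C η w c m2 (0 : VecField P j ℝ) φ * (massForm w φ ^ 2 * (⟪φ x, EuclideanSpace.basisFun (Fin N) ℝ a⟫_ℝ * ⟪φ x', EuclideanSpace.basisFun (Fin N) ℝ b⟫_ℝ))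
      = (∫ φ, weight C η w c m2 (0 : VecField P j ℝ) φ) * ⟪EuclideanSpace.basisFun (Fin N) ℝ a, EuclideanSpace.basisFun (Fin N) ℝ b⟫_ℝ *
        (G w c m2 x x' * (∑ y : Site P j, ∑ z : Site P j, w * w * (2 * N * G w c m2 z y ^ 2))
          + (∑ y : Site P j, ∑ z : Site P j, w * w *
              (4 * G w c m2 z y * (G w c m2 x y * G w c m2 z x' + G w c m2 x' y * G w c m2 z x)))
          + (∑ y : Site P j, ∑ z : Site P j, w * w * (N * G w c m2 z z * (2 * (G w c m2 x y * G w c m2 x' y))))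
          + (∑ y : Site P j, ∑ z : Site P j, w * w * (N * G w c m2 y y * (2 * (G w c m2 x z * G w c m2 x' z))))
          + G w c m2 x x' * (∑ y : Site P j, ∑ z : Site P j, w * w * (N * G w c m2 y y * (N * G w c m2 z z)))) := by
  have hi : ∀ y z : Site P j, Integrable (fun φ : Cfg P j N =>
      weight C η w c m2 (0 : VecField P j ℝ) φ * (w * w * (‖φ y‖ ^ 2 * (‖φ z‖ ^ 2 * (⟪φ x, EuclideanSpace.basisFun (Fin N) ℝ a⟫_ℝ * ⟪φ x', EuclideanSpace.basisFun (Fin N) ℝ b⟫_ℝ))))) := fun y z =>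
    ((((ExpGrowth.norm_sq_apply y).mul ((ExpGrowth.norm_sq_apply z).mul (expGrowth_legs a b x x')))).const_mul
      (w * w)).integrable C η w c m2 hw hm
  have e1 : (fun φ : Cfg P j N => weight C η w c m2 (0 : VecField P j ℝ) φ * (massForm w φ ^ 2 * (⟪φ x, EuclideanSpace.basisFun (Fin N) ℝ a⟫_ℝ * ⟪φ x', EuclideanSpace.basisFun (Fin N) ℝ b⟫_ℝ)))
      = fun φ => ∑ y : Site P j, ∑ z : Site P j, weight C η w c m2 (0 : VecField P j ℝ) φ * (w * w * (‖φ y‖ ^ 2 * (‖φ z‖ ^ 2 * (⟪φ x, EuclideanSpace.basisFun (Fin N) ℝ a⟫_ℝ * ⟪φ x', EuclideanSpace.basisFun (Fin N) ℝ b⟫_ℝ)))) := by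
    funext φ
    rw [massForm, sq, Finset.sum_mul_sum, Finset.sum_mul, Finset.mul_sum]
    refine Finset.sum_congr rfl fun y _ => ?_
    rw [Finset.sum_mul, Finset.mul_sum]
    exact Finset.sum_congr rfl fun z _ => by ring
  have e2 : ∀ y z : Site P j,
      (∫ φ, weight C η w c m2 (0 : VecField P j ℝ) φ * (w * w * (‖φ y‖ ^ 2 * (‖φ z‖ ^ 2 * (⟪φ x, EuclideanSpace.basisFun (Fin N) ℝ a⟫_ℝ * ⟪φ x', EuclideanSpace.basisFun (Fin N) ℝ b⟫_ℝ)))))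
        = (w * w) * ∫ φ, weight C η w c m2 (0 : VecField P j ℝ) φ * (‖φ y‖ ^ 2 * (‖φ z‖ ^ 2 * (⟪φ x, EuclideanSpace.basisFun (Fin N) ℝ a⟫_ℝ * ⟪φ x', EuclideanSpace.basisFun (Fin N) ℝ b⟫_ℝ))) := by
    intro y z
    rw [← integral_const_mul]
    exact integral_congr_ae (Filter.Eventually.of_forall fun φ => by ring)
  rw [e1, integral_finsetSum _ (fun y _ => integrable_finsetSum _ fun z _ => hi y z)]
  simp_rw [integral_finsetSum _ (fun z _ => hi _ z), e2, integral_normSq_normSq_legs C η w c m2 hw hm a b x x']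
  simp only [Finset.mul_sum, mul_add, ← Finset.sum_add_distrib]
  exact Finset.sum_congr rfl fun y _ => Finset.sum_congr rfl fun z _ => by ring

/-- `∫W·Q²` organised by graph: bubbles + loops². [cite: GlimmJaffeQP1987, Prop. 8.3.1] -/
theorem integral_massForm_sq (hw : 0 < w) (hm : 0 < m2) :
    ∫ φ, weight C η w c m2 (0 : VecField P j ℝ) φ * massForm w φ ^ 2
      = (∫ φ, weight C η w c m2 (0 : VecField P j ℝ) φ) * ((∑ y : Site P j, ∑ z : Site P j, w * w * (2 * N * G w c m2 z y ^ 2))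
          + ∑ y : Site P j, ∑ z : Site P j, w * w * (N * G w c m2 y y * (N * G w c m2 z z))) := by
  have hi : ∀ y z : Site P j, Integrable (fun φ : Cfg P j N => weight C η w c m2 (0 : VecField P j ℝ) φ * (w * w * (‖φ y‖ ^ 2 * ‖φ z‖ ^ 2))) := fun y z =>
    ((((ExpGrowth.norm_sq_apply y).mul (ExpGrowth.norm_sq_apply z))).const_mul (w * w)).integrable C η w c m2 hw hm
  have e1 : (fun φ : Cfg P j N => weight C η w c m2 (0 : VecField P j ℝ) φ * massForm w φ ^ 2)
      = fun φ => ∑ y : Site P j, ∑ z : Site P j, weight C η w c m2 (0 : VecField P j ℝ) φ * (w * w * (‖φ y‖ ^ 2 * ‖φ z‖ ^ 2)) := by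
    funext φ
    rw [massForm, sq, Finset.sum_mul_sum, Finset.mul_sum]
    refine Finset.sum_congr rfl fun y _ => ?_
    rw [Finset.mul_sum]
    exact Finset.sum_congr rfl fun z _ => by ring
  have e2 : ∀ y z : Site P j, (∫ φ, weight C η w c m2 (0 : VecField P j ℝ) φ * (w * w * (‖φ y‖ ^ 2 * ‖φ z‖ ^ 2)))
      = (w * w) * ∫ φ, weight C η w c m2 (0 : VecField P j ℝ) φ * (‖φ y‖ ^ 2 * ‖φ z‖ ^ 2) := by
    intro y z
    rw [← integral_const_mul]
    exact integral_congr_ae (Filter.Eventually.of_forall fun φ => by ring)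
  rw [e1, integral_finsetSum _ (fun y _ => integrable_finsetSum _ fun z _ => hi y z)]
  simp_rw [integral_finsetSum _ (fun z _ => hi _ z), e2, integral_normSq_normSq C η w c m2 hw hm]
  simp only [Finset.mul_sum, mul_add, ← Finset.sum_add_distrib]
  exact Finset.sum_congr rfl fun y _ => Finset.sum_congr rfl fun z _ => by ring

/-- `∫W·V·Q·φ_a(x)φ_b(x′)` organised by graph: THE TADPOLE WITH THE MASS INSERTION ON ITS LOOP `Σ_{y,z}η^{2d}8(N+2)C(z,y)²C(x,y)C(x′,y)`,
bubble with tadpole factor × free line, THE CHAIN tadpole–mass insertion `Σ_{y,z}η^{2d}2(N+2)C(y,y)·4C(z,y)(…)`, and the disconnected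
products (tadpole × loop, double self-line × mass insertion, double self-line × loop × free line).
[cite: Balaban1983Higgs3, (1.21)–(1.22) p.416] [cite: GlimmJaffeQP1987, Prop. 8.3.1] -/
theorem integral_V_massForm_legs (hw : 0 < w) (hm : 0 < m2) (a b : Fin N) (x x' : Site P j) :
    ∫ φ, weight C η w c m2 (0 : VecField P j ℝ) φ * ((∑ y : Site P j, w * ‖φ y‖ ^ 4) * (massForm w φ * (⟪φ x, EuclideanSpace.basisFun (Fin N) ℝ a⟫_ℝ * ⟪φ x', EuclideanSpace.basisFun (Fin N) ℝ b⟫_ℝ)))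
      = (∫ φ, weight C η w c m2 (0 : VecField P j ℝ) φ) * ⟪EuclideanSpace.basisFun (Fin N) ℝ a, EuclideanSpace.basisFun (Fin N) ℝ b⟫_ℝ *
        ((∑ y : Site P j, ∑ z : Site P j, w * w * (8 * (N + 2) * G w c m2 z y ^ 2 * (G w c m2 x y * G w c m2 x' y)))
          + G w c m2 x x' * (∑ y : Site P j, ∑ z : Site P j, w * w * (2 * (N + 2) * G w c m2 y y * (2 * N * G w c m2 z y ^ 2)))
          + (∑ y : Site P j, ∑ z : Site P j, w * w *
              (2 * (N + 2) * G w c m2 y y * (4 * G w c m2 z y * (G w c m2 x y * G w c m2 z x' + G w c m2 x' y * G w c m2 z x))))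
          + (∑ y : Site P j, ∑ z : Site P j, w * w *
              (2 * (N + 2) * G w c m2 y y * (N * G w c m2 z z) * (2 * (G w c m2 x y * G w c m2 x' y))))
          + (∑ y : Site P j, ∑ z : Site P j, w * w * (N * (N + 2) * G w c m2 y y ^ 2 * (2 * (G w c m2 x z * G w c m2 x' z))))
          + G w c m2 x x' * (∑ y : Site P j, ∑ z : Site P j, w * w *
              (N * (N + 2) * G w c m2 y y ^ 2 * (N * G w c m2 z z)))) := by
  have hi : ∀ y z : Site P j, Integrable (fun φ : Cfg P j N =>
      weight C η w c m2 (0 : VecField P j ℝ) φ * (w * w * (‖φ y‖ ^ 4 * (‖φ z‖ ^ 2 * (⟪φ x, EuclideanSpace.basisFun (Fin N) ℝ a⟫_ℝ * ⟪φ x', EuclideanSpace.basisFun (Fin N) ℝ b⟫_ℝ))))) := fun y z =>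
    ((((expGrowth_norm_four y).mul ((ExpGrowth.norm_sq_apply z).mul (expGrowth_legs a b x x')))).const_mul
      (w * w)).integrable C η w c m2 hw hm
  have e1 : (fun φ : Cfg P j N => weight C η w c m2 (0 : VecField P j ℝ) φ * ((∑ y : Site P j, w * ‖φ y‖ ^ 4) * (massForm w φ * (⟪φ x, EuclideanSpace.basisFun (Fin N) ℝ a⟫_ℝ * ⟪φ x', EuclideanSpace.basisFun (Fin N) ℝ b⟫_ℝ))))
      = fun φ => ∑ y : Site P j, ∑ z : Site P j, weight C η w c m2 (0 : VecField P j ℝ) φ * (w * w * (‖φ y‖ ^ 4 * (‖φ z‖ ^ 2 * (⟪φ x, EuclideanSpace.basisFun (Fin N) ℝ a⟫_ℝ * ⟪φ x', EuclideanSpace.basisFun (Fin N) ℝ b⟫_ℝ)))) := by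
    funext φ
    simp only [massForm, Finset.sum_mul, Finset.mul_sum]
    rw [Finset.sum_comm]
    exact Finset.sum_congr rfl fun y _ => Finset.sum_congr rfl fun z _ => by ring
  have e2 : ∀ y z : Site P j,
      (∫ φ, weight C η w c m2 (0 : VecField P j ℝ) φ * (w * w * (‖φ y‖ ^ 4 * (‖φ z‖ ^ 2 * (⟪φ x, EuclideanSpace.basisFun (Fin N) ℝ a⟫_ℝ * ⟪φ x', EuclideanSpace.basisFun (Fin N) ℝ b⟫_ℝ)))))
        = (w * w) * ∫ φ, weight C η w c m2 (0 : VecField P j ℝ) φ * (‖φ y‖ ^ 4 * (‖φ z‖ ^ 2 * (⟪φ x, EuclideanSpace.basisFun (Fin N) ℝ a⟫_ℝ * ⟪φ x', EuclideanSpace.basisFun (Fin N) ℝ b⟫_ℝ))) := by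
    intro y z
    rw [← integral_const_mul]
    exact integral_congr_ae (Filter.Eventually.of_forall fun φ => by ring)
  rw [e1, integral_finsetSum _ (fun y _ => integrable_finsetSum _ fun z _ => hi y z)]
  simp_rw [integral_finsetSum _ (fun z _ => hi _ z), e2, integral_normFour_normSq_legs C η w c m2 hw hm a b x x']
  simp only [Finset.mul_sum, mul_add, ← Finset.sum_add_distrib]
  exact Finset.sum_congr rfl fun y _ => Finset.sum_congr rfl fun z _ => by ring

/-- `∫W·V·Q` organised by graph: bubble with a tadpole factor, double self-line × loop. [cite: GlimmJaffeQP1987, Prop. 8.3.1] -/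
theorem integral_V_massForm (hw : 0 < w) (hm : 0 < m2) :
    ∫ φ, weight C η w c m2 (0 : VecField P j ℝ) φ * ((∑ y : Site P j, w * ‖φ y‖ ^ 4) * massForm w φ)
      = (∫ φ, weight C η w c m2 (0 : VecField P j ℝ) φ) * ((∑ y : Site P j, ∑ z : Site P j, w * w * (2 * (N + 2) * G w c m2 y y * (2 * N * G w c m2 z y ^ 2)))
          + ∑ y : Site P j, ∑ z : Site P j, w * w * (N * (N + 2) * G w c m2 y y ^ 2 * (N * G w c m2 z z))) := by
  have hi : ∀ y z : Site P j, Integrable (fun φ : Cfg P j N => weight C η w c m2 (0 : VecField P j ℝ) φ * (w * w * (‖φ y‖ ^ 4 * ‖φ z‖ ^ 2))) := fun y z =>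
    ((((expGrowth_norm_four y).mul (ExpGrowth.norm_sq_apply z))).const_mul (w * w)).integrable C η w c m2 hw hm
  have e1 : (fun φ : Cfg P j N => weight C η w c m2 (0 : VecField P j ℝ) φ * ((∑ y : Site P j, w * ‖φ y‖ ^ 4) * massForm w φ))
      = fun φ => ∑ y : Site P j, ∑ z : Site P j, weight C η w c m2 (0 : VecField P j ℝ) φ * (w * w * (‖φ y‖ ^ 4 * ‖φ z‖ ^ 2)) := by
    funext φ
    simp only [massForm, Finset.sum_mul, Finset.mul_sum]
    rw [Finset.sum_comm]
    exact Finset.sum_congr rfl fun y _ => Finset.sum_congr rfl fun z _ => by ring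
  have e2 : ∀ y z : Site P j, (∫ φ, weight C η w c m2 (0 : VecField P j ℝ) φ * (w * w * (‖φ y‖ ^ 4 * ‖φ z‖ ^ 2)))
      = (w * w) * ∫ φ, weight C η w c m2 (0 : VecField P j ℝ) φ * (‖φ y‖ ^ 4 * ‖φ z‖ ^ 2) := by
    intro y z
    rw [← integral_const_mul]
    exact integral_congr_ae (Filter.Eventually.of_forall fun φ => by ring)
  rw [e1, integral_finsetSum _ (fun y _ => integrable_finsetSum _ fun z _ => hi y z)]
  simp_rw [integral_finsetSum _ (fun z _ => hi _ z), e2, integral_normFour_normSq C η w c m2 hw hm]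
  simp only [Finset.mul_sum, mul_add, ← Finset.sum_add_distrib]
  exact Finset.sum_congr rfl fun y _ => Finset.sum_congr rfl fun z _ => by ring

end MassMoments

/-! ## §5 THE CONNECTED PARTS (joint cumulants against the two legs): every disconnected vacuum piece cancels — linked-cluster at
second order by explicit computation -/

section Cumulants

/-- **`⟨φ_a(x)φ_b(x′); Q⟩`, THE MASS INSERTION**: `Z·∫WQφ_aφ_b − ∫WQ·∫Wφ_aφ_b = Z²·δ_{ab}·Σ_zη^d2C(x,z)C(x′,z)` — the vacuum loop
cancels, the amputated mass vertex between two free propagators `2(C₀⋆C₀)(x,x′)` remains (the `n = 1` term `C₀(−δm²)C₀` of (1.21) per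
unit `−δm²`). [cite: Balaban1983Higgs3, (1.21) p.416] [cite: GlimmJaffeQP1987, §8.3] -/
theorem cum2_massForm_legs (hw : 0 < w) (hm : 0 < m2) (a b : Fin N) (x x' : Site P j) :
    (∫ φ, weight C η w c m2 (0 : VecField P j ℝ) φ) * (∫ φ, weight C η w c m2 (0 : VecField P j ℝ) φ * (massForm w φ * (⟪φ x, EuclideanSpace.basisFun (Fin N) ℝ a⟫_ℝ * ⟪φ x', EuclideanSpace.basisFun (Fin N) ℝ b⟫_ℝ))) - (∫ φ, weight C η w c m2 (0 : VecField P j ℝ) φ * massForm w φ) * (∫ φ, weight C η w c m2 (0 : VecField P j ℝ) φ * (⟪φ x, EuclideanSpace.basisFun (Fin N) ℝ a⟫_ℝ * ⟪φ x', EuclideanSpace.basisFun (Fin N) ℝ b⟫_ℝ))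
      = (∫ φ, weight C η w c m2 (0 : VecField P j ℝ) φ) ^ 2 * ⟪EuclideanSpace.basisFun (Fin N) ℝ a, EuclideanSpace.basisFun (Fin N) ℝ b⟫_ℝ * ∑ z : Site P j, w * (2 * (G w c m2 x z * G w c m2 x' z)) := by
  rw [integral_massForm_legs C η w c m2 hw hm a b x x', integral_massForm C η w c m2 hw hm, integral_legs C η w c m2 hw hm a b x x']
  ring

/-- **`⟨φ_a(x)φ_b(x′); Q; Q⟩`, TWO MASS INSERTIONS IN A ROW**: the third joint cumulant of the legs with two mass vertices is the CHAIN
alone, `Z³·δ_{ab}·Σ_{y,z}η^{2d}4C(z,y)(C(x,y)C(z,x′) + C(x′,y)C(z,x))` — bubbles, loops and loop × insertion products cancel (the `n = 2`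
term `C₀(−δm²)C₀(−δm²)C₀` of (1.21) per unit `(−δm²)²`, both orientations). [cite: Balaban1983Higgs3, (1.21) p.416]
[cite: GlimmJaffeQP1987, §8.3] -/
theorem cum3_massForm_massForm_legs (hw : 0 < w) (hm : 0 < m2) (a b : Fin N) (x x' : Site P j) :
    (∫ φ, weight C η w c m2 (0 : VecField P j ℝ) φ) ^ 2 * (∫ φ, weight C η w c m2 (0 : VecField P j ℝ) φ * (massForm w φ ^ 2 * (⟪φ x, EuclideanSpace.basisFun (Fin N) ℝ a⟫_ℝ * ⟪φ x', EuclideanSpace.basisFun (Fin N) ℝ b⟫_ℝ)))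
      - (∫ φ, weight C η w c m2 (0 : VecField P j ℝ) φ) * (∫ φ, weight C η w c m2 (0 : VecField P j ℝ) φ * (⟪φ x, EuclideanSpace.basisFun (Fin N) ℝ a⟫_ℝ * ⟪φ x', EuclideanSpace.basisFun (Fin N) ℝ b⟫_ℝ)) * (∫ φ, weight C η w c m2 (0 : VecField P j ℝ) φ * massForm w φ ^ 2)
      - 2 * (∫ φ, weight C η w c m2 (0 : VecField P j ℝ) φ) * (∫ φ, weight C η w c m2 (0 : VecField P j ℝ) φ * massForm w φ) * (∫ φ, weight C η w c m2 (0 : VecField P j ℝ) φ * (massForm w φ * (⟪φ x, EuclideanSpace.basisFun (Fin N) ℝ a⟫_ℝ * ⟪φ x', EuclideanSpace.basisFun (Fin N) ℝ b⟫_ℝ)))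
      + 2 * (∫ φ, weight C η w c m2 (0 : VecField P j ℝ) φ * (⟪φ x, EuclideanSpace.basisFun (Fin N) ℝ a⟫_ℝ * ⟪φ x', EuclideanSpace.basisFun (Fin N) ℝ b⟫_ℝ)) * (∫ φ, weight C η w c m2 (0 : VecField P j ℝ) φ * massForm w φ) ^ 2
      = (∫ φ, weight C η w c m2 (0 : VecField P j ℝ) φ) ^ 3 * ⟪EuclideanSpace.basisFun (Fin N) ℝ a, EuclideanSpace.basisFun (Fin N) ℝ b⟫_ℝ * ∑ y : Site P j, ∑ z : Site P j, w * w *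
          (4 * G w c m2 z y * (G w c m2 x y * G w c m2 z x' + G w c m2 x' y * G w c m2 z x)) := by
  rw [integral_massForm_sq_legs C η w c m2 hw hm a b x x', integral_massForm_legs C η w c m2 hw hm a b x x',
    integral_massForm_sq C η w c m2 hw hm, integral_massForm C η w c m2 hw hm, integral_legs C η w c m2 hw hm a b x x']
  set Z : ℝ := ∫ φ, weight C η w c m2 (0 : VecField P j ℝ) φ with hZdef
  set dab : ℝ := ⟪EuclideanSpace.basisFun (Fin N) ℝ a, EuclideanSpace.basisFun (Fin N) ℝ b⟫_ℝ with hdab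
  set g : ℝ := G w c m2 x x' with hg
  set QQa : ℝ := ∑ y : Site P j, ∑ z : Site P j, w * w * (2 * N * G w c m2 z y ^ 2) with hQQa
  set CH : ℝ := ∑ y : Site P j, ∑ z : Site P j, w * w *
      (4 * G w c m2 z y * (G w c m2 x y * G w c m2 z x' + G w c m2 x' y * G w c m2 z x)) with hCH
  set QQc : ℝ := ∑ y : Site P j, ∑ z : Site P j, w * w * (N * G w c m2 z z * (2 * (G w c m2 x y * G w c m2 x' y))) with hQQc
  set QQe : ℝ := ∑ y : Site P j, ∑ z : Site P j, w * w * (N * G w c m2 y y * (2 * (G w c m2 x z * G w c m2 x' z))) with hQQe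
  set QQd : ℝ := ∑ y : Site P j, ∑ z : Site P j, w * w * (N * G w c m2 y y * (N * G w c m2 z z)) with hQQd
  set sQ : ℝ := ∑ z : Site P j, w * (N * G w c m2 z z) with hsQ
  set sQF : ℝ := ∑ z : Site P j, w * (2 * (G w c m2 x z * G w c m2 x' z)) with hsQF
  have hs : sQ * sQF = QQe := by
    rw [hsQ, hsQF, Finset.sum_mul_sum, hQQe]
    exact Finset.sum_congr rfl fun y _ => Finset.sum_congr rfl fun z _ => by ring
  have hsym : QQc = QQe := by
    rw [hQQc, hQQe, Finset.sum_comm]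
  linear_combination (Z ^ 3 * dab) * hsym + (-2 * Z ^ 3 * dab) * hs

/-- **`⟨φ_a(x)φ_b(x′); V; Q⟩`, THE QUARTIC VERTEX AND ONE MASS INSERTION**: the third joint cumulant is
`Z³·δ_{ab}·Σ_{y,z}η^{2d}[8(N+2)C(z,y)²C(x,y)C(x′,y) + 2(N+2)C(y,y)·4C(z,y)(C(x,y)C(z,x′) + C(x′,y)C(z,x))]` — THE TADPOLE WHOSE LOOP
CARRIES THE MASS INSERTION (1PI) plus THE CHAIN tadpole–mass insertion (one-particle reducible, both orders); every disconnected
product cancels. [cite: Balaban1983Higgs3, (1.21)–(1.22) p.416] [cite: GlimmJaffeQP1987, §8.3] -/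
theorem cum3_V_massForm_legs (hw : 0 < w) (hm : 0 < m2) (a b : Fin N) (x x' : Site P j) :
    (∫ φ, weight C η w c m2 (0 : VecField P j ℝ) φ) ^ 2 * (∫ φ, weight C η w c m2 (0 : VecField P j ℝ) φ * ((∑ y : Site P j, w * ‖φ y‖ ^ 4) * (massForm w φ * (⟪φ x, EuclideanSpace.basisFun (Fin N) ℝ a⟫_ℝ * ⟪φ x', EuclideanSpace.basisFun (Fin N) ℝ b⟫_ℝ))))
      - (∫ φ, weight C η w c m2 (0 : VecField P j ℝ) φ) * (∫ φ, weight C η w c m2 (0 : VecField P j ℝ) φ * (⟪φ x, EuclideanSpace.basisFun (Fin N) ℝ a⟫_ℝ * ⟪φ x', EuclideanSpace.basisFun (Fin N) ℝ b⟫_ℝ)) * (∫ φ, weight C η w c m2 (0 : VecField P j ℝ) φ * ((∑ y : Site P j, w * ‖φ y‖ ^ 4) * massForm w φ))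
      - (∫ φ, weight C η w c m2 (0 : VecField P j ℝ) φ) * (∫ φ, weight C η w c m2 (0 : VecField P j ℝ) φ * (∑ y : Site P j, w * ‖φ y‖ ^ 4)) * (∫ φ, weight C η w c m2 (0 : VecField P j ℝ) φ * (massForm w φ * (⟪φ x, EuclideanSpace.basisFun (Fin N) ℝ a⟫_ℝ * ⟪φ x', EuclideanSpace.basisFun (Fin N) ℝ b⟫_ℝ)))
      - (∫ φ, weight C η w c m2 (0 : VecField P j ℝ) φ) * (∫ φ, weight C η w c m2 (0 : VecField P j ℝ) φ * massForm w φ) * (∫ φ, weight C η w c m2 (0 : VecField P j ℝ) φ * ((∑ y : Site P j, w * ‖φ y‖ ^ 4) * (⟪φ x, EuclideanSpace.basisFun (Fin N) ℝ a⟫_ℝ * ⟪φ x', EuclideanSpace.basisFun (Fin N) ℝ b⟫_ℝ)))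
      + 2 * (∫ φ, weight C η w c m2 (0 : VecField P j ℝ) φ * (⟪φ x, EuclideanSpace.basisFun (Fin N) ℝ a⟫_ℝ * ⟪φ x', EuclideanSpace.basisFun (Fin N) ℝ b⟫_ℝ)) * (∫ φ, weight C η w c m2 (0 : VecField P j ℝ) φ * (∑ y : Site P j, w * ‖φ y‖ ^ 4)) * (∫ φ, weight C η w c m2 (0 : VecField P j ℝ) φ * massForm w φ)
      = (∫ φ, weight C η w c m2 (0 : VecField P j ℝ) φ) ^ 3 * ⟪EuclideanSpace.basisFun (Fin N) ℝ a, EuclideanSpace.basisFun (Fin N) ℝ b⟫_ℝ * ∑ y : Site P j, ∑ z : Site P j, w * w *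
          (8 * (N + 2) * G w c m2 z y ^ 2 * (G w c m2 x y * G w c m2 x' y)
            + 2 * (N + 2) * G w c m2 y y * (4 * G w c m2 z y * (G w c m2 x y * G w c m2 z x' + G w c m2 x' y * G w c m2 z x))) := by
  rw [integral_V_massForm_legs C η w c m2 hw hm a b x x', integral_V_massForm C η w c m2 hw hm,
    integral_V C η w c m2 hw hm, integral_massForm_legs C η w c m2 hw hm a b x x', integral_massForm C η w c m2 hw hm,
    integral_V_mul_legs C η w c m2 hw hm a b x x', integral_legs C η w c m2 hw hm a b x x']
  set Z : ℝ := ∫ φ, weight C η w c m2 (0 : VecField P j ℝ) φ with hZdef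
  set dab : ℝ := ⟪EuclideanSpace.basisFun (Fin N) ℝ a, EuclideanSpace.basisFun (Fin N) ℝ b⟫_ℝ with hdab
  set g : ℝ := G w c m2 x x' with hg
  set T1 : ℝ := ∑ y : Site P j, ∑ z : Site P j, w * w * (8 * (N + 2) * G w c m2 z y ^ 2 * (G w c m2 x y * G w c m2 x' y))
    with hT1
  set VQa : ℝ := ∑ y : Site P j, ∑ z : Site P j, w * w * (2 * (N + 2) * G w c m2 y y * (2 * N * G w c m2 z y ^ 2)) with hVQa
  set VQb : ℝ := ∑ y : Site P j, ∑ z : Site P j, w * w *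
      (2 * (N + 2) * G w c m2 y y * (4 * G w c m2 z y * (G w c m2 x y * G w c m2 z x' + G w c m2 x' y * G w c m2 z x))) with hVQb
  set VQc : ℝ := ∑ y : Site P j, ∑ z : Site P j, w * w *
      (2 * (N + 2) * G w c m2 y y * (N * G w c m2 z z) * (2 * (G w c m2 x y * G w c m2 x' y))) with hVQc
  set VQd : ℝ := ∑ y : Site P j, ∑ z : Site P j, w * w * (N * (N + 2) * G w c m2 y y ^ 2 * (2 * (G w c m2 x z * G w c m2 x' z)))
    with hVQd
  set VQe : ℝ := ∑ y : Site P j, ∑ z : Site P j, w * w * (N * (N + 2) * G w c m2 y y ^ 2 * (N * G w c m2 z z)) with hVQe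
  set sV : ℝ := ∑ y : Site P j, w * (N * (N + 2) * G w c m2 y y ^ 2) with hsV
  set s2 : ℝ := ∑ y : Site P j, w *
      (N * (N + 2) * G w c m2 y y ^ 2 * G w c m2 x x' + 4 * (N + 2) * G w c m2 y y * (G w c m2 x y * G w c m2 x' y)) with hs2
  set sQ : ℝ := ∑ z : Site P j, w * (N * G w c m2 z z) with hsQ
  set sQF : ℝ := ∑ z : Site P j, w * (2 * (G w c m2 x z * G w c m2 x' z)) with hsQF
  have hs1 : sV * sQF = VQd := by
    rw [hsV, hsQF, Finset.sum_mul_sum, hVQd]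
    exact Finset.sum_congr rfl fun y _ => Finset.sum_congr rfl fun z _ => by ring
  have hs2' : s2 * sQ = g * VQe + VQc := by
    rw [hs2, hsQ, Finset.sum_mul_sum, hVQe, hVQc, hg, Finset.mul_sum, ← Finset.sum_add_distrib]
    refine Finset.sum_congr rfl fun y _ => ?_
    rw [Finset.mul_sum, ← Finset.sum_add_distrib]
    exact Finset.sum_congr rfl fun z _ => by ring
  have hs3 : sV * sQ = VQe := by
    rw [hsV, hsQ, Finset.sum_mul_sum, hVQe]
    exact Finset.sum_congr rfl fun y _ => Finset.sum_congr rfl fun z _ => by ring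
  have hsplit : (∑ y : Site P j, ∑ z : Site P j, w * w *
      (8 * (N + 2) * G w c m2 z y ^ 2 * (G w c m2 x y * G w c m2 x' y)
        + 2 * (N + 2) * G w c m2 y y * (4 * G w c m2 z y * (G w c m2 x y * G w c m2 z x' + G w c m2 x' y * G w c m2 z x))))
      = T1 + VQb := by
    rw [hT1, hVQb, ← Finset.sum_add_distrib]
    refine Finset.sum_congr rfl fun y _ => ?_
    rw [← Finset.sum_add_distrib]
    exact Finset.sum_congr rfl fun z _ => by ring
  linear_combination (-(Z ^ 3 * dab)) * hs1 + (-(Z ^ 3 * dab)) * hs2' + (Z ^ 3 * dab * g) * hs3 + (-(Z ^ 3 * dab)) * hsplit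

/-- **`⟨φ_a(x)φ_b(x′); V; V⟩`, TWO QUARTIC VERTICES** (BRICK 1 §11's moments, Z-cleared): the third joint cumulant is
`Z³·δ_{ab}·Σ_{y,z}η^{2d}[SUNSET ⑥ 4²(2N+4)C(z,y)³(C(x,y)C(z,x′)+C(x′,y)C(z,x)) + local two-loop graph (both placements) + chain of two
tadpoles]` — basketballs, bubbles and double self-lines cancel. [cite: Balaban1983Higgs3, (1.21)–(1.22) p.416] [cite: GlimmJaffeQP1987, §8.3] -/
theorem cum3_V_V_legs (hw : 0 < w) (hm : 0 < m2) (a b : Fin N) (x x' : Site P j) :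
    (∫ φ, weight C η w c m2 (0 : VecField P j ℝ) φ) ^ 2 * (∫ φ, weight C η w c m2 (0 : VecField P j ℝ) φ * ((∑ y : Site P j, w * ‖φ y‖ ^ 4) ^ 2 * (⟪φ x, EuclideanSpace.basisFun (Fin N) ℝ a⟫_ℝ * ⟪φ x', EuclideanSpace.basisFun (Fin N) ℝ b⟫_ℝ)))
      - (∫ φ, weight C η w c m2 (0 : VecField P j ℝ) φ) * (∫ φ, weight C η w c m2 (0 : VecField P j ℝ) φ * (⟪φ x, EuclideanSpace.basisFun (Fin N) ℝ a⟫_ℝ * ⟪φ x', EuclideanSpace.basisFun (Fin N) ℝ b⟫_ℝ)) * (∫ φ, weight C η w c m2 (0 : VecField P j ℝ) φ * (∑ y : Site P j, w * ‖φ y‖ ^ 4) ^ 2)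
      - 2 * (∫ φ, weight C η w c m2 (0 : VecField P j ℝ) φ) * (∫ φ, weight C η w c m2 (0 : VecField P j ℝ) φ * (∑ y : Site P j, w * ‖φ y‖ ^ 4)) * (∫ φ, weight C η w c m2 (0 : VecField P j ℝ) φ * ((∑ y : Site P j, w * ‖φ y‖ ^ 4) * (⟪φ x, EuclideanSpace.basisFun (Fin N) ℝ a⟫_ℝ * ⟪φ x', EuclideanSpace.basisFun (Fin N) ℝ b⟫_ℝ)))
      + 2 * (∫ φ, weight C η w c m2 (0 : VecField P j ℝ) φ * (⟪φ x, EuclideanSpace.basisFun (Fin N) ℝ a⟫_ℝ * ⟪φ x', EuclideanSpace.basisFun (Fin N) ℝ b⟫_ℝ)) * (∫ φ, weight C η w c m2 (0 : VecField P j ℝ) φ * (∑ y : Site P j, w * ‖φ y‖ ^ 4)) ^ 2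
      = (∫ φ, weight C η w c m2 (0 : VecField P j ℝ) φ) ^ 3 * ⟪EuclideanSpace.basisFun (Fin N) ℝ a, EuclideanSpace.basisFun (Fin N) ℝ b⟫_ℝ * ∑ y : Site P j, ∑ z : Site P j, w * w *
          (4 ^ 2 * (2 * N + 4) * G w c m2 z y ^ 3 * (G w c m2 x y * G w c m2 z x' + G w c m2 x' y * G w c m2 z x)
            + 2 * (N + 2) * G w c m2 z z * (8 * (N + 2) * G w c m2 z y ^ 2 * (G w c m2 x y * G w c m2 x' y))
            + 2 * (N + 2) * G w c m2 y y * (8 * (N + 2) * G w c m2 y z ^ 2 * (G w c m2 x z * G w c m2 x' z))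
            + 2 * (N + 2) * G w c m2 y y * (2 * (N + 2) * G w c m2 z z)
              * (4 * G w c m2 z y * (G w c m2 x y * G w c m2 z x' + G w c m2 x' y * G w c m2 z x))) := by
  rw [integral_V_sq_legs C η w c m2 hw hm a b x x', integral_legs C η w c m2 hw hm a b x x',
    integral_V_sq C η w c m2 hw hm, integral_V C η w c m2 hw hm, integral_V_mul_legs C η w c m2 hw hm a b x x']
  set Z : ℝ := ∫ φ, weight C η w c m2 (0 : VecField P j ℝ) φ with hZdef
  set dab : ℝ := ⟪EuclideanSpace.basisFun (Fin N) ℝ a, EuclideanSpace.basisFun (Fin N) ℝ b⟫_ℝ with hdab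
  set g : ℝ := G w c m2 x x' with hg
  set A : ℝ := ∑ y : Site P j, ∑ z : Site P j, w * w * (8 * (N * (N + 2)) * G w c m2 z y ^ 4) with hA
  set D3 : ℝ := ∑ y : Site P j, ∑ z : Site P j, w * w *
      (4 ^ 2 * (2 * N + 4) * G w c m2 z y ^ 3 * (G w c m2 x y * G w c m2 z x' + G w c m2 x' y * G w c m2 z x)
        + 2 * (N + 2) * G w c m2 z z * (8 * (N + 2) * G w c m2 z y ^ 2 * (G w c m2 x y * G w c m2 x' y))
        + 2 * (N + 2) * G w c m2 y y * (8 * (N + 2) * G w c m2 y z ^ 2 * (G w c m2 x z * G w c m2 x' z))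
        + 2 * (N + 2) * G w c m2 y y * (2 * (N + 2) * G w c m2 z z)
          * (4 * G w c m2 z y * (G w c m2 x y * G w c m2 z x' + G w c m2 x' y * G w c m2 z x))) with hD3
  set Bb : ℝ := ∑ y : Site P j, ∑ z : Site P j, w * w *
      (2 * (N + 2) * G w c m2 y y * (2 * (N + 2) * G w c m2 z z) * (2 * N * G w c m2 z y ^ 2)) with hBb
  set Aab : ℝ := ∑ y : Site P j, ∑ z : Site P j, w * w *
      (2 * (N + 2) * G w c m2 y y * (N * (N + 2) * G w c m2 z z ^ 2) * (G w c m2 x y * G w c m2 x' y)) with hAab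
  set Bβ : ℝ := ∑ y : Site P j, ∑ z : Site P j, w * w *
      (N * (N + 2) * G w c m2 y y ^ 2 * (N * (N + 2) * G w c m2 z z ^ 2)) with hBβ
  set Aβa : ℝ := ∑ y : Site P j, ∑ z : Site P j, w * w *
      (N * (N + 2) * G w c m2 y y ^ 2 * (2 * (N + 2) * G w c m2 z z) * (G w c m2 x z * G w c m2 x' z)) with hAβa
  set sβ : ℝ := ∑ y : Site P j, w * (N * (N + 2) * G w c m2 y y ^ 2) with hsβ
  set s2 : ℝ := ∑ y : Site P j, w *
      (N * (N + 2) * G w c m2 y y ^ 2 * G w c m2 x x' + 4 * (N + 2) * G w c m2 y y * (G w c m2 x y * G w c m2 x' y)) with hs2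
  have hs1 : sβ * s2 = g * Bβ + 2 * Aβa := by
    rw [hsβ, hs2, Finset.sum_mul_sum, hBβ, hAβa, hg, Finset.mul_sum, Finset.mul_sum, ← Finset.sum_add_distrib]
    refine Finset.sum_congr rfl fun y _ => ?_
    rw [Finset.mul_sum, Finset.mul_sum, ← Finset.sum_add_distrib]
    exact Finset.sum_congr rfl fun z _ => by ring
  have hs2' : sβ ^ 2 = Bβ := by
    rw [hsβ, sq, Finset.sum_mul_sum, hBβ]
    exact Finset.sum_congr rfl fun y _ => Finset.sum_congr rfl fun z _ => by ring
  have hsym : Aab = Aβa := by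
    rw [hAab, hAβa, Finset.sum_comm]
    exact Finset.sum_congr rfl fun y _ => Finset.sum_congr rfl fun z _ => by ring
  linear_combination (-2 * Z ^ 3 * dab) * hs1 + (2 * Z ^ 3 * dab * g) * hs2' + (2 * Z ^ 3 * dab) * hsym

end Cumulants


/-! ## §6 THE ORDER-`λ²` COEFFICIENT OF (1.19) WITH THE COUNTERTERM `λδm²_{(0,1)} + λ²δm²_{(0,2)}` INSERTED (e = 0): the second
right-derivative at `λ = 0⁺` DERIVED and EVALUATED — sunset ⑥ + the tadpole with the first-order-corrected loop + the chain of two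
first-order letters + the mass insertion `C₀(−2δ₂)C₀` -/

section SecondOrder

/-- expansion of the shifted interaction squared against the legs:
`∫W(V+½δ₁Q)²φφ = ∫WV²φφ + δ₁∫WVQφφ + (δ₁²/4)∫WQ²φφ`. [cite: Balaban1983Higgs3, (1.20) p.416] -/
theorem integral_V1_sq_legs (hw : 0 < w) (hm : 0 < m2) (δ₁ : ℝ) (a b : Fin N) (x x' : Site P j) :
    (∫ φ, weight C η w c m2 (0 : VecField P j ℝ) φ * (((∑ y : Site P j, w * ‖φ y‖ ^ 4) + 1 / 2 * δ₁ * massForm w φ) ^ 2 * (⟪φ x, EuclideanSpace.basisFun (Fin N) ℝ a⟫_ℝ * ⟪φ x', EuclideanSpace.basisFun (Fin N) ℝ b⟫_ℝ)))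
      = (∫ φ, weight C η w c m2 (0 : VecField P j ℝ) φ * ((∑ y : Site P j, w * ‖φ y‖ ^ 4) ^ 2 * (⟪φ x, EuclideanSpace.basisFun (Fin N) ℝ a⟫_ℝ * ⟪φ x', EuclideanSpace.basisFun (Fin N) ℝ b⟫_ℝ))) + δ₁ * (∫ φ, weight C η w c m2 (0 : VecField P j ℝ) φ * ((∑ y : Site P j, w * ‖φ y‖ ^ 4) * (massForm w φ * (⟪φ x, EuclideanSpace.basisFun (Fin N) ℝ a⟫_ℝ * ⟪φ x', EuclideanSpace.basisFun (Fin N) ℝ b⟫_ℝ))))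
        + δ₁ ^ 2 / 4 * (∫ φ, weight C η w c m2 (0 : VecField P j ℝ) φ * (massForm w φ ^ 2 * (⟪φ x, EuclideanSpace.basisFun (Fin N) ℝ a⟫_ℝ * ⟪φ x', EuclideanSpace.basisFun (Fin N) ℝ b⟫_ℝ))) := by
  have hF := expGrowth_legs (P := P) (j := j) a b x x'
  have hV := expGrowth_V (P := P) (j := j) (N := N) w
  have hQ := (expGrowth_V_add_massForm (P := P) (j := j) (N := N) w 0).2
  have e : (fun φ : Cfg P j N => weight C η w c m2 (0 : VecField P j ℝ) φ * (((∑ y : Site P j, w * ‖φ y‖ ^ 4) + 1 / 2 * δ₁ * massForm w φ) ^ 2 * (⟪φ x, EuclideanSpace.basisFun (Fin N) ℝ a⟫_ℝ * ⟪φ x', EuclideanSpace.basisFun (Fin N) ℝ b⟫_ℝ)))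
      = fun φ => weight C η w c m2 (0 : VecField P j ℝ) φ * (1 * ((∑ y : Site P j, w * ‖φ y‖ ^ 4) * (∑ y : Site P j, w * ‖φ y‖ ^ 4) * (⟪φ x, EuclideanSpace.basisFun (Fin N) ℝ a⟫_ℝ * ⟪φ x', EuclideanSpace.basisFun (Fin N) ℝ b⟫_ℝ)) + δ₁ * ((∑ y : Site P j, w * ‖φ y‖ ^ 4) * (massForm w φ * (⟪φ x, EuclideanSpace.basisFun (Fin N) ℝ a⟫_ℝ * ⟪φ x', EuclideanSpace.basisFun (Fin N) ℝ b⟫_ℝ)))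
          + δ₁ ^ 2 / 4 * (massForm w φ * massForm w φ * (⟪φ x, EuclideanSpace.basisFun (Fin N) ℝ a⟫_ℝ * ⟪φ x', EuclideanSpace.basisFun (Fin N) ℝ b⟫_ℝ))) := by
    funext φ; ring
  have e1 : (∫ φ, weight C η w c m2 (0 : VecField P j ℝ) φ * ((∑ y : Site P j, w * ‖φ y‖ ^ 4) * (∑ y : Site P j, w * ‖φ y‖ ^ 4) * (⟪φ x, EuclideanSpace.basisFun (Fin N) ℝ a⟫_ℝ * ⟪φ x', EuclideanSpace.basisFun (Fin N) ℝ b⟫_ℝ))) = ∫ φ, weight C η w c m2 (0 : VecField P j ℝ) φ * ((∑ y : Site P j, w * ‖φ y‖ ^ 4) ^ 2 * (⟪φ x, EuclideanSpace.basisFun (Fin N) ℝ a⟫_ℝ * ⟪φ x', EuclideanSpace.basisFun (Fin N) ℝ b⟫_ℝ)) :=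
    integral_congr_ae (Filter.Eventually.of_forall fun φ => by ring)
  have e2 : (∫ φ, weight C η w c m2 (0 : VecField P j ℝ) φ * (massForm w φ * massForm w φ * (⟪φ x, EuclideanSpace.basisFun (Fin N) ℝ a⟫_ℝ * ⟪φ x', EuclideanSpace.basisFun (Fin N) ℝ b⟫_ℝ))) = ∫ φ, weight C η w c m2 (0 : VecField P j ℝ) φ * (massForm w φ ^ 2 * (⟪φ x, EuclideanSpace.basisFun (Fin N) ℝ a⟫_ℝ * ⟪φ x', EuclideanSpace.basisFun (Fin N) ℝ b⟫_ℝ)) :=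
    integral_congr_ae (Filter.Eventually.of_forall fun φ => by ring)
  rw [show (∫ φ, weight C η w c m2 (0 : VecField P j ℝ) φ * (((∑ y : Site P j, w * ‖φ y‖ ^ 4) + 1 / 2 * δ₁ * massForm w φ) ^ 2 * (⟪φ x, EuclideanSpace.basisFun (Fin N) ℝ a⟫_ℝ * ⟪φ x', EuclideanSpace.basisFun (Fin N) ℝ b⟫_ℝ))) = ∫ φ, (fun φ : Cfg P j N => weight C η w c m2 (0 : VecField P j ℝ) φ * (((∑ y : Site P j, w * ‖φ y‖ ^ 4) + 1 / 2 * δ₁ * massForm w φ) ^ 2 * (⟪φ x, EuclideanSpace.basisFun (Fin N) ℝ a⟫_ℝ * ⟪φ x', EuclideanSpace.basisFun (Fin N) ℝ b⟫_ℝ))) φ from rfl, e,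
    integral_W_lin3 C η w c m2 hw hm ((hV.mul hV).mul hF) (hV.mul (hQ.mul hF)) ((hQ.mul hQ).mul hF), e1, e2]
  ring

/-- `∫W(V+½δ₁Q)² = ∫WV² + δ₁∫WVQ + (δ₁²/4)∫WQ²`. [cite: Balaban1983Higgs3, (1.20) p.416] -/
theorem integral_V1_sq (hw : 0 < w) (hm : 0 < m2) (δ₁ : ℝ) :
    (∫ φ, weight C η w c m2 (0 : VecField P j ℝ) φ * ((∑ y : Site P j, w * ‖φ y‖ ^ 4) + 1 / 2 * δ₁ * massForm w φ) ^ 2)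
      = (∫ φ, weight C η w c m2 (0 : VecField P j ℝ) φ * (∑ y : Site P j, w * ‖φ y‖ ^ 4) ^ 2) + δ₁ * (∫ φ, weight C η w c m2 (0 : VecField P j ℝ) φ * ((∑ y : Site P j, w * ‖φ y‖ ^ 4) * massForm w φ))
        + δ₁ ^ 2 / 4 * (∫ φ, weight C η w c m2 (0 : VecField P j ℝ) φ * massForm w φ ^ 2) := by
  have hV := expGrowth_V (P := P) (j := j) (N := N) w
  have hQ := (expGrowth_V_add_massForm (P := P) (j := j) (N := N) w 0).2
  have e : (fun φ : Cfg P j N => weight C η w c m2 (0 : VecField P j ℝ) φ * ((∑ y : Site P j, w * ‖φ y‖ ^ 4) + 1 / 2 * δ₁ * massForm w φ) ^ 2)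
      = fun φ => weight C η w c m2 (0 : VecField P j ℝ) φ * (1 * ((∑ y : Site P j, w * ‖φ y‖ ^ 4) * (∑ y : Site P j, w * ‖φ y‖ ^ 4)) + δ₁ * ((∑ y : Site P j, w * ‖φ y‖ ^ 4) * massForm w φ)
          + δ₁ ^ 2 / 4 * (massForm w φ * massForm w φ)) := by
    funext φ; ring
  have e1 : (∫ φ, weight C η w c m2 (0 : VecField P j ℝ) φ * ((∑ y : Site P j, w * ‖φ y‖ ^ 4) * (∑ y : Site P j, w * ‖φ y‖ ^ 4))) = ∫ φ, weight C η w c m2 (0 : VecField P j ℝ) φ * (∑ y : Site P j, w * ‖φ y‖ ^ 4) ^ 2 :=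
    integral_congr_ae (Filter.Eventually.of_forall fun φ => by ring)
  have e2 : (∫ φ, weight C η w c m2 (0 : VecField P j ℝ) φ * (massForm w φ * massForm w φ)) = ∫ φ, weight C η w c m2 (0 : VecField P j ℝ) φ * massForm w φ ^ 2 :=
    integral_congr_ae (Filter.Eventually.of_forall fun φ => by ring)
  rw [show (∫ φ, weight C η w c m2 (0 : VecField P j ℝ) φ * ((∑ y : Site P j, w * ‖φ y‖ ^ 4) + 1 / 2 * δ₁ * massForm w φ) ^ 2) = ∫ φ, (fun φ : Cfg P j N => weight C η w c m2 (0 : VecField P j ℝ) φ * ((∑ y : Site P j, w * ‖φ y‖ ^ 4) + 1 / 2 * δ₁ * massForm w φ) ^ 2) φ from rfl, e,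
    integral_W_lin3 C η w c m2 hw hm (hV.mul hV) (hV.mul hQ) (hQ.mul hQ), e1, e2]
  ring

/-- `∫W(V+½δ₁Q)φφ = ∫WVφφ + (δ₁/2)∫WQφφ`. [cite: Balaban1983Higgs3, (1.20) p.416] -/
theorem integral_V1_legs (hw : 0 < w) (hm : 0 < m2) (δ₁ : ℝ) (a b : Fin N) (x x' : Site P j) :
    (∫ φ, weight C η w c m2 (0 : VecField P j ℝ) φ * (((∑ y : Site P j, w * ‖φ y‖ ^ 4) + 1 / 2 * δ₁ * massForm w φ) * (⟪φ x, EuclideanSpace.basisFun (Fin N) ℝ a⟫_ℝ * ⟪φ x', EuclideanSpace.basisFun (Fin N) ℝ b⟫_ℝ)))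
      = (∫ φ, weight C η w c m2 (0 : VecField P j ℝ) φ * ((∑ y : Site P j, w * ‖φ y‖ ^ 4) * (⟪φ x, EuclideanSpace.basisFun (Fin N) ℝ a⟫_ℝ * ⟪φ x', EuclideanSpace.basisFun (Fin N) ℝ b⟫_ℝ))) + δ₁ / 2 * (∫ φ, weight C η w c m2 (0 : VecField P j ℝ) φ * (massForm w φ * (⟪φ x, EuclideanSpace.basisFun (Fin N) ℝ a⟫_ℝ * ⟪φ x', EuclideanSpace.basisFun (Fin N) ℝ b⟫_ℝ))) := by
  have hF := expGrowth_legs (P := P) (j := j) a b x x'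
  have hV := expGrowth_V (P := P) (j := j) (N := N) w
  have hQ := (expGrowth_V_add_massForm (P := P) (j := j) (N := N) w 0).2
  have e : (fun φ : Cfg P j N => weight C η w c m2 (0 : VecField P j ℝ) φ * (((∑ y : Site P j, w * ‖φ y‖ ^ 4) + 1 / 2 * δ₁ * massForm w φ) * (⟪φ x, EuclideanSpace.basisFun (Fin N) ℝ a⟫_ℝ * ⟪φ x', EuclideanSpace.basisFun (Fin N) ℝ b⟫_ℝ)))
      = fun φ => weight C η w c m2 (0 : VecField P j ℝ) φ * (1 * ((∑ y : Site P j, w * ‖φ y‖ ^ 4) * (⟪φ x, EuclideanSpace.basisFun (Fin N) ℝ a⟫_ℝ * ⟪φ x', EuclideanSpace.basisFun (Fin N) ℝ b⟫_ℝ)) + δ₁ / 2 * (massForm w φ * (⟪φ x, EuclideanSpace.basisFun (Fin N) ℝ a⟫_ℝ * ⟪φ x', EuclideanSpace.basisFun (Fin N) ℝ b⟫_ℝ)) + 0 * (1 : ℝ)) := by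
    funext φ; ring
  rw [show (∫ φ, weight C η w c m2 (0 : VecField P j ℝ) φ * (((∑ y : Site P j, w * ‖φ y‖ ^ 4) + 1 / 2 * δ₁ * massForm w φ) * (⟪φ x, EuclideanSpace.basisFun (Fin N) ℝ a⟫_ℝ * ⟪φ x', EuclideanSpace.basisFun (Fin N) ℝ b⟫_ℝ))) = ∫ φ, (fun φ : Cfg P j N => weight C η w c m2 (0 : VecField P j ℝ) φ * (((∑ y : Site P j, w * ‖φ y‖ ^ 4) + 1 / 2 * δ₁ * massForm w φ) * (⟪φ x, EuclideanSpace.basisFun (Fin N) ℝ a⟫_ℝ * ⟪φ x', EuclideanSpace.basisFun (Fin N) ℝ b⟫_ℝ))) φ from rfl, e,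
    integral_W_lin3 C η w c m2 hw hm (hV.mul hF) (hQ.mul hF) (ExpGrowth.const 1)]
  ring

/-- `∫W(V+½δ₁Q) = ∫WV + (δ₁/2)∫WQ`. [cite: Balaban1983Higgs3, (1.20) p.416] -/
theorem integral_V1 (hw : 0 < w) (hm : 0 < m2) (δ₁ : ℝ) :
    (∫ φ, weight C η w c m2 (0 : VecField P j ℝ) φ * ((∑ y : Site P j, w * ‖φ y‖ ^ 4) + 1 / 2 * δ₁ * massForm w φ)) = (∫ φ, weight C η w c m2 (0 : VecField P j ℝ) φ * (∑ y : Site P j, w * ‖φ y‖ ^ 4)) + δ₁ / 2 * (∫ φ, weight C η w c m2 (0 : VecField P j ℝ) φ * massForm w φ) := by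
  have hV := expGrowth_V (P := P) (j := j) (N := N) w
  have hQ := (expGrowth_V_add_massForm (P := P) (j := j) (N := N) w 0).2
  have e : (fun φ : Cfg P j N => weight C η w c m2 (0 : VecField P j ℝ) φ * ((∑ y : Site P j, w * ‖φ y‖ ^ 4) + 1 / 2 * δ₁ * massForm w φ))
      = fun φ => weight C η w c m2 (0 : VecField P j ℝ) φ * (1 * (∑ y : Site P j, w * ‖φ y‖ ^ 4) + δ₁ / 2 * massForm w φ + 0 * (1 : ℝ)) := by
    funext φ; ring
  rw [show (∫ φ, weight C η w c m2 (0 : VecField P j ℝ) φ * ((∑ y : Site P j, w * ‖φ y‖ ^ 4) + 1 / 2 * δ₁ * massForm w φ)) = ∫ φ, (fun φ : Cfg P j N => weight C η w c m2 (0 : VecField P j ℝ) φ * ((∑ y : Site P j, w * ‖φ y‖ ^ 4) + 1 / 2 * δ₁ * massForm w φ)) φ from rfl, e,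
    integral_W_lin3 C η w c m2 hw hm hV hQ (ExpGrowth.const 1)]
  ring

/-- **THE SECOND RIGHT `λ`-DERIVATIVE AT `0⁺` OF (1.19) WITH `δm² = λδ₁ + λ²δ₂` INSERTED (e = 0), EVALUATED**: the quotient-rule
expression `D₁(λ)` (= the first derivative on the window, `hasDerivWithinAt_ratio`) of the two-point function
`G_{ab}(λ;x,x′) = ∫We^{−[λ(V+½δ₁Q)+λ²·½δ₂Q]}φ_a(x)φ_b(x′)/∫We^{−[…]}` has right-derivative at `λ = 0`
`δ_{ab}·{Σ_{y,z}η^{2d}[⑥ + two-loop (both placements) + tadpole chain] + δ₁·Σ_{y,z}η^{2d}[8(N+2)C(z,y)²C(x,y)C(x′,y) + 2(N+2)C(y,y)·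
4C(z,y)(…)] + (δ₁²/4)·Σ_{y,z}η^{2d}4C(z,y)(…) − δ₂·Σ_zη^d2C(x,z)C(x′,z)}` — BRICK 1's order-`λ²` graphs, the mass insertion on the
tadpole loop and the tadpole–insertion chains, the insertion–insertion chain, and the second-order mass insertion `C₀(−2δ₂)C₀`.
[cite: Balaban1983Higgs3, (1.19)–(1.22) p.416, (1.23) p.417] [cite: GlimmJaffeQP1987, §8.4–8.5] -/
theorem hasDerivWithinAt_D1_counterterm (hw : 0 < w) (hm : 0 < m2) (δ₁ δ₂ : ℝ) (a b : Fin N) (x x' : Site P j) {L : ℝ}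
    (hL0 : 0 < L) (hL1 : L ≤ 1) (hLκ : L * |1 / 2 * δ₂| ≤ m2 / 4) :
    HasDerivWithinAt
      (fun lam : ℝ =>
        (((-((∫ φ, weight C η w c m2 (0 : VecField P j ℝ) φ * (Real.exp (-(lam * ((∑ y : Site P j, w * ‖φ y‖ ^ 4) + 1 / 2 * δ₁ * massForm w φ) + lam ^ 2 * (1 / 2 * δ₂ * massForm w φ))) * (((∑ y : Site P j, w * ‖φ y‖ ^ 4) + 1 / 2 * δ₁ * massForm w φ) * (⟪φ x, EuclideanSpace.basisFun (Fin N) ℝ a⟫_ℝ * ⟪φ x', EuclideanSpace.basisFun (Fin N) ℝ b⟫_ℝ))))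
              + 2 * lam * (1 / 2 * δ₂) * ∫ φ, weight C η w c m2 (0 : VecField P j ℝ) φ * (Real.exp (-(lam * ((∑ y : Site P j, w * ‖φ y‖ ^ 4) + 1 / 2 * δ₁ * massForm w φ) + lam ^ 2 * (1 / 2 * δ₂ * massForm w φ))) * (massForm w φ * (⟪φ x, EuclideanSpace.basisFun (Fin N) ℝ a⟫_ℝ * ⟪φ x', EuclideanSpace.basisFun (Fin N) ℝ b⟫_ℝ)))))
            * (∫ φ, weight C η w c m2 (0 : VecField P j ℝ) φ * (Real.exp (-(lam * ((∑ y : Site P j, w * ‖φ y‖ ^ 4) + 1 / 2 * δ₁ * massForm w φ) + lam ^ 2 * (1 / 2 * δ₂ * massForm w φ))) * 1))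
          + (∫ φ, weight C η w c m2 (0 : VecField P j ℝ) φ * (Real.exp (-(lam * ((∑ y : Site P j, w * ‖φ y‖ ^ 4) + 1 / 2 * δ₁ * massForm w φ) + lam ^ 2 * (1 / 2 * δ₂ * massForm w φ))) * (⟪φ x, EuclideanSpace.basisFun (Fin N) ℝ a⟫_ℝ * ⟪φ x', EuclideanSpace.basisFun (Fin N) ℝ b⟫_ℝ)))
            * ((∫ φ, weight C η w c m2 (0 : VecField P j ℝ) φ * (Real.exp (-(lam * ((∑ y : Site P j, w * ‖φ y‖ ^ 4) + 1 / 2 * δ₁ * massForm w φ) + lam ^ 2 * (1 / 2 * δ₂ * massForm w φ))) * (((∑ y : Site P j, w * ‖φ y‖ ^ 4) + 1 / 2 * δ₁ * massForm w φ) * 1)))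
              + 2 * lam * (1 / 2 * δ₂) * ∫ φ, weight C η w c m2 (0 : VecField P j ℝ) φ * (Real.exp (-(lam * ((∑ y : Site P j, w * ‖φ y‖ ^ 4) + 1 / 2 * δ₁ * massForm w φ) + lam ^ 2 * (1 / 2 * δ₂ * massForm w φ))) * (massForm w φ * 1))))
          / (∫ φ, weight C η w c m2 (0 : VecField P j ℝ) φ * (Real.exp (-(lam * ((∑ y : Site P j, w * ‖φ y‖ ^ 4) + 1 / 2 * δ₁ * massForm w φ) + lam ^ 2 * (1 / 2 * δ₂ * massForm w φ))) * 1)) ^ 2))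
      (⟪EuclideanSpace.basisFun (Fin N) ℝ a, EuclideanSpace.basisFun (Fin N) ℝ b⟫_ℝ *
        ((∑ y : Site P j, ∑ z : Site P j, w * w *
            (4 ^ 2 * (2 * N + 4) * G w c m2 z y ^ 3 * (G w c m2 x y * G w c m2 z x' + G w c m2 x' y * G w c m2 z x)
              + 2 * (N + 2) * G w c m2 z z * (8 * (N + 2) * G w c m2 z y ^ 2 * (G w c m2 x y * G w c m2 x' y))
              + 2 * (N + 2) * G w c m2 y y * (8 * (N + 2) * G w c m2 y z ^ 2 * (G w c m2 x z * G w c m2 x' z))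
              + 2 * (N + 2) * G w c m2 y y * (2 * (N + 2) * G w c m2 z z)
                * (4 * G w c m2 z y * (G w c m2 x y * G w c m2 z x' + G w c m2 x' y * G w c m2 z x))))
          + δ₁ * (∑ y : Site P j, ∑ z : Site P j, w * w *
            (8 * (N + 2) * G w c m2 z y ^ 2 * (G w c m2 x y * G w c m2 x' y)
              + 2 * (N + 2) * G w c m2 y y * (4 * G w c m2 z y * (G w c m2 x y * G w c m2 z x' + G w c m2 x' y * G w c m2 z x))))
          + δ₁ ^ 2 / 4 * (∑ y : Site P j, ∑ z : Site P j, w * w *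
            (4 * G w c m2 z y * (G w c m2 x y * G w c m2 z x' + G w c m2 x' y * G w c m2 z x)))
          - δ₂ * ∑ z : Site P j, w * (2 * (G w c m2 x z * G w c m2 x' z))))
      (Set.Ici 0) 0 := by
  have hVQ := expGrowth_V_add_massForm (P := P) (j := j) (N := N) w δ₁
  have hK : (0 : ℝ) ≤ Fintype.card (Site P j) * w * (δ₁ ^ 2 / 16) := by positivity
  have hVK : ∀ φ : Cfg P j N, -(Fintype.card (Site P j) * w * (δ₁ ^ 2 / 16)) ≤ ((∑ y : Site P j, w * ‖φ y‖ ^ 4) + 1 / 2 * δ₁ * massForm w φ) :=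
    fun φ => neg_le_V_add_massForm w hw.le δ₁ φ
  have hF := expGrowth_legs (P := P) (j := j) a b x x'
  have h := hasDerivWithinAt_D1_zero C η w c m2 hw hm hVQ.1 hK hVK hF (κ := 1 / 2 * δ₂) hL0 hL1 hLκ
  refine h.congr_deriv ?_
  rw [integral_V1_sq_legs C η w c m2 hw hm δ₁ a b x x', integral_V1_sq C η w c m2 hw hm δ₁,
    integral_V1_legs C η w c m2 hw hm δ₁ a b x x', integral_V1 C η w c m2 hw hm δ₁]
  have h3VV := cum3_V_V_legs C η w c m2 hw hm a b x x'
  have h3VQ := cum3_V_massForm_legs C η w c m2 hw hm a b x x'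
  have h3QQ := cum3_massForm_massForm_legs C η w c m2 hw hm a b x x'
  have h2Q := cum2_massForm_legs C η w c m2 hw hm a b x x'
  have hZ : 0 < ∫ φ, weight C η w c m2 (0 : VecField P j ℝ) φ := B3WT226Traces.Z_pos C η w c m2 hw hm
  set Z : ℝ := ∫ φ, weight C η w c m2 (0 : VecField P j ℝ) φ with hZdef
  set dab : ℝ := ⟪EuclideanSpace.basisFun (Fin N) ℝ a, EuclideanSpace.basisFun (Fin N) ℝ b⟫_ℝ with hdab
  set IF : ℝ := ∫ φ, weight C η w c m2 (0 : VecField P j ℝ) φ * (⟪φ x, EuclideanSpace.basisFun (Fin N) ℝ a⟫_ℝ * ⟪φ x', EuclideanSpace.basisFun (Fin N) ℝ b⟫_ℝ)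
  set IV : ℝ := ∫ φ, weight C η w c m2 (0 : VecField P j ℝ) φ * (∑ y : Site P j, w * ‖φ y‖ ^ 4)
  set IVF : ℝ := ∫ φ, weight C η w c m2 (0 : VecField P j ℝ) φ * ((∑ y : Site P j, w * ‖φ y‖ ^ 4) * (⟪φ x, EuclideanSpace.basisFun (Fin N) ℝ a⟫_ℝ * ⟪φ x', EuclideanSpace.basisFun (Fin N) ℝ b⟫_ℝ))
  set IV2F : ℝ := ∫ φ, weight C η w c m2 (0 : VecField P j ℝ) φ * ((∑ y : Site P j, w * ‖φ y‖ ^ 4) ^ 2 * (⟪φ x, EuclideanSpace.basisFun (Fin N) ℝ a⟫_ℝ * ⟪φ x', EuclideanSpace.basisFun (Fin N) ℝ b⟫_ℝ))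
  set IV2 : ℝ := ∫ φ, weight C η w c m2 (0 : VecField P j ℝ) φ * (∑ y : Site P j, w * ‖φ y‖ ^ 4) ^ 2
  set IVQF : ℝ := ∫ φ, weight C η w c m2 (0 : VecField P j ℝ) φ * ((∑ y : Site P j, w * ‖φ y‖ ^ 4) * (massForm w φ * (⟪φ x, EuclideanSpace.basisFun (Fin N) ℝ a⟫_ℝ * ⟪φ x', EuclideanSpace.basisFun (Fin N) ℝ b⟫_ℝ)))
  set IVQ : ℝ := ∫ φ, weight C η w c m2 (0 : VecField P j ℝ) φ * ((∑ y : Site P j, w * ‖φ y‖ ^ 4) * massForm w φ)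
  set IQ2F : ℝ := ∫ φ, weight C η w c m2 (0 : VecField P j ℝ) φ * (massForm w φ ^ 2 * (⟪φ x, EuclideanSpace.basisFun (Fin N) ℝ a⟫_ℝ * ⟪φ x', EuclideanSpace.basisFun (Fin N) ℝ b⟫_ℝ))
  set IQ2 : ℝ := ∫ φ, weight C η w c m2 (0 : VecField P j ℝ) φ * massForm w φ ^ 2
  set IQF : ℝ := ∫ φ, weight C η w c m2 (0 : VecField P j ℝ) φ * (massForm w φ * (⟪φ x, EuclideanSpace.basisFun (Fin N) ℝ a⟫_ℝ * ⟪φ x', EuclideanSpace.basisFun (Fin N) ℝ b⟫_ℝ))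
  set IQ : ℝ := ∫ φ, weight C η w c m2 (0 : VecField P j ℝ) φ * massForm w φ
  set D3 : ℝ := ∑ y : Site P j, ∑ z : Site P j, w * w *
      (4 ^ 2 * (2 * N + 4) * G w c m2 z y ^ 3 * (G w c m2 x y * G w c m2 z x' + G w c m2 x' y * G w c m2 z x)
        + 2 * (N + 2) * G w c m2 z z * (8 * (N + 2) * G w c m2 z y ^ 2 * (G w c m2 x y * G w c m2 x' y))
        + 2 * (N + 2) * G w c m2 y y * (8 * (N + 2) * G w c m2 y z ^ 2 * (G w c m2 x z * G w c m2 x' z))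
        + 2 * (N + 2) * G w c m2 y y * (2 * (N + 2) * G w c m2 z z)
          * (4 * G w c m2 z y * (G w c m2 x y * G w c m2 z x' + G w c m2 x' y * G w c m2 z x))) with hD3
  set TVQ : ℝ := ∑ y : Site P j, ∑ z : Site P j, w * w *
      (8 * (N + 2) * G w c m2 z y ^ 2 * (G w c m2 x y * G w c m2 x' y)
        + 2 * (N + 2) * G w c m2 y y * (4 * G w c m2 z y * (G w c m2 x y * G w c m2 z x' + G w c m2 x' y * G w c m2 z x)))
    with hTVQ
  set CH : ℝ := ∑ y : Site P j, ∑ z : Site P j, w * w *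
      (4 * G w c m2 z y * (G w c m2 x y * G w c m2 z x' + G w c m2 x' y * G w c m2 z x)) with hCH
  set sQF : ℝ := ∑ z : Site P j, w * (2 * (G w c m2 x z * G w c m2 x' z)) with hsQF
  have hZne : Z ≠ 0 := hZ.ne'
  field_simp
  linear_combination 8 * h3VV + (8 * δ₁) * h3VQ + (2 * δ₁ ^ 2) * h3QQ - (8 * δ₂ * Z) * h2Q

end SecondOrder


/-! ### the window and the Taylor coefficient in Mathlib's `iteratedDerivWithin` on `[0, ∞)` -/

section Window

omit C η w c in
/-- a window `0 < L ≤ 1` with `L∣κ∣ ≤ m²/4` exists for every `κ` (`m² > 0`). [folklore] -/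
private theorem exists_window (hm : 0 < m2) (κ : ℝ) : ∃ L : ℝ, 0 < L ∧ L ≤ 1 ∧ L * |κ| ≤ m2 / 4 := by
  refine ⟨min 1 (m2 / (4 * (|κ| + 1))), lt_min zero_lt_one (by positivity), min_le_left _ _, ?_⟩
  have hk : 0 ≤ |κ| := abs_nonneg κ
  have h1 : min 1 (m2 / (4 * (|κ| + 1))) * |κ| ≤ m2 / (4 * (|κ| + 1)) * |κ| :=
    mul_le_mul_of_nonneg_right (min_le_right _ _) hk
  have h2 : m2 / (4 * (|κ| + 1)) * |κ| ≤ m2 / 4 := by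
    rw [div_mul_eq_mul_div, div_le_div_iff₀ (by positivity) (by positivity)]
    nlinarith
  exact h1.trans h2

/-- **THE TWO-POINT FUNCTION WITH THE COUNTERTERM ON THE WINDOW**: for `0 ≤ λ < L` the derivative within `[0,∞)` of
`G_{ab}(λ;x,x′) = ∫We^{−[λ(V+½δ₁Q)+λ²·½δ₂Q]}φ_a(x)φ_b(x′)/∫We^{−[…]}` is the quotient-rule expression `D₁(λ)` of
`hasDerivWithinAt_D1_counterterm`. [cite: Balaban1983Higgs3, (1.19)–(1.21) p.416] -/
theorem derivWithin_twoPointCt_eq (hw : 0 < w) (hm : 0 < m2) (δ₁ δ₂ : ℝ) (a b : Fin N) (x x' : Site P j) {L : ℝ}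
    (hL1 : L ≤ 1) (hLκ : L * |1 / 2 * δ₂| ≤ m2 / 4) {lam : ℝ} (hlam0 : 0 ≤ lam) (hlamL : lam < L) :
    derivWithin (fun lam : ℝ => (∫ φ, weight C η w c m2 (0 : VecField P j ℝ) φ * (Real.exp (-(lam * ((∑ y : Site P j, w * ‖φ y‖ ^ 4) + 1 / 2 * δ₁ * massForm w φ) + lam ^ 2 * (1 / 2 * δ₂ * massForm w φ))) * (⟪φ x, EuclideanSpace.basisFun (Fin N) ℝ a⟫_ℝ * ⟪φ x', EuclideanSpace.basisFun (Fin N) ℝ b⟫_ℝ))) / ∫ φ, weight C η w c m2 (0 : VecField P j ℝ) φ * (Real.exp (-(lam * ((∑ y : Site P j, w * ‖φ y‖ ^ 4) + 1 / 2 * δ₁ * massForm w φ) + lam ^ 2 * (1 / 2 * δ₂ * massForm w φ))) * 1)) (Set.Ici 0) lam = (fun lam : ℝ =>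
        (((-((∫ φ, weight C η w c m2 (0 : VecField P j ℝ) φ * (Real.exp (-(lam * ((∑ y : Site P j, w * ‖φ y‖ ^ 4) + 1 / 2 * δ₁ * massForm w φ) + lam ^ 2 * (1 / 2 * δ₂ * massForm w φ))) * (((∑ y : Site P j, w * ‖φ y‖ ^ 4) + 1 / 2 * δ₁ * massForm w φ) * (⟪φ x, EuclideanSpace.basisFun (Fin N) ℝ a⟫_ℝ * ⟪φ x', EuclideanSpace.basisFun (Fin N) ℝ b⟫_ℝ))))
              + 2 * lam * (1 / 2 * δ₂) * ∫ φ, weight C η w c m2 (0 : VecField P j ℝ) φ * (Real.exp (-(lam * ((∑ y : Site P j, w * ‖φ y‖ ^ 4) + 1 / 2 * δ₁ * massForm w φ) + lam ^ 2 * (1 / 2 * δ₂ * massForm w φ))) * (massForm w φ * (⟪φ x, EuclideanSpace.basisFun (Fin N) ℝ a⟫_ℝ * ⟪φ x', EuclideanSpace.basisFun (Fin N) ℝ b⟫_ℝ)))))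
            * (∫ φ, weight C η w c m2 (0 : VecField P j ℝ) φ * (Real.exp (-(lam * ((∑ y : Site P j, w * ‖φ y‖ ^ 4) + 1 / 2 * δ₁ * massForm w φ) + lam ^ 2 * (1 / 2 * δ₂ * massForm w φ))) * 1))
          + (∫ φ, weight C η w c m2 (0 : VecField P j ℝ) φ * (Real.exp (-(lam * ((∑ y : Site P j, w * ‖φ y‖ ^ 4) + 1 / 2 * δ₁ * massForm w φ) + lam ^ 2 * (1 / 2 * δ₂ * massForm w φ))) * (⟪φ x, EuclideanSpace.basisFun (Fin N) ℝ a⟫_ℝ * ⟪φ x', EuclideanSpace.basisFun (Fin N) ℝ b⟫_ℝ)))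
            * ((∫ φ, weight C η w c m2 (0 : VecField P j ℝ) φ * (Real.exp (-(lam * ((∑ y : Site P j, w * ‖φ y‖ ^ 4) + 1 / 2 * δ₁ * massForm w φ) + lam ^ 2 * (1 / 2 * δ₂ * massForm w φ))) * (((∑ y : Site P j, w * ‖φ y‖ ^ 4) + 1 / 2 * δ₁ * massForm w φ) * 1)))
              + 2 * lam * (1 / 2 * δ₂) * ∫ φ, weight C η w c m2 (0 : VecField P j ℝ) φ * (Real.exp (-(lam * ((∑ y : Site P j, w * ‖φ y‖ ^ 4) + 1 / 2 * δ₁ * massForm w φ) + lam ^ 2 * (1 / 2 * δ₂ * massForm w φ))) * (massForm w φ * 1))))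
          / (∫ φ, weight C η w c m2 (0 : VecField P j ℝ) φ * (Real.exp (-(lam * ((∑ y : Site P j, w * ‖φ y‖ ^ 4) + 1 / 2 * δ₁ * massForm w φ) + lam ^ 2 * (1 / 2 * δ₂ * massForm w φ))) * 1)) ^ 2)) lam := by
  have hVQ := expGrowth_V_add_massForm (P := P) (j := j) (N := N) w δ₁
  have hK : (0 : ℝ) ≤ Fintype.card (Site P j) * w * (δ₁ ^ 2 / 16) := by positivity
  have hVK : ∀ φ : Cfg P j N, -(Fintype.card (Site P j) * w * (δ₁ ^ 2 / 16)) ≤ ((∑ y : Site P j, w * ‖φ y‖ ^ 4) + 1 / 2 * δ₁ * massForm w φ) :=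
    fun φ => neg_le_V_add_massForm w hw.le δ₁ φ
  have hF := expGrowth_legs (P := P) (j := j) a b x x'
  exact (hasDerivWithinAt_ratio C η w c m2 hw hm hVQ.1 hK hVK hF (κ := 1 / 2 * δ₂) hL1 hLκ hlam0 hlamL).derivWithin
    (uniqueDiffOn_Ici (0 : ℝ) lam hlam0)

/-- **THE SECOND TAYLOR COEFFICIENT (times `2!`) OF (1.19) AT `λ = 0⁺` WITH `δm² = λδm²_{(0,1)} + λ²δm²_{(0,2)}` INSERTED
(e = 0)**, in Mathlib's `iteratedDerivWithin 2 · (Set.Ici 0) 0`: `(d/dλ)²∣_{0⁺}G_{ab}(λ;x,x′) = δ_{ab}·{Σ_{y,z}η^{2d}[⑥ + two-loop +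
tadpole chain] + δ₁·[mass insertion on the tadpole loop + tadpole–insertion chains] + (δ₁²/4)·[insertion–insertion chain] −
δ₂·Σ_zη^d2C(x,z)C(x′,z)}` (`δ₁ = δm²_{(0,1)}`, `δ₂ = δm²_{(0,2)}`). [cite: Balaban1983Higgs3, (1.19)–(1.22) p.416, (1.23) p.417]
[cite: GlimmJaffeQP1987, §8.4–8.5] -/
theorem iteratedDerivWithin_two_twoPointCt (hw : 0 < w) (hm : 0 < m2) (δ₁ δ₂ : ℝ) (a b : Fin N) (x x' : Site P j) :
    iteratedDerivWithin 2 (fun lam : ℝ => (∫ φ, weight C η w c m2 (0 : VecField P j ℝ) φ * (Real.exp (-(lam * ((∑ y : Site P j, w * ‖φ y‖ ^ 4) + 1 / 2 * δ₁ * massForm w φ) + lam ^ 2 * (1 / 2 * δ₂ * massForm w φ))) * (⟪φ x, EuclideanSpace.basisFun (Fin N) ℝ a⟫_ℝ * ⟪φ x', EuclideanSpace.basisFun (Fin N) ℝ b⟫_ℝ))) / ∫ φ, weight C η w c m2 (0 : VecField P j ℝ) φ * (Real.exp (-(lam * ((∑ y : Site P j, w * ‖φ y‖ ^ 4) + 1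 / 2 * δ₁ * massForm w φ) + lam ^ 2 * (1 / 2 * δ₂ * massForm w φ))) * 1)) (Set.Ici 0) 0 = (⟪EuclideanSpace.basisFun (Fin N) ℝ a, EuclideanSpace.basisFun (Fin N) ℝ b⟫_ℝ *
        ((∑ y : Site P j, ∑ z : Site P j, w * w *
            (4 ^ 2 * (2 * N + 4) * G w c m2 z y ^ 3 * (G w c m2 x y * G w c m2 z x' + G w c m2 x' y * G w c m2 z x)
              + 2 * (N + 2) * G w c m2 z z * (8 * (N + 2) * G w c m2 z y ^ 2 * (G w c m2 x y * G w c m2 x' y))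
              + 2 * (N + 2) * G w c m2 y y * (8 * (N + 2) * G w c m2 y z ^ 2 * (G w c m2 x z * G w c m2 x' z))
              + 2 * (N + 2) * G w c m2 y y * (2 * (N + 2) * G w c m2 z z)
                * (4 * G w c m2 z y * (G w c m2 x y * G w c m2 z x' + G w c m2 x' y * G w c m2 z x))))
          + δ₁ * (∑ y : Site P j, ∑ z : Site P j, w * w *
            (8 * (N + 2) * G w c m2 z y ^ 2 * (G w c m2 x y * G w c m2 x' y)
              + 2 * (N + 2) * G w c m2 y y * (4 * G w c m2 z y * (G w c m2 x y * G w c m2 z x' + G w c m2 x' y * G w c m2 z x))))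
          + δ₁ ^ 2 / 4 * (∑ y : Site P j, ∑ z : Site P j, w * w *
            (4 * G w c m2 z y * (G w c m2 x y * G w c m2 z x' + G w c m2 x' y * G w c m2 z x)))
          - δ₂ * ∑ z : Site P j, w * (2 * (G w c m2 x z * G w c m2 x' z)))) := by
  obtain ⟨L, hL0, hL1, hLκ⟩ := exists_window m2 hm (1 / 2 * δ₂)
  rw [iteratedDerivWithin_succ, iteratedDerivWithin_one]
  have hcongr : derivWithin (fun lam : ℝ => (∫ φ, weight C η w c m2 (0 : VecField P j ℝ) φ * (Real.exp (-(lam * ((∑ y : Site P j, w * ‖φ y‖ ^ 4) + 1 / 2 * δ₁ * massForm w φ) + lam ^ 2 * (1 / 2 * δ₂ * massForm w φ))) * (⟪φ x, EuclideanSpace.basisFun (Fin N) ℝ a⟫_ℝ * ⟪φ x', EuclideanSpace.basisFun (Fin N) ℝ b⟫_ℝ))) / ∫ φ, weight C η w c m2 (0 : VecField P j ℝ) φ * (Real.exp (-(lam * ((∑ y : Site P j, w * ‖φ y‖ ^ 4) + 1 / 2 * δ₁ * massForm w φ) + lam ^ 2 * (1 / 2 * δ₂ * massForm w φ))) * 1))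 (Set.Ici 0) =ᶠ[𝓝[Set.Ici (0 : ℝ)] 0] (fun lam : ℝ =>
        (((-((∫ φ, weight C η w c m2 (0 : VecField P j ℝ) φ * (Real.exp (-(lam * ((∑ y : Site P j, w * ‖φ y‖ ^ 4) + 1 / 2 * δ₁ * massForm w φ) + lam ^ 2 * (1 / 2 * δ₂ * massForm w φ))) * (((∑ y : Site P j, w * ‖φ y‖ ^ 4) + 1 / 2 * δ₁ * massForm w φ) * (⟪φ x, EuclideanSpace.basisFun (Fin N) ℝ a⟫_ℝ * ⟪φ x', EuclideanSpace.basisFun (Fin N) ℝ b⟫_ℝ))))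
              + 2 * lam * (1 / 2 * δ₂) * ∫ φ, weight C η w c m2 (0 : VecField P j ℝ) φ * (Real.exp (-(lam * ((∑ y : Site P j, w * ‖φ y‖ ^ 4) + 1 / 2 * δ₁ * massForm w φ) + lam ^ 2 * (1 / 2 * δ₂ * massForm w φ))) * (massForm w φ * (⟪φ x, EuclideanSpace.basisFun (Fin N) ℝ a⟫_ℝ * ⟪φ x', EuclideanSpace.basisFun (Fin N) ℝ b⟫_ℝ)))))
            * (∫ φ, weight C η w c m2 (0 : VecField P j ℝ) φ * (Real.exp (-(lam * ((∑ y : Site P j, w * ‖φ y‖ ^ 4) + 1 / 2 * δ₁ * massForm w φ) + lam ^ 2 * (1 / 2 * δ₂ * massForm w φ))) * 1))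
          + (∫ φ, weight C η w c m2 (0 : VecField P j ℝ) φ * (Real.exp (-(lam * ((∑ y : Site P j, w * ‖φ y‖ ^ 4) + 1 / 2 * δ₁ * massForm w φ) + lam ^ 2 * (1 / 2 * δ₂ * massForm w φ))) * (⟪φ x, EuclideanSpace.basisFun (Fin N) ℝ a⟫_ℝ * ⟪φ x', EuclideanSpace.basisFun (Fin N) ℝ b⟫_ℝ)))
            * ((∫ φ, weight C η w c m2 (0 : VecField P j ℝ) φ * (Real.exp (-(lam * ((∑ y : Site P j, w * ‖φ y‖ ^ 4) + 1 / 2 * δ₁ * massForm w φ) + lam ^ 2 * (1 / 2 * δ₂ * massForm w φ))) * (((∑ y : Site P j, w * ‖φ y‖ ^ 4) + 1 / 2 * δ₁ * massForm w φ) * 1)))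
              + 2 * lam * (1 / 2 * δ₂) * ∫ φ, weight C η w c m2 (0 : VecField P j ℝ) φ * (Real.exp (-(lam * ((∑ y : Site P j, w * ‖φ y‖ ^ 4) + 1 / 2 * δ₁ * massForm w φ) + lam ^ 2 * (1 / 2 * δ₂ * massForm w φ))) * (massForm w φ * 1))))
          / (∫ φ, weight C η w c m2 (0 : VecField P j ℝ) φ * (Real.exp (-(lam * ((∑ y : Site P j, w * ‖φ y‖ ^ 4) + 1 / 2 * δ₁ * massForm w φ) + lam ^ 2 * (1 / 2 * δ₂ * massForm w φ))) * 1)) ^ 2)) := by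
    filter_upwards [Ico_mem_nhdsGE hL0] with lam hlam
    exact derivWithin_twoPointCt_eq C η w c m2 hw hm δ₁ δ₂ a b x x' hL1 hLκ hlam.1 hlam.2
  rw [hcongr.derivWithin_eq_of_mem Set.self_mem_Ici]
  exact (hasDerivWithinAt_D1_counterterm C η w c m2 hw hm δ₁ δ₂ a b x x' hL0 hL1 hLκ).derivWithin
    (uniqueDiffOn_Ici (0 : ℝ) 0 Set.self_mem_Ici)

/-- **(1.20)'S OWN SPELLING OF THE FAMILY**: with the counterterm series `δm² = λδ₁ + λ²δ₂` of (1.23) (e = 0) inserted in the mass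
term of (1.20), the two-point function `∫dφ e^{−½⟨φ,(−Δ^η+m²+δm²)φ⟩−λΣη^d∣φ∣⁴}φ_a(x)φ_b(x′)/∫dφ e^{−…}` IS the family differentiated
above (the `e = 0` vector field integrates out of (1.19) numerator and denominator alike, BRICK 10 `twoPtJoint_zero_charge` by name
once built). [cite: Balaban1983Higgs3, (1.19)–(1.20) p.416, (1.23) p.417] -/
theorem twoPointCt_eq (lam δ₁ δ₂ : ℝ) (a b : Fin N) (x x' : Site P j) :
    (∫ φ, weight C η w c (m2 + (lam * δ₁ + lam ^ 2 * δ₂)) (0 : VecField P j ℝ) φ *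
        (Real.exp (-(lam * ∑ y : Site P j, w * ‖φ y‖ ^ 4)) * (⟪φ x, EuclideanSpace.basisFun (Fin N) ℝ a⟫_ℝ * ⟪φ x', EuclideanSpace.basisFun (Fin N) ℝ b⟫_ℝ)))
      / (∫ φ, weight C η w c (m2 + (lam * δ₁ + lam ^ 2 * δ₂)) (0 : VecField P j ℝ) φ *
        (Real.exp (-(lam * ∑ y : Site P j, w * ‖φ y‖ ^ 4)) * 1))
      = (fun lam : ℝ => (∫ φ, weight C η w c m2 (0 : VecField P j ℝ) φ * (Real.exp (-(lam * ((∑ y : Site P j, w * ‖φ y‖ ^ 4) + 1 / 2 * δ₁ * massForm w φ) + lam ^ 2 * (1 / 2 * δ₂ * massForm w φ))) * (⟪φ x, EuclideanSpace.basisFun (Fin N) ℝ a⟫_ℝ * ⟪φ x', EuclideanSpace.basisFun (Fin N) ℝ b⟫_ℝ))) / ∫ φ, weight C η w c m2 (0 : VecField P j ℝ) φ * (Real.exp (-(lam * ((∑ y : Site P j, w * ‖φ y‖ ^ 4) + 1 / 2 * δ₁ * massForm w φ) + lam ^ 2 * (1 / 2 * δ₂ * massForm w φ))) * 1)) lam :=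 by
  have e : ∀ g : Cfg P j N → ℝ, (∫ φ, weight C η w c (m2 + (lam * δ₁ + lam ^ 2 * δ₂)) (0 : VecField P j ℝ) φ *
      (Real.exp (-(lam * ∑ y : Site P j, w * ‖φ y‖ ^ 4)) * g φ)) = ∫ φ, weight C η w c m2 (0 : VecField P j ℝ) φ * (Real.exp (-(lam * ((∑ y : Site P j, w * ‖φ y‖ ^ 4) + 1 / 2 * δ₁ * massForm w φ) + lam ^ 2 * (1 / 2 * δ₂ * massForm w φ))) * g φ) := fun g =>
    integral_congr_ae (Filter.Eventually.of_forall fun φ => by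
      show weight C η w c (m2 + (lam * δ₁ + lam ^ 2 * δ₂)) (0 : VecField P j ℝ) φ *
          (Real.exp (-(lam * ∑ y : Site P j, w * ‖φ y‖ ^ 4)) * g φ) = weight C η w c m2 (0 : VecField P j ℝ) φ * (Real.exp (-(lam * ((∑ y : Site P j, w * ‖φ y‖ ^ 4) + 1 / 2 * δ₁ * massForm w φ) + lam ^ 2 * (1 / 2 * δ₂ * massForm w φ))) * g φ)
      rw [← mul_assoc, weight_counterterm_eq C η w c m2 lam δ₁ δ₂ φ, mul_assoc])
  rw [e, e]

end Window

/-! ## §7 PRINT'S DEFINING EQUATION AT THE INDEX `(0,2)`: «−δm²_{(0,2)} + Σ_{x∈T_ε}ε^dΣ^ε_{(0,2)}(x) = 0» READ ON THE DERIVED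
`n = 1` KERNEL, and its solution at print's `δm²_{(0,1)}` -/

section Equation

variable {w}

/-- collapse of a diagonal kernel between two propagators: `Σ_{y,y′}η^{2d}C(x,y)·f(y)δ^ε(y−y′)·C(y′,x′) = Σ_yη^dC(x,y)f(y)C(y,x′)`.
[cite: Balaban1983Higgs3, (1.21) p.416] -/
theorem sum_G_diag_G (hw : w ≠ 0) (m2' c' : ℝ) (f : Site P j → ℝ) (x x' : Site P j) :
    (∑ y : Site P j, ∑ y' : Site P j, w * w * (G w c' m2' x y * (f y * delta w y y') * G w c' m2' y' x'))
      = ∑ y : Site P j, w * (f y * (G w c' m2' x y * G w c' m2' y x')) := by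
  refine Finset.sum_congr rfl fun y _ => ?_
  simp only [delta, mul_ite, mul_zero, ite_mul, zero_mul, Finset.sum_ite_eq, Finset.mem_univ, if_true]
  field_simp

variable (w)

/-- **THE `(0,2)` CONDITION ON THE DERIVED `n = 1` KERNEL.**  Print p. 417: *"The counterterms δm²_{(α,β)} are defined by the
equations −δm²_{(α,β)} + Σ_{x∈T_ε}ε^dΣ^ε_{(α,β)}(x) = 0"* — r15's `dm2Graph` row sum applied, as in BRICK 10's `condition_01_iff`
(the `(0,1)` step), to the order-`λ²` mass-type kernel of the derived coefficient (§6; read as the `n = 1` letter of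
(1.21) in §8): `K(y,y′) = sig6 D(y,y′) + [Λ(y) − λ²δ₂]·δ^ε(y−y′)` with p26's
typed sunset `sig6` and the LOOP-INSERTION LETTER `Λ(y) = λ²·4(N+2)Σ_zη^dC(z,y)²[4(N+2)C(z,z) + δ₁]` (the tadpole whose loop
carries the first-order corrected propagator). The row sums of `K` vanish IFF `λ²δ₂ = ct6 D(y) + Λ(y)` at every `y` — the equation
FIXES `λ²δm²_{(0,2)}` as p26's `ct6` (⑥'s counterterm of (1.23)) PLUS the loop-insertion row sum.
[cite: Balaban1983Higgs3, (1.22) p.416, (1.23) p.417] -/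
theorem condition_02_iff (D : SEData P j) (hwD : D.w = w) (hw : w ≠ 0) (δ₁ r : ℝ) (Cv : Kernel P j) :
    (∀ y : Site P j, dm2Graph w (fun y y' => sig6 D y y'
        + (D.lam ^ 2 * (4 * (N + 2) * ∑ z : Site P j, w * (Cv z y ^ 2 * (4 * (N + 2) * Cv z z + δ₁))) - r) * delta w y y') y
        = 0)
      ↔ ∀ y : Site P j, r = ct6 D y
          + D.lam ^ 2 * (4 * (N + 2) * ∑ z : Site P j, w * (Cv z y ^ 2 * (4 * (N + 2) * Cv z z + δ₁))) := by
  have key : ∀ y : Site P j, dm2Graph w (fun y y' => sig6 D y y'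
        + (D.lam ^ 2 * (4 * (N + 2) * ∑ z : Site P j, w * (Cv z y ^ 2 * (4 * (N + 2) * Cv z z + δ₁))) - r) * delta w y y') y
      = ct6 D y + D.lam ^ 2 * (4 * (N + 2) * ∑ z : Site P j, w * (Cv z y ^ 2 * (4 * (N + 2) * Cv z z + δ₁))) - r := by
    intro y
    have hsplit : (fun y y' : Site P j => sig6 D y y'
        + (D.lam ^ 2 * (4 * (N + 2) * ∑ z : Site P j, w * (Cv z y ^ 2 * (4 * (N + 2) * Cv z z + δ₁))) - r) * delta w y y')
        = sig6 D + fun y y' => (D.lam ^ 2 * (4 * (N + 2) * ∑ z : Site P j, w * (Cv z y ^ 2 * (4 * (N + 2) * Cv z z + δ₁))) - r)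
          * delta w y y' := by
      funext y y'; simp only [Pi.add_apply]
    rw [hsplit, dm2Graph_add, dm2Graph_mul_delta hw, ct6, hwD]
    ring
  constructor
  · intro h y
    have h1 := h y
    rw [key y] at h1
    linarith
  · intro h y
    rw [key y, h y]
    ring

/-- **AT PRINT'S `δm²_{(0,1)}` THE LOOP INSERTION VANISHES IDENTICALLY**: with the scalar propagator of the model torus
(`C₀ = B3WTPropagator.G`, shift-invariant: `C₀(z,z) = C₀(0)`, `B3WTCovariance.G_diag_const`) and `δ₁ = −4(N+2)C₀(0)` — the solution
of the `(0,1)` equation (BRICK 10 `condition_01_iff`: `λδ₁ = ct1 D = −4(N+2)λC^ε_0(0)`, (1.23)①) — the letter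
`Λ(y) = λ²·4(N+2)Σ_zη^dC₀(z,y)²[4(N+2)C₀(z,z) + δ₁]` is ZERO: the tadpole with the tadpole-corrected loop is cancelled EXACTLY by the
tadpole with the counterterm-corrected loop. [cite: Balaban1983Higgs3, (1.22) p.416, (1.23) p.417] -/
theorem loopInsertion_eq_zero_at_dm2One (lam δ₁ : ℝ) (y₀ : Site P j) (hδ₁ : δ₁ = -(4 * (N + 2) * G w c m2 y₀ y₀)) (y : Site P j) :
    lam ^ 2 * (4 * (N + 2) * ∑ z : Site P j, w * (G w c m2 z y ^ 2 * (4 * (N + 2) * G w c m2 z z + δ₁))) = 0 := by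
  have hz : ∀ z : Site P j, 4 * (N + 2) * G w c m2 z z + δ₁ = 0 := fun z => by
    rw [hδ₁, G_diag_const w c m2 z y₀]; ring
  simp only [hz, mul_zero, Finset.sum_const_zero]

/-- **THE `(0,2)` EQUATION SOLVED AT PRINT'S `δm²_{(0,1)}`: `λ²δm²_{(0,2)} = 4²(2N+4)λ²Σ_{x′∈T_ε}ε^d(C^ε_0(x−x′))³` — p26's `ct6`,
THE SIXTH DISPLAYED COUNTERTERM OF (1.23), DERIVED.**  For p26's (1.22)-data `D` carrying this propagator (`D.C0 = C₀`, `D.N = N`,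
`D.w = η^d`) and `δ₁ = −4(N+2)C₀(0)` (the `(0,1)` solution, BRICK 10 `condition_01_iff` ∕ `dm2One_eq_of_conditions`): the row sums of
the derived order-`λ²` mass-type kernel vanish IFF `λ²δ₂ = ct6 D(y)` (a constant on `T_ε` for shift-invariant `C₀`, p26 `ct_const`).
This is the `(0,2)` step of print's *"This equation can be solved recursively"*; together with BRICK 10's `(0,1)` step the PURE-`λ`
SECTOR of *"δm² will be defined by the terms of order ≦ 4"* is derived from (1.19)/(1.20).
[cite: Balaban1983Higgs3, (1.22) p.416, (1.23) p.417] -/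
theorem condition_02_iff_at_dm2One (D : SEData P j) (hwD : D.w = w) (hw : w ≠ 0) (δ₁ r : ℝ)
    (y₀ : Site P j) (hδ₁ : δ₁ = -(4 * (N + 2) * G w c m2 y₀ y₀)) :
    (∀ y : Site P j, dm2Graph w (fun y y' => sig6 D y y'
        + (D.lam ^ 2 * (4 * (N + 2) * ∑ z : Site P j, w * (G w c m2 z y ^ 2 * (4 * (N + 2) * G w c m2 z z + δ₁))) - r)
          * delta w y y') y = 0)
      ↔ ∀ y : Site P j, r = ct6 D y := by
  rw [condition_02_iff w D hwD hw δ₁ r (G w c m2)]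
  refine forall_congr' fun y => ?_
  rw [loopInsertion_eq_zero_at_dm2One w c m2 D.lam δ₁ y₀ hδ₁ y, add_zero]

/-- the value: `ct6 D(y) = 4²(2N+4)λ²Σ_{x′}η^dC₀(y,x′)³` (p26 `ct6_eq`), print's sixth counterterm with its combinatoric factor — here
the END of a derivation from the measure (1.19)/(1.20), not a definition. [cite: Balaban1983Higgs3, (1.23) p.417] -/
theorem ct6_value (D : SEData P j) (hC0 : D.C0 = G w c m2) (hwD : D.w = w) (y : Site P j) :
    ct6 D y = (4 : ℝ) ^ 2 * (2 * (D.N : ℝ) + 4) * D.lam ^ 2 * ∑ x' : Site P j, w * (G w c m2 y x') ^ 3 := by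
  rw [ct6_eq, hwD, hC0]

end Equation


/-! ## §8 THE STRUCTURE (1.21) AT ORDER `λ²` WITH THE COUNTERTERM: `(λ²/2)G″(0⁺) = C₀[⑥ + Λ − λ²δ₂]C₀ + C₀X₁C₀X₁C₀` with the
DERIVED weight-2 letter `X₁ = λ(Σ^ε_{(0,1)} − δm²_{(0,1)})` (diagonal kernel `−λ[4(N+2)C₀(0) + δ₁]δ^ε`, BRICK 10 §10) — the `n = 1`
term carries the order-`λ²` letters `λ²Σ^ε_{(0,2)} = ⑥ + Λ` and `−δm²∣_{λ²} = −λ²δ₂`, the `n = 2` term the square of the weight-2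
letter -/

section Structure

/-- **`(λ²/2)·G″(0⁺) = Σ_{y,y′}η^{2d}C₀(x,y)[sig6 D + (Λ − λ²δ₂)δ^ε](y,y′)C₀(y′,x′) + Σ_{y,z}η^{2d}C₀(x,y)X₁(y)C₀(y,z)X₁(z)C₀(z,x′)`**
(per `δ_{ab}`), `X₁(v) = −λ[4(N+2)C₀(v,v) + δ₁]` the diagonal of the derived weight-2 letter `sig1 D − λδ₁δ^ε` (BRICK 10
`derivWithin_massCurve_eq_C0_sig1_delta_C0`), `Λ(y) = λ²·4(N+2)Σ_zη^dC₀(z,y)²[4(N+2)C₀(z,z) + δ₁]`: the `n = 1` term of (1.21) at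
order `λ²` with the letters `λ²Σ^ε_{(0,2)} = ⑥ + Λ` (p26's typed sunset `sig6` by name; BRICK 1 `secondCoeff_eq_C0_sig6_C0`) and
`−δm²∣_{λ²}`, PLUS the `n = 2` term `C₀X₁C₀X₁C₀` — the two orientations of every chain merging into the Taylor factor `1/2!`.
[cite: Balaban1983Higgs3, (1.21)–(1.22) p.416, (1.23) p.417] -/
theorem secondOrder_structure (D : SEData P j) (hC0 : D.C0 = G w c m2) (hN : D.N = N) (hw : w ≠ 0) (δ₁ δ₂ : ℝ)
    (x x' : Site P j) :
    D.lam ^ 2 / 2 * ((∑ y : Site P j, ∑ z : Site P j, w * w *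
            (4 ^ 2 * (2 * N + 4) * G w c m2 z y ^ 3 * (G w c m2 x y * G w c m2 z x' + G w c m2 x' y * G w c m2 z x)
              + 2 * (N + 2) * G w c m2 z z * (8 * (N + 2) * G w c m2 z y ^ 2 * (G w c m2 x y * G w c m2 x' y))
              + 2 * (N + 2) * G w c m2 y y * (8 * (N + 2) * G w c m2 y z ^ 2 * (G w c m2 x z * G w c m2 x' z))
              + 2 * (N + 2) * G w c m2 y y * (2 * (N + 2) * G w c m2 z z)
                * (4 * G w c m2 z y * (G w c m2 x y * G w c m2 z x' + G w c m2 x' y * G w c m2 z x))))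
          + δ₁ * (∑ y : Site P j, ∑ z : Site P j, w * w *
            (8 * (N + 2) * G w c m2 z y ^ 2 * (G w c m2 x y * G w c m2 x' y)
              + 2 * (N + 2) * G w c m2 y y * (4 * G w c m2 z y * (G w c m2 x y * G w c m2 z x' + G w c m2 x' y * G w c m2 z x))))
          + δ₁ ^ 2 / 4 * (∑ y : Site P j, ∑ z : Site P j, w * w *
            (4 * G w c m2 z y * (G w c m2 x y * G w c m2 z x' + G w c m2 x' y * G w c m2 z x)))
          - δ₂ * ∑ z : Site P j, w * (2 * (G w c m2 x z * G w c m2 x' z)))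
      = (∑ y : Site P j, ∑ y' : Site P j, w * w * (G w c m2 x y * (sig6 D y y'
          + (D.lam ^ 2 * (4 * (N + 2) * ∑ z : Site P j, w * (G w c m2 z y ^ 2 * (4 * (N + 2) * G w c m2 z z + δ₁)))
              - D.lam ^ 2 * δ₂) * delta w y y') * G w c m2 y' x'))
        + ∑ y : Site P j, ∑ z : Site P j, w * w * (G w c m2 x y * (-(D.lam * (4 * (N + 2) * G w c m2 y y + δ₁)))
            * G w c m2 y z * (-(D.lam * (4 * (N + 2) * G w c m2 z z + δ₁))) * G w c m2 z x') := by
  -- the n = 1 kernel splits into the sunset and the diagonal letter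
  have hn1 : (∑ y : Site P j, ∑ y' : Site P j, w * w * (G w c m2 x y * (sig6 D y y'
          + (D.lam ^ 2 * (4 * (N + 2) * ∑ z : Site P j, w * (G w c m2 z y ^ 2 * (4 * (N + 2) * G w c m2 z z + δ₁)))
              - D.lam ^ 2 * δ₂) * delta w y y') * G w c m2 y' x'))
      = (∑ y : Site P j, ∑ y' : Site P j, w * w * (G w c m2 x y * sig6 D y y' * G w c m2 y' x'))
        + ∑ y : Site P j, w * ((D.lam ^ 2 * (4 * (N + 2) * ∑ z : Site P j, w * (G w c m2 z y ^ 2 * (4 * (N + 2) * G w c m2 z z + δ₁)))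
              - D.lam ^ 2 * δ₂) * (G w c m2 x y * G w c m2 y x')) := by
    rw [← sum_G_diag_G hw m2 c _ x x', ← Finset.sum_add_distrib]
    refine Finset.sum_congr rfl fun y _ => ?_
    rw [← Finset.sum_add_distrib]
    exact Finset.sum_congr rfl fun y' _ => by ring
  rw [hn1, ← secondCoeff_eq_C0_sig6_C0 w c m2 D hC0 hN x x']
  -- atoms
  set S2 : ℝ := ∑ y : Site P j, ∑ z : Site P j, w * w * (4 ^ 2 * (2 * N + 4) * G w c m2 z y ^ 3
      * (G w c m2 x y * G w c m2 z x' + G w c m2 x' y * G w c m2 z x)) with hS2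
  set Ta : ℝ := ∑ y : Site P j, ∑ z : Site P j, w * w *
      (2 * (N + 2) * G w c m2 z z * (8 * (N + 2) * G w c m2 z y ^ 2 * (G w c m2 x y * G w c m2 x' y))) with hTa
  set Tb : ℝ := ∑ y : Site P j, ∑ z : Site P j, w * w *
      (2 * (N + 2) * G w c m2 y y * (8 * (N + 2) * G w c m2 y z ^ 2 * (G w c m2 x z * G w c m2 x' z))) with hTb
  set CHa1 : ℝ := ∑ y : Site P j, ∑ z : Site P j, w * w *
      (2 * (N + 2) * G w c m2 y y * (2 * (N + 2) * G w c m2 z z) * (4 * G w c m2 z y * (G w c m2 x y * G w c m2 z x'))) with hCHa1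
  set CHa2 : ℝ := ∑ y : Site P j, ∑ z : Site P j, w * w *
      (2 * (N + 2) * G w c m2 y y * (2 * (N + 2) * G w c m2 z z) * (4 * G w c m2 z y * (G w c m2 x' y * G w c m2 z x))) with hCHa2
  set T1 : ℝ := ∑ y : Site P j, ∑ z : Site P j, w * w * (8 * (N + 2) * G w c m2 z y ^ 2 * (G w c m2 x y * G w c m2 x' y))
    with hT1
  set Vb1 : ℝ := ∑ y : Site P j, ∑ z : Site P j, w * w *
      (2 * (N + 2) * G w c m2 y y * (4 * G w c m2 z y * (G w c m2 x y * G w c m2 z x'))) with hVb1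
  set Vb2 : ℝ := ∑ y : Site P j, ∑ z : Site P j, w * w *
      (2 * (N + 2) * G w c m2 y y * (4 * G w c m2 z y * (G w c m2 x' y * G w c m2 z x))) with hVb2
  set Vb2' : ℝ := ∑ y : Site P j, ∑ z : Site P j, w * w *
      (2 * (N + 2) * G w c m2 z z * (4 * G w c m2 z y * (G w c m2 x y * G w c m2 z x'))) with hVb2'
  set C1 : ℝ := ∑ y : Site P j, ∑ z : Site P j, w * w * (4 * G w c m2 z y * (G w c m2 x y * G w c m2 z x')) with hC1
  set C2 : ℝ := ∑ y : Site P j, ∑ z : Site P j, w * w * (4 * G w c m2 z y * (G w c m2 x' y * G w c m2 z x)) with hC2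
  set RL2 : ℝ := ∑ y : Site P j, w * (G w c m2 x y * G w c m2 y x') with hRL2
  set U : ℝ := ∑ y : Site P j, ∑ z : Site P j, w * w *
      (4 * (N + 2) * G w c m2 z y ^ 2 * (4 * (N + 2) * G w c m2 z z + δ₁) * (G w c m2 x y * G w c m2 x' y)) with hU
  set Wc : ℝ := ∑ y : Site P j, ∑ z : Site P j, w * w *
      ((16 * (N + 2) ^ 2 * (G w c m2 y y * G w c m2 z z) + 4 * (N + 2) * δ₁ * (G w c m2 y y + G w c m2 z z) + δ₁ ^ 2)
        * (G w c m2 z y * (G w c m2 x y * G w c m2 z x'))) with hWc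
  -- splitting the graph sums into atoms
  have hD3 : (∑ y : Site P j, ∑ z : Site P j, w * w *
      (4 ^ 2 * (2 * N + 4) * G w c m2 z y ^ 3 * (G w c m2 x y * G w c m2 z x' + G w c m2 x' y * G w c m2 z x)
        + 2 * (N + 2) * G w c m2 z z * (8 * (N + 2) * G w c m2 z y ^ 2 * (G w c m2 x y * G w c m2 x' y))
        + 2 * (N + 2) * G w c m2 y y * (8 * (N + 2) * G w c m2 y z ^ 2 * (G w c m2 x z * G w c m2 x' z))
        + 2 * (N + 2) * G w c m2 y y * (2 * (N + 2) * G w c m2 z z)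
          * (4 * G w c m2 z y * (G w c m2 x y * G w c m2 z x' + G w c m2 x' y * G w c m2 z x))))
      = S2 + Ta + Tb + CHa1 + CHa2 := by
    rw [hS2, hTa, hTb, hCHa1, hCHa2, ← Finset.sum_add_distrib, ← Finset.sum_add_distrib, ← Finset.sum_add_distrib,
      ← Finset.sum_add_distrib]
    refine Finset.sum_congr rfl fun y _ => ?_
    rw [← Finset.sum_add_distrib, ← Finset.sum_add_distrib, ← Finset.sum_add_distrib, ← Finset.sum_add_distrib]
    exact Finset.sum_congr rfl fun z _ => by ring
  have hTVQ : (∑ y : Site P j, ∑ z : Site P j, w * w *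
      (8 * (N + 2) * G w c m2 z y ^ 2 * (G w c m2 x y * G w c m2 x' y)
        + 2 * (N + 2) * G w c m2 y y * (4 * G w c m2 z y * (G w c m2 x y * G w c m2 z x' + G w c m2 x' y * G w c m2 z x))))
      = T1 + Vb1 + Vb2 := by
    rw [hT1, hVb1, hVb2, ← Finset.sum_add_distrib, ← Finset.sum_add_distrib]
    refine Finset.sum_congr rfl fun y _ => ?_
    rw [← Finset.sum_add_distrib, ← Finset.sum_add_distrib]
    exact Finset.sum_congr rfl fun z _ => by ring
  have hCH : (∑ y : Site P j, ∑ z : Site P j, w * w *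
      (4 * G w c m2 z y * (G w c m2 x y * G w c m2 z x' + G w c m2 x' y * G w c m2 z x))) = C1 + C2 := by
    rw [hC1, hC2, ← Finset.sum_add_distrib]
    refine Finset.sum_congr rfl fun y _ => ?_
    rw [← Finset.sum_add_distrib]
    exact Finset.sum_congr rfl fun z _ => by ring
  -- orientation swaps (y ↔ z, symmetry of C₀)
  have hTab : Tb = Ta := by
    rw [hTb, hTa, Finset.sum_comm]
  have hCHa : CHa2 = CHa1 := by
    rw [hCHa2, hCHa1, Finset.sum_comm]
    refine Finset.sum_congr rfl fun y _ => Finset.sum_congr rfl fun z _ => ?_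
    rw [G_symm w c m2 y z, G_symm w c m2 x' z, G_symm w c m2 y x, G_symm w c m2 z x']
    ring
  have hVb : Vb2 = Vb2' := by
    rw [hVb2, hVb2', Finset.sum_comm]
    refine Finset.sum_congr rfl fun y _ => Finset.sum_congr rfl fun z _ => ?_
    rw [G_symm w c m2 y z, G_symm w c m2 x' z, G_symm w c m2 y x, G_symm w c m2 z x']
    ring
  have hC12 : C2 = C1 := by
    rw [hC2, hC1, Finset.sum_comm]
    refine Finset.sum_congr rfl fun y _ => Finset.sum_congr rfl fun z _ => ?_
    rw [G_symm w c m2 y z, G_symm w c m2 x' z, G_symm w c m2 y x, G_symm w c m2 z x']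
    ring
  -- the loop-insertion letter between two propagators
  have hRL : (∑ y : Site P j, w * ((D.lam ^ 2 * (4 * (N + 2) * ∑ z : Site P j, w * (G w c m2 z y ^ 2
        * (4 * (N + 2) * G w c m2 z z + δ₁))) - D.lam ^ 2 * δ₂) * (G w c m2 x y * G w c m2 y x')))
      = D.lam ^ 2 * U - D.lam ^ 2 * δ₂ * RL2 := by
    rw [hU, hRL2]
    conv_rhs => rw [Finset.mul_sum, Finset.mul_sum, ← Finset.sum_sub_distrib]
    refine Finset.sum_congr rfl fun y _ => ?_
    have e : (∑ z : Site P j, w * w * (4 * (N + 2) * G w c m2 z y ^ 2 * (4 * (N + 2) * G w c m2 z z + δ₁)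
        * (G w c m2 x y * G w c m2 x' y)))
        = (w * (4 * (N + 2)) * (G w c m2 x y * G w c m2 x' y))
          * ∑ z : Site P j, w * (G w c m2 z y ^ 2 * (4 * (N + 2) * G w c m2 z z + δ₁)) := by
      rw [Finset.mul_sum]; exact Finset.sum_congr rfl fun z _ => by ring
    rw [e, G_symm w c m2 y x']
    ring
  -- the chain `C₀X₁C₀X₁C₀`
  have hRC : (∑ y : Site P j, ∑ z : Site P j, w * w * (G w c m2 x y * (-(D.lam * (4 * (N + 2) * G w c m2 y y + δ₁)))
            * G w c m2 y z * (-(D.lam * (4 * (N + 2) * G w c m2 z z + δ₁))) * G w c m2 z x'))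
      = D.lam ^ 2 * Wc := by
    rw [hWc, Finset.mul_sum]
    refine Finset.sum_congr rfl fun y _ => ?_
    rw [Finset.mul_sum]
    refine Finset.sum_congr rfl fun z _ => ?_
    rw [G_symm w c m2 y z]
    ring
  have hWcs : Wc = CHa1 + δ₁ / 2 * (Vb1 + Vb2') + δ₁ ^ 2 / 4 * C1 := by
    rw [hWc, hCHa1, hVb1, hVb2', hC1, ← Finset.sum_add_distrib, Finset.mul_sum, Finset.mul_sum, ← Finset.sum_add_distrib,
      ← Finset.sum_add_distrib]
    refine Finset.sum_congr rfl fun y _ => ?_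
    rw [← Finset.sum_add_distrib, Finset.mul_sum, Finset.mul_sum, ← Finset.sum_add_distrib, ← Finset.sum_add_distrib]
    exact Finset.sum_congr rfl fun z _ => by ring
  have hUs : U = Ta + δ₁ / 2 * T1 := by
    rw [hU, hTa, hT1, Finset.mul_sum, ← Finset.sum_add_distrib]
    refine Finset.sum_congr rfl fun y _ => ?_
    rw [Finset.mul_sum, ← Finset.sum_add_distrib]
    exact Finset.sum_congr rfl fun z _ => by ring
  have hsQF : (∑ z : Site P j, w * (2 * (G w c m2 x z * G w c m2 x' z))) = 2 * RL2 := by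
    rw [hRL2, Finset.mul_sum]
    refine Finset.sum_congr rfl fun z _ => ?_
    rw [G_symm w c m2 x' z]
    ring
  rw [hD3, hTVQ, hCH, hRL, hRC, hWcs, hUs, hsQF]
  linear_combination (D.lam ^ 2 / 2) * hTab + (D.lam ^ 2 / 2) * hCHa + (D.lam ^ 2 * δ₁ / 2) * hVb
    + (D.lam ^ 2 * δ₁ ^ 2 / 8) * hC12

/-- **AT PRINT'S `δm²_{(0,1)}` ONLY THE SUNSET AND THE COUNTERTERM SURVIVE AT ORDER `λ²`.**  With `δ₁ = −4(N+2)C₀(0)` — the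
solution of the `(0,1)` equation (BRICK 10 `condition_01_iff`: `λδ₁ = ct1 D`; `C₀(v,v) = C₀(0)` on the torus,
`B3WTCovariance.G_diag_const`) — the derived weight-2 letter `X₁ = −λ[4(N+2)C₀(0) + δ₁] ≡ 0`, so the `n = 2` chain `C₀X₁C₀X₁C₀`
and the loop-insertion letter `Λ` (print's graph-by-graph reading, p. 417: the two-loop tadpole-on-tadpole graph and the tadpole
with the vertex (1.7) `δm²_{(0,1)}` on its loop have OPPOSITE counterterms `δm²_G`) VANISH IDENTICALLY:
`(λ²/2)·G″(0⁺) = Σ_{y,y′}η^{2d}C₀(x,y)[sig6 D − λ²δ₂·δ^ε](y,y′)C₀(y′,x′)` — of the order-`λ²` content of the bracket of (1.21) exactly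
the displayed sunset ⑥ of (1.22) and the counterterm `−λ²δm²_{(0,2)}` remain. [cite: Balaban1983Higgs3, (1.21)–(1.22) p.416, (1.23) p.417] -/
theorem secondOrder_structure_at_dm2One (D : SEData P j) (hC0 : D.C0 = G w c m2) (hN : D.N = N) (hw : w ≠ 0) (δ₁ δ₂ : ℝ)
    (y₀ : Site P j) (hδ₁ : δ₁ = -(4 * (N + 2) * G w c m2 y₀ y₀)) (x x' : Site P j) :
    D.lam ^ 2 / 2 * ((∑ y : Site P j, ∑ z : Site P j, w * w *
            (4 ^ 2 * (2 * N + 4) * G w c m2 z y ^ 3 * (G w c m2 x y * G w c m2 z x' + G w c m2 x' y * G w c m2 z x)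
              + 2 * (N + 2) * G w c m2 z z * (8 * (N + 2) * G w c m2 z y ^ 2 * (G w c m2 x y * G w c m2 x' y))
              + 2 * (N + 2) * G w c m2 y y * (8 * (N + 2) * G w c m2 y z ^ 2 * (G w c m2 x z * G w c m2 x' z))
              + 2 * (N + 2) * G w c m2 y y * (2 * (N + 2) * G w c m2 z z)
                * (4 * G w c m2 z y * (G w c m2 x y * G w c m2 z x' + G w c m2 x' y * G w c m2 z x))))
          + δ₁ * (∑ y : Site P j, ∑ z : Site P j, w * w *
            (8 * (N + 2) * G w c m2 z y ^ 2 * (G w c m2 x y * G w c m2 x' y)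
              + 2 * (N + 2) * G w c m2 y y * (4 * G w c m2 z y * (G w c m2 x y * G w c m2 z x' + G w c m2 x' y * G w c m2 z x))))
          + δ₁ ^ 2 / 4 * (∑ y : Site P j, ∑ z : Site P j, w * w *
            (4 * G w c m2 z y * (G w c m2 x y * G w c m2 z x' + G w c m2 x' y * G w c m2 z x)))
          - δ₂ * ∑ z : Site P j, w * (2 * (G w c m2 x z * G w c m2 x' z)))
      = ∑ y : Site P j, ∑ y' : Site P j, w * w * (G w c m2 x y * (sig6 D y y' + (-(D.lam ^ 2 * δ₂)) * delta w y y')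
          * G w c m2 y' x') := by
  rw [secondOrder_structure w c m2 D hC0 hN hw δ₁ δ₂ x x']
  have hz : ∀ z : Site P j, 4 * (N + 2) * G w c m2 z z + δ₁ = 0 := fun z => by
    rw [hδ₁, G_diag_const w c m2 z y₀]; ring
  have hΛ := loopInsertion_eq_zero_at_dm2One w c m2 D.lam δ₁ y₀ hδ₁
  have hch : (∑ y : Site P j, ∑ z : Site P j, w * w * (G w c m2 x y * (-(D.lam * (4 * (N + 2) * G w c m2 y y + δ₁)))
      * G w c m2 y z * (-(D.lam * (4 * (N + 2) * G w c m2 z z + δ₁))) * G w c m2 z x')) = 0 := by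
    refine Finset.sum_eq_zero fun y _ => Finset.sum_eq_zero fun z _ => ?_
    rw [hz y]
    ring
  rw [hch, add_zero]
  refine Finset.sum_congr rfl fun y _ => Finset.sum_congr rfl fun y' _ => ?_
  rw [hΛ y]
  ring

end Structure


/-! ## §9 DICTIONARY TO THE TYPED (1.21)/(1.22)/(1.23): the weight-2 letter is BRICK 10's kernel `sig1 D − λδ₁δ^ε`, the series of
(1.23) at `e = 0` is `λδm²_{(0,1)} + λ²δm²_{(0,2)}`, and the two terms above are `dysonTerm … 1` and `dysonTerm … 2` of r15's (1.21) -/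

section Dictionary

omit C η c m2 in
/-- **r15's typed (1.23) series at `e = 0` is `λδm²_{(0,1)} + λ²δm²_{(0,2)}`** (index set `{(2,0),(3,0),(4,0),(0,1),(1,1),(2,1),(0,2)}`,
`B3Sect1TwoPoint.idx123_eq`; the `α ≥ 1` terms carry `e^α = 0`): the counterterm curve `λδ₁ + λ²δ₂` of this file IS print's
inserted series in the pure-`λ` sector, `δ₁ = δm²_{(0,1)}`, `δ₂ = δm²_{(0,2)}`. [cite: Balaban1983Higgs3, (1.23) p.417] -/
theorem dm2Of123_charge_zero {X : Type*} [Fintype X] (lam epsd : ℝ) (S : ℕ → ℕ → X → ℝ) :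
    dm2Of123 0 lam epsd S = lam * dm2Coeff epsd S 0 1 + lam ^ 2 * dm2Coeff epsd S 0 2 := by
  simp [dm2Of123, idx123_eq]

/-- **THE WEIGHT-2 LETTER IS DIAGONAL**: BRICK 10's derived order-`λ` kernel `sig1 D − λδ₁·δ^ε` (its
`derivWithin_massCurve_eq_C0_sig1_delta_C0`; p26's typed tadpole `sig1 = −4(N+2)λC^ε_0(0)δ^ε` and lattice delta) times the volume
element is the diagonal matrix with entries `X₁(y) = −λ[4(N+2)C₀(y,y) + δ₁]` — the letter whose square is the chain of §8.
[cite: Balaban1983Higgs3, (1.21)–(1.22) p.416, (1.23) p.417] -/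
theorem letter01_diag (D : SEData P j) (hC0 : D.C0 = G w c m2) (hN : D.N = N) (hwD : D.w = w) (hw : w ≠ 0) (δ₁ : ℝ)
    (y y' : Site P j) :
    w * (sig1 D y y' + (-(D.lam * δ₁)) * delta w y y')
      = if y = y' then -(D.lam * (4 * (N + 2) * G w c m2 y y + δ₁)) else 0 := by
  simp only [sig1, delta, hC0, hN, hwD]
  split_ifs with h
  · field_simp
    ring
  · ring

/-- **THE `n = 1` TERM**: the matrix (with the volume element `η^d`) of `Σ_{y,y′}η^{2d}C₀(x,y)K(y,y′)C₀(y′,x′)` for the derived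
order-`λ²` kernel `K = sig6 D + (Λ − λ²δ₂)δ^ε` is r15's `dysonTerm (η^d·C₀) (η^d·K) 1 = C₀[λ²Σ^ε_{(0,2)} − λ²δm²_{(0,2)}]C₀`.
[cite: Balaban1983Higgs3, (1.21) p.416] -/
theorem n1_eq_dysonTerm_one (D : SEData P j) (δ₁ δ₂ : ℝ) :
    (Matrix.of fun x x' : Site P j => w * ∑ y : Site P j, ∑ y' : Site P j, w * w * (G w c m2 x y * (sig6 D y y'
          + (D.lam ^ 2 * (4 * (N + 2) * ∑ z : Site P j, w * (G w c m2 z y ^ 2 * (4 * (N + 2) * G w c m2 z z + δ₁)))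
              - D.lam ^ 2 * δ₂) * delta w y y') * G w c m2 y' x'))
      = dysonTerm (w • G w c m2) (Matrix.of fun y y' : Site P j => w * (sig6 D y y'
          + (D.lam ^ 2 * (4 * (N + 2) * ∑ z : Site P j, w * (G w c m2 z y ^ 2 * (4 * (N + 2) * G w c m2 z z + δ₁)))
              - D.lam ^ 2 * δ₂) * delta w y y')) 1 := by
  ext x x'
  simp only [dysonTerm, pow_one, Matrix.mul_apply, Matrix.of_apply, Matrix.smul_apply, smul_eq_mul, Finset.mul_sum]
  exact Finset.sum_congr rfl fun y _ => Finset.sum_congr rfl fun y' _ => by ring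

/-- **THE `n = 2` TERM**: the matrix of the chain `Σ_{y,z}η^{2d}C₀(x,y)X₁(y)C₀(y,z)X₁(z)C₀(z,x′)` is r15's
`dysonTerm (η^d·C₀) (η^d·[sig1 D − λδ₁δ^ε]) 2 = C₀X₁C₀X₁C₀` — two DERIVED weight-2 letters of (1.21) in a row (BRICK 1
`chain_eq_dysonTerm_two` is the `δ₁ = 0` case). [cite: Balaban1983Higgs3, (1.21) p.416] -/
theorem chain_eq_dysonTerm_two_counterterm (D : SEData P j) (hC0 : D.C0 = G w c m2) (hN : D.N = N) (hwD : D.w = w) (hw : w ≠ 0)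
    (δ₁ : ℝ) :
    (Matrix.of fun x x' : Site P j => w * ∑ y : Site P j, ∑ z : Site P j, w * w *
        (G w c m2 x y * (-(D.lam * (4 * (N + 2) * G w c m2 y y + δ₁))) * G w c m2 y z
          * (-(D.lam * (4 * (N + 2) * G w c m2 z z + δ₁))) * G w c m2 z x'))
      = dysonTerm (w • G w c m2) (Matrix.of fun y y' : Site P j => w * (sig1 D y y' + (-(D.lam * δ₁)) * delta w y y')) 2 := by
  -- the weight-2 letter (with the volume element) is the diagonal matrix `X₁`
  have hX : (Matrix.of fun y y' : Site P j => w * (sig1 D y y' + (-(D.lam * δ₁)) * delta w y y'))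
      = Matrix.diagonal fun y : Site P j => -(D.lam * (4 * (N + 2) * G w c m2 y y + δ₁)) := by
    ext y y'
    rw [Matrix.of_apply, letter01_diag w c m2 D hC0 hN hwD hw δ₁ y y', Matrix.diagonal_apply]
  have hdC : (Matrix.diagonal fun y : Site P j => -(D.lam * (4 * (N + 2) * G w c m2 y y + δ₁))) * (w • G w c m2)
      = Matrix.of fun i k : Site P j => -(D.lam * (4 * (N + 2) * G w c m2 i i + δ₁)) * (w * G w c m2 i k) := by
    ext i k
    rw [Matrix.diagonal_mul, Matrix.smul_apply, smul_eq_mul, Matrix.of_apply]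
  rw [hX, dysonTerm, pow_two, hdC]
  ext x x'
  simp only [Matrix.mul_apply, Matrix.of_apply, Matrix.smul_apply, smul_eq_mul, Finset.mul_sum]
  exact Finset.sum_congr rfl fun y _ => Finset.sum_congr rfl fun z _ => by ring

/-- **(1.21) AT ORDER `λ²` WITH THE COUNTERTERM, IN r15's VOCABULARY**: the matrix of `(λ²/2!)·(d/dλ)²∣_{0⁺}G` (per `δ_{ab}`,
volume element `η^d`) is `dysonTerm (η^dC₀) (η^d[sig6 D + (Λ − λ²δ₂)δ^ε]) 1 + dysonTerm (η^dC₀) (η^d[sig1 D − λδ₁δ^ε]) 2` — the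
`n = 1` and `n = 2` terms of print's `Σ_n C₀[(−δm² + Σ^ε + …)C₀]ⁿ` at order `λ²` (e = 0: no `Σ₁`, `Σ₂` letters), every letter
DERIVED from (1.19)/(1.20). [cite: Balaban1983Higgs3, (1.21)–(1.22) p.416, (1.23) p.417] -/
theorem secondOrder_eq_dysonTerms (D : SEData P j) (hC0 : D.C0 = G w c m2) (hN : D.N = N) (hwD : D.w = w) (hw : w ≠ 0)
    (δ₁ δ₂ : ℝ) :
    (Matrix.of fun x x' : Site P j => w * (D.lam ^ 2 / 2 * ((∑ y : Site P j, ∑ z : Site P j, w * w *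
            (4 ^ 2 * (2 * N + 4) * G w c m2 z y ^ 3 * (G w c m2 x y * G w c m2 z x' + G w c m2 x' y * G w c m2 z x)
              + 2 * (N + 2) * G w c m2 z z * (8 * (N + 2) * G w c m2 z y ^ 2 * (G w c m2 x y * G w c m2 x' y))
              + 2 * (N + 2) * G w c m2 y y * (8 * (N + 2) * G w c m2 y z ^ 2 * (G w c m2 x z * G w c m2 x' z))
              + 2 * (N + 2) * G w c m2 y y * (2 * (N + 2) * G w c m2 z z)
                * (4 * G w c m2 z y * (G w c m2 x y * G w c m2 z x' + G w c m2 x' y * G w c m2 z x))))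
          + δ₁ * (∑ y : Site P j, ∑ z : Site P j, w * w *
            (8 * (N + 2) * G w c m2 z y ^ 2 * (G w c m2 x y * G w c m2 x' y)
              + 2 * (N + 2) * G w c m2 y y * (4 * G w c m2 z y * (G w c m2 x y * G w c m2 z x' + G w c m2 x' y * G w c m2 z x))))
          + δ₁ ^ 2 / 4 * (∑ y : Site P j, ∑ z : Site P j, w * w *
            (4 * G w c m2 z y * (G w c m2 x y * G w c m2 z x' + G w c m2 x' y * G w c m2 z x)))
          - δ₂ * ∑ z : Site P j, w * (2 * (G w c m2 x z * G w c m2 x' z)))))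
      = dysonTerm (w • G w c m2) (Matrix.of fun y y' : Site P j => w * (sig6 D y y'
          + (D.lam ^ 2 * (4 * (N + 2) * ∑ z : Site P j, w * (G w c m2 z y ^ 2 * (4 * (N + 2) * G w c m2 z z + δ₁)))
              - D.lam ^ 2 * δ₂) * delta w y y')) 1
        + dysonTerm (w • G w c m2) (Matrix.of fun y y' : Site P j => w * (sig1 D y y' + (-(D.lam * δ₁)) * delta w y y')) 2 := by
  rw [← n1_eq_dysonTerm_one w c m2 D δ₁ δ₂, ← chain_eq_dysonTerm_two_counterterm w c m2 D hC0 hN hwD hw δ₁]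
  ext x x'
  simp only [Matrix.add_apply, Matrix.of_apply]
  rw [secondOrder_structure w c m2 D hC0 hN hw δ₁ δ₂ x x', mul_add]

/-- **(1.21) AT ORDER `λ²` AT PRINT'S `δm²₁`, IN r15's VOCABULARY: THE `n = 1` TERM ALONE, `C₀[sig6 D − λ²δm²_{(0,2)}δ^ε]C₀`.**  With
`δ₁ = −4(N+2)C₀(0)` (the `(0,1)` solution) the matrix (volume element `η^d`) of `(λ²/2!)·(d/dλ)²∣_{0⁺}G` per `δ_{ab}` is
`dysonTerm (η^dC₀) (η^d[sig6 D − λ²δ₂·δ^ε]) 1` — the weight-2 letter being zero, no `n = 2` term survives, and the bracket of (1.21)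
at order `λ²` carries exactly p26's typed sunset `sig6` ((1.22)⑥) and the counterterm letter `−λ²δm²_{(0,2)}`; with
`condition_02_iff_at_dm2One` the latter is `−ct6 D·δ^ε`. [cite: Balaban1983Higgs3, (1.21)–(1.22) p.416, (1.23) p.417] -/
theorem secondOrder_eq_dysonTerm_one_at_dm2One (D : SEData P j) (hC0 : D.C0 = G w c m2) (hN : D.N = N) (hw : w ≠ 0)
    (δ₁ δ₂ : ℝ) (y₀ : Site P j) (hδ₁ : δ₁ = -(4 * (N + 2) * G w c m2 y₀ y₀)) :
    (Matrix.of fun x x' : Site P j => w * (D.lam ^ 2 / 2 * ((∑ y : Site P j, ∑ z : Site P j, w * w *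
            (4 ^ 2 * (2 * N + 4) * G w c m2 z y ^ 3 * (G w c m2 x y * G w c m2 z x' + G w c m2 x' y * G w c m2 z x)
              + 2 * (N + 2) * G w c m2 z z * (8 * (N + 2) * G w c m2 z y ^ 2 * (G w c m2 x y * G w c m2 x' y))
              + 2 * (N + 2) * G w c m2 y y * (8 * (N + 2) * G w c m2 y z ^ 2 * (G w c m2 x z * G w c m2 x' z))
              + 2 * (N + 2) * G w c m2 y y * (2 * (N + 2) * G w c m2 z z)
                * (4 * G w c m2 z y * (G w c m2 x y * G w c m2 z x' + G w c m2 x' y * G w c m2 z x))))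
          + δ₁ * (∑ y : Site P j, ∑ z : Site P j, w * w *
            (8 * (N + 2) * G w c m2 z y ^ 2 * (G w c m2 x y * G w c m2 x' y)
              + 2 * (N + 2) * G w c m2 y y * (4 * G w c m2 z y * (G w c m2 x y * G w c m2 z x' + G w c m2 x' y * G w c m2 z x))))
          + δ₁ ^ 2 / 4 * (∑ y : Site P j, ∑ z : Site P j, w * w *
            (4 * G w c m2 z y * (G w c m2 x y * G w c m2 z x' + G w c m2 x' y * G w c m2 z x)))
          - δ₂ * ∑ z : Site P j, w * (2 * (G w c m2 x z * G w c m2 x' z)))))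
      = dysonTerm (w • G w c m2)
          (Matrix.of fun y y' : Site P j => w * (sig6 D y y' + (-(D.lam ^ 2 * δ₂)) * delta w y y')) 1 := by
  ext x x'
  rw [Matrix.of_apply, secondOrder_structure_at_dm2One w c m2 D hC0 hN hw δ₁ δ₂ y₀ hδ₁ x x']
  simp only [dysonTerm, pow_one, Matrix.mul_apply, Matrix.of_apply, Matrix.smul_apply, smul_eq_mul, Finset.mul_sum]
  exact Finset.sum_congr rfl fun y _ => Finset.sum_congr rfl fun y' _ => by ring

end Dictionary


/-! ## §10 THE VACUUM SIDE — (1.24) AT `e = 0` WITH THE COUNTERTERM SERIES INSERTED: `(∂/∂λ)^β log∫dφ e^{−S^ε}∣_{λ=0⁺}` for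
`β = 1, 2`, the action (1.20) carrying `δm² = λδ₁ + λ²δ₂` -/

section Vacuum

/-- **(1.24), β = 1, e = 0, WITH THE COUNTERTERM**: `(d/dλ)log∫dφ e^{−S^ε}∣_{0⁺} = −Σ_yη^d[N(N+2)C₀(y,y)² + (δ₁/2)·N·C₀(y,y)]` —
the "8" of BRICK 1 §13 plus the one-loop vacuum graph of the mass vertex (1.7)·`λδm²_{(0,1)}` (print p. 417: *"E₁ = Σ_{1≤α+β≤n̄}
(1/(α!β!))e^αλ^β(∂^{α+β}/∂e^α∂λ^β log∫dA∫dφ e^{−S^ε(A,φ)})∣_{e=λ=0} (1.24) … Terms of this expansion are described by connected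
graphs without external legs (vacuum graphs)"*). [cite: Balaban1983Higgs3, (1.24) p.417] [cite: GlimmJaffeQP1987, §8.4–8.5] -/
theorem hasDerivWithinAt_logZct (hw : 0 < w) (hm : 0 < m2) (δ₁ δ₂ : ℝ) :
    HasDerivWithinAt
      (fun lam : ℝ => Real.log (∫ φ, weight C η w c m2 (0 : VecField P j ℝ) φ * (Real.exp (-(lam * ((∑ y : Site P j, w * ‖φ y‖ ^ 4) + 1 / 2 * δ₁ * massForm w φ) + lam ^ 2 * (1 / 2 * δ₂ * massForm w φ))) * 1)))
      (-((∑ y : Site P j, w * (N * (N + 2) * G w c m2 y y ^ 2)) + δ₁ / 2 * ∑ z : Site P j, w * (N * G w c m2 z z)))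
      (Set.Ici 0) 0 := by
  obtain ⟨L, hL0, hL1, hLκ⟩ := exists_window m2 hm (1 / 2 * δ₂)
  have hVQ := expGrowth_V_add_massForm (P := P) (j := j) (N := N) w δ₁
  have hK : (0 : ℝ) ≤ Fintype.card (Site P j) * w * (δ₁ ^ 2 / 16) := by positivity
  have hVK : ∀ φ : Cfg P j N, -(Fintype.card (Site P j) * w * (δ₁ ^ 2 / 16)) ≤ ((∑ y : Site P j, w * ‖φ y‖ ^ 4) + 1 / 2 * δ₁ * massForm w φ) :=
    fun φ => neg_le_V_add_massForm w hw.le δ₁ φ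
  have h1 := hasDerivWithinAt_moment_zero C η w c m2 hw hm hVQ.1 hK hVK (ExpGrowth.const 1) (κ := 1 / 2 * δ₂) hL0 hL1 hLκ
  have hpos := moment_one_pos C η w c m2 hw hm hVQ.1 hK hVK (κ := 1 / 2 * δ₂) (lam := 0) le_rfl zero_le_one
    (by rw [zero_mul]; positivity)
  have hZ : 0 < ∫ φ, weight C η w c m2 (0 : VecField P j ℝ) φ := B3WT226Traces.Z_pos C η w c m2 hw hm
  have hden0 : (∫ φ, weight C η w c m2 (0 : VecField P j ℝ) φ * (Real.exp (-(0 * ((∑ y : Site P j, w * ‖φ y‖ ^ 4) + 1 / 2 * δ₁ * massForm w φ) + 0 ^ 2 * (1 / 2 * δ₂ * massForm w φ))) * 1)) = ∫ φ, weight C η w c m2 (0 : VecField P j ℝ) φ :=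
    integral_congr_ae (Filter.Eventually.of_forall fun φ => by simp)
  have h := h1.log hpos.ne'
  refine h.congr_deriv ?_
  rw [hden0]
  simp only [mul_one]
  rw [integral_V1 C η w c m2 hw hm δ₁, integral_V C η w c m2 hw hm, integral_massForm C η w c m2 hw hm]
  have hZne : (∫ φ, weight C η w c m2 (0 : VecField P j ℝ) φ) ≠ 0 := hZ.ne'
  field_simp

/-- on the window `0 ≤ λ < L` the derivative (within `[0,∞)`) of `log Z^{ct}(λ)` is `−⟨V₁ + λδ₂Q⟩_λ = −[N_{V₁}(λ) + λδ₂N_Q(λ)]/N_1(λ)`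
(`V₁ = V + ½δ₁Q`). [cite: Balaban1983Higgs3, (1.24) p.417] -/
theorem derivWithin_logZct_eq (hw : 0 < w) (hm : 0 < m2) (δ₁ δ₂ : ℝ) {L : ℝ} (hL1 : L ≤ 1)
    (hLκ : L * |1 / 2 * δ₂| ≤ m2 / 4) {lam : ℝ} (hlam0 : 0 ≤ lam) (hlamL : lam < L) :
    derivWithin (fun lam : ℝ => Real.log (∫ φ, weight C η w c m2 (0 : VecField P j ℝ) φ * (Real.exp (-(lam * ((∑ y : Site P j, w * ‖φ y‖ ^ 4) + 1 / 2 * δ₁ * massForm w φ) + lam ^ 2 * (1 / 2 * δ₂ * massForm w φ))) * 1))) (Set.Ici 0) lam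
      = -((∫ φ, weight C η w c m2 (0 : VecField P j ℝ) φ * (Real.exp (-(lam * ((∑ y : Site P j, w * ‖φ y‖ ^ 4) + 1 / 2 * δ₁ * massForm w φ) + lam ^ 2 * (1 / 2 * δ₂ * massForm w φ))) * (((∑ y : Site P j, w * ‖φ y‖ ^ 4) + 1 / 2 * δ₁ * massForm w φ) * 1)))
          + 2 * lam * (1 / 2 * δ₂) * ∫ φ, weight C η w c m2 (0 : VecField P j ℝ) φ * (Real.exp (-(lam * ((∑ y : Site P j, w * ‖φ y‖ ^ 4) + 1 / 2 * δ₁ * massForm w φ) + lam ^ 2 * (1 / 2 * δ₂ * massForm w φ))) * (massForm w φ * 1)))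
        / (∫ φ, weight C η w c m2 (0 : VecField P j ℝ) φ * (Real.exp (-(lam * ((∑ y : Site P j, w * ‖φ y‖ ^ 4) + 1 / 2 * δ₁ * massForm w φ) + lam ^ 2 * (1 / 2 * δ₂ * massForm w φ))) * 1)) := by
  have hVQ := expGrowth_V_add_massForm (P := P) (j := j) (N := N) w δ₁
  have hK : (0 : ℝ) ≤ Fintype.card (Site P j) * w * (δ₁ ^ 2 / 16) := by positivity
  have hVK : ∀ φ : Cfg P j N, -(Fintype.card (Site P j) * w * (δ₁ ^ 2 / 16)) ≤ ((∑ y : Site P j, w * ‖φ y‖ ^ 4) + 1 / 2 * δ₁ * massForm w φ) :=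
    fun φ => neg_le_V_add_massForm w hw.le δ₁ φ
  have hlam1 : lam ≤ 1 := (hlamL.le.trans hL1)
  have hlamκ : lam * |1 / 2 * δ₂| ≤ m2 / 4 := (mul_le_mul_of_nonneg_right hlamL.le (abs_nonneg _)).trans hLκ
  have h1 := hasDerivWithinAt_moment C η w c m2 hw hm hVQ.1 hK hVK (ExpGrowth.const 1) (κ := 1 / 2 * δ₂) hL1 hLκ hlam0 hlamL
  have hpos := moment_one_pos C η w c m2 hw hm hVQ.1 hK hVK (κ := 1 / 2 * δ₂) (lam := lam) hlam0 hlam1 hlamκ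
  rw [(h1.log hpos.ne').derivWithin (uniqueDiffOn_Ici (0 : ℝ) lam hlam0),
    moment_split C η w c m2 hw hm hVQ.1 hK hVK (ExpGrowth.const 1) (κ := 1 / 2 * δ₂) hlam0 hlam1 hlamκ, neg_div]

/-- **(1.24), β = 2, e = 0, WITH THE COUNTERTERM: THE CONNECTED TWO-VERTEX VACUUM GRAPHS OF THE ACTION (1.20).**  `λ ↦ −⟨V₁ +
λδ₂Q⟩_λ` (= `(d/dλ)log Z^{ct}` on the window, `derivWithin_logZct_eq`) is right-differentiable at `0⁺` with derivative
`Var₀(V₁) − δ₂⟨Q⟩₀ = Σ_{y,z}η^{2d}[8N(N+2)C₀(z,y)⁴ + 2(N+2)C₀(y,y)·2(N+2)C₀(z,z)·2N·C₀(z,y)²] + δ₁·Σ_{y,z}η^{2d}2(N+2)C₀(y,y)·2N·C₀(z,y)²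
+ (δ₁²/4)·Σ_{y,z}η^{2d}2N·C₀(z,y)² − δ₂·Σ_zη^dN·C₀(z,z)` — BRICK 1's basketball and bubble with two tadpole loops, the bubble
with one tadpole loop and one mass vertex, the bubble of two mass vertices, and the loop of the second-order mass vertex
`λ²δm²_{(0,2)}`; every disconnected product CANCELS (*"connected graphs without external legs"*).
[cite: Balaban1983Higgs3, (1.24) p.417] [cite: GlimmJaffeQP1987, §8.4–8.5] -/
theorem hasDerivWithinAt_firstDeriv_logZct (hw : 0 < w) (hm : 0 < m2) (δ₁ δ₂ : ℝ) :
    HasDerivWithinAt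
      (fun lam : ℝ => -((∫ φ, weight C η w c m2 (0 : VecField P j ℝ) φ * (Real.exp (-(lam * ((∑ y : Site P j, w * ‖φ y‖ ^ 4) + 1 / 2 * δ₁ * massForm w φ) + lam ^ 2 * (1 / 2 * δ₂ * massForm w φ))) * (((∑ y : Site P j, w * ‖φ y‖ ^ 4) + 1 / 2 * δ₁ * massForm w φ) * 1)))
          + 2 * lam * (1 / 2 * δ₂) * ∫ φ, weight C η w c m2 (0 : VecField P j ℝ) φ * (Real.exp (-(lam * ((∑ y : Site P j, w * ‖φ y‖ ^ 4) + 1 / 2 * δ₁ * massForm w φ) + lam ^ 2 * (1 / 2 * δ₂ * massForm w φ))) * (massForm w φ * 1)))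
        / (∫ φ, weight C η w c m2 (0 : VecField P j ℝ) φ * (Real.exp (-(lam * ((∑ y : Site P j, w * ‖φ y‖ ^ 4) + 1 / 2 * δ₁ * massForm w φ) + lam ^ 2 * (1 / 2 * δ₂ * massForm w φ))) * 1)))
      ((∑ y : Site P j, ∑ z : Site P j, w * w * (8 * (N * (N + 2)) * G w c m2 z y ^ 4))
        + (∑ y : Site P j, ∑ z : Site P j, w * w *
            (2 * (N + 2) * G w c m2 y y * (2 * (N + 2) * G w c m2 z z) * (2 * N * G w c m2 z y ^ 2)))
        + δ₁ * (∑ y : Site P j, ∑ z : Site P j, w * w * (2 * (N + 2) * G w c m2 y y * (2 * N * G w c m2 z y ^ 2)))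
        + δ₁ ^ 2 / 4 * (∑ y : Site P j, ∑ z : Site P j, w * w * (2 * N * G w c m2 z y ^ 2))
        - δ₂ * ∑ z : Site P j, w * (N * G w c m2 z z))
      (Set.Ici 0) 0 := by
  obtain ⟨L, hL0, hL1, hLκ⟩ := exists_window m2 hm (1 / 2 * δ₂)
  have hVQ := expGrowth_V_add_massForm (P := P) (j := j) (N := N) w δ₁
  have hK : (0 : ℝ) ≤ Fintype.card (Site P j) * w * (δ₁ ^ 2 / 16) := by positivity
  have hVK : ∀ φ : Cfg P j N, -(Fintype.card (Site P j) * w * (δ₁ ^ 2 / 16)) ≤ ((∑ y : Site P j, w * ‖φ y‖ ^ 4) + 1 / 2 * δ₁ * massForm w φ) :=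
    fun φ => neg_le_V_add_massForm w hw.le δ₁ φ
  have hA := hasDerivWithinAt_moment_zero C η w c m2 hw hm hVQ.1 hK hVK (hVQ.1.mul (ExpGrowth.const 1))
    (κ := 1 / 2 * δ₂) hL0 hL1 hLκ
  have hB := hasDerivWithinAt_moment_zero C η w c m2 hw hm hVQ.1 hK hVK (hVQ.2.mul (ExpGrowth.const 1))
    (κ := 1 / 2 * δ₂) hL0 hL1 hLκ
  have h1 := hasDerivWithinAt_moment_zero C η w c m2 hw hm hVQ.1 hK hVK (ExpGrowth.const 1) (κ := 1 / 2 * δ₂) hL0 hL1 hLκ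
  have hpos := moment_one_pos C η w c m2 hw hm hVQ.1 hK hVK (κ := 1 / 2 * δ₂) (lam := 0) le_rfl zero_le_one
    (by rw [zero_mul]; positivity)
  have hZ : 0 < ∫ φ, weight C η w c m2 (0 : VecField P j ℝ) φ := B3WT226Traces.Z_pos C η w c m2 hw hm
  have hlin : HasDerivWithinAt (fun lam : ℝ => 2 * lam * (1 / 2 * δ₂)) (2 * 1 * (1 / 2 * δ₂)) (Set.Ici 0) 0 :=
    ((hasDerivWithinAt_id (0 : ℝ) (Set.Ici 0)).const_mul 2).mul_const (1 / 2 * δ₂)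
  have h := (hA.fun_add (hlin.fun_mul hB)).fun_neg.fun_div h1 hpos.ne'
  refine h.congr_deriv ?_
  have hA0 : (∫ φ, weight C η w c m2 (0 : VecField P j ℝ) φ * (Real.exp (-(0 * ((∑ y : Site P j, w * ‖φ y‖ ^ 4) + 1 / 2 * δ₁ * massForm w φ) + 0 ^ 2 * (1 / 2 * δ₂ * massForm w φ))) * (((∑ y : Site P j, w * ‖φ y‖ ^ 4) + 1 / 2 * δ₁ * massForm w φ) * 1))) = ∫ φ, weight C η w c m2 (0 : VecField P j ℝ) φ * ((∑ y : Site P j, w * ‖φ y‖ ^ 4) + 1 / 2 * δ₁ * massForm w φ) :=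
    integral_congr_ae (Filter.Eventually.of_forall fun φ => by simp)
  have hB0 : (∫ φ, weight C η w c m2 (0 : VecField P j ℝ) φ * (Real.exp (-(0 * ((∑ y : Site P j, w * ‖φ y‖ ^ 4) + 1 / 2 * δ₁ * massForm w φ) + 0 ^ 2 * (1 / 2 * δ₂ * massForm w φ))) * (massForm w φ * 1))) = ∫ φ, weight C η w c m2 (0 : VecField P j ℝ) φ * massForm w φ :=
    integral_congr_ae (Filter.Eventually.of_forall fun φ => by simp)
  have hden0 : (∫ φ, weight C η w c m2 (0 : VecField P j ℝ) φ * (Real.exp (-(0 * ((∑ y : Site P j, w * ‖φ y‖ ^ 4) + 1 / 2 * δ₁ * massForm w φ) + 0 ^ 2 * (1 / 2 * δ₂ * massForm w φ))) * 1)) = ∫ φ, weight C η w c m2 (0 : VecField P j ℝ) φ :=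
    integral_congr_ae (Filter.Eventually.of_forall fun φ => by simp)
  have e2 : (∫ φ, weight C η w c m2 (0 : VecField P j ℝ) φ * (((∑ y : Site P j, w * ‖φ y‖ ^ 4) + 1 / 2 * δ₁ * massForm w φ) * (((∑ y : Site P j, w * ‖φ y‖ ^ 4) + 1 / 2 * δ₁ * massForm w φ) * 1))) = ∫ φ, weight C η w c m2 (0 : VecField P j ℝ) φ * ((∑ y : Site P j, w * ‖φ y‖ ^ 4) + 1 / 2 * δ₁ * massForm w φ) ^ 2 :=
    integral_congr_ae (Filter.Eventually.of_forall fun φ => by ring)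
  have e1 : (∫ φ, weight C η w c m2 (0 : VecField P j ℝ) φ * (((∑ y : Site P j, w * ‖φ y‖ ^ 4) + 1 / 2 * δ₁ * massForm w φ) * 1)) = ∫ φ, weight C η w c m2 (0 : VecField P j ℝ) φ * ((∑ y : Site P j, w * ‖φ y‖ ^ 4) + 1 / 2 * δ₁ * massForm w φ) :=
    integral_congr_ae (Filter.Eventually.of_forall fun φ => by ring)
  rw [hA0, hB0, hden0, e2, e1]
  simp only [mul_zero, zero_mul, add_zero, mul_one]
  rw [integral_V1_sq C η w c m2 hw hm δ₁, integral_V1 C η w c m2 hw hm δ₁, integral_V_sq C η w c m2 hw hm,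
    integral_V C η w c m2 hw hm, integral_V_massForm C η w c m2 hw hm, integral_massForm_sq C η w c m2 hw hm,
    integral_massForm C η w c m2 hw hm]
  set Z : ℝ := ∫ φ, weight C η w c m2 (0 : VecField P j ℝ) φ with hZdef
  set A : ℝ := ∑ y : Site P j, ∑ z : Site P j, w * w * (8 * (N * (N + 2)) * G w c m2 z y ^ 4) with hA'
  set Bb : ℝ := ∑ y : Site P j, ∑ z : Site P j, w * w *
      (2 * (N + 2) * G w c m2 y y * (2 * (N + 2) * G w c m2 z z) * (2 * N * G w c m2 z y ^ 2)) with hBb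
  set B88 : ℝ := ∑ y : Site P j, ∑ z : Site P j, w * w *
      (N * (N + 2) * G w c m2 y y ^ 2 * (N * (N + 2) * G w c m2 z z ^ 2)) with hB88
  set s8 : ℝ := ∑ y : Site P j, w * (N * (N + 2) * G w c m2 y y ^ 2) with hs8
  set T8Q : ℝ := ∑ y : Site P j, ∑ z : Site P j, w * w * (2 * (N + 2) * G w c m2 y y * (2 * N * G w c m2 z y ^ 2)) with hT8Q
  set B8Q : ℝ := ∑ y : Site P j, ∑ z : Site P j, w * w * (N * (N + 2) * G w c m2 y y ^ 2 * (N * G w c m2 z z)) with hB8Q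
  set TQQ : ℝ := ∑ y : Site P j, ∑ z : Site P j, w * w * (2 * N * G w c m2 z y ^ 2) with hTQQ
  set BQQ : ℝ := ∑ y : Site P j, ∑ z : Site P j, w * w * (N * G w c m2 y y * (N * G w c m2 z z)) with hBQQ
  set sQ : ℝ := ∑ z : Site P j, w * (N * G w c m2 z z) with hsQ
  have hs88 : s8 * s8 = B88 := by
    rw [hs8, Finset.sum_mul_sum, hB88]
    exact Finset.sum_congr rfl fun y _ => Finset.sum_congr rfl fun z _ => by ring
  have hs8Q : s8 * sQ = B8Q := by
    rw [hs8, hsQ, Finset.sum_mul_sum, hB8Q]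
    exact Finset.sum_congr rfl fun y _ => Finset.sum_congr rfl fun z _ => by ring
  have hsQQ : sQ * sQ = BQQ := by
    rw [hsQ, Finset.sum_mul_sum, hBQQ]
    exact Finset.sum_congr rfl fun y _ => Finset.sum_congr rfl fun z _ => by ring
  have hZne : Z ≠ 0 := hZ.ne'
  field_simp
  linear_combination (-16) * hs88 + (-16 * δ₁) * hs8Q + (-4 * δ₁ ^ 2) * hsQQ

/-- **THE `(α,β) = (0,2)` VACUUM COEFFICIENT IN MATHLIB'S SPELLING**: `iteratedDerivWithin 2 (λ ↦ log Z^{ct}(λ)) (Set.Ici 0) 0`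
is the value of `hasDerivWithinAt_firstDeriv_logZct` — the derivative `(∂/∂λ)²log∫dφ e^{−S^ε}∣_{λ=0⁺}` entering the `(α,β) = (0,2)`
term `(1/2!)λ²·(…)` of (1.24), at `e = 0`, with the counterterm series of (1.23) inserted in the action.
[cite: Balaban1983Higgs3, (1.24) p.417] -/
theorem iteratedDerivWithin_two_logZct (hw : 0 < w) (hm : 0 < m2) (δ₁ δ₂ : ℝ) :
    iteratedDerivWithin 2 (fun lam : ℝ => Real.log (∫ φ, weight C η w c m2 (0 : VecField P j ℝ) φ * (Real.exp (-(lam * ((∑ y : Site P j, w * ‖φ y‖ ^ 4) + 1 / 2 * δ₁ * massForm w φ) + lam ^ 2 * (1 / 2 * δ₂ * massForm w φ))) * 1))) (Set.Ici 0) 0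
      = (∑ y : Site P j, ∑ z : Site P j, w * w * (8 * (N * (N + 2)) * G w c m2 z y ^ 4))
        + (∑ y : Site P j, ∑ z : Site P j, w * w *
            (2 * (N + 2) * G w c m2 y y * (2 * (N + 2) * G w c m2 z z) * (2 * N * G w c m2 z y ^ 2)))
        + δ₁ * (∑ y : Site P j, ∑ z : Site P j, w * w * (2 * (N + 2) * G w c m2 y y * (2 * N * G w c m2 z y ^ 2)))
        + δ₁ ^ 2 / 4 * (∑ y : Site P j, ∑ z : Site P j, w * w * (2 * N * G w c m2 z y ^ 2))
        - δ₂ * ∑ z : Site P j, w * (N * G w c m2 z z) := by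
  obtain ⟨L, hL0, hL1, hLκ⟩ := exists_window m2 hm (1 / 2 * δ₂)
  rw [iteratedDerivWithin_succ, iteratedDerivWithin_one]
  have hcongr : derivWithin (fun lam : ℝ => Real.log (∫ φ, weight C η w c m2 (0 : VecField P j ℝ) φ * (Real.exp (-(lam * ((∑ y : Site P j, w * ‖φ y‖ ^ 4) + 1 / 2 * δ₁ * massForm w φ) + lam ^ 2 * (1 / 2 * δ₂ * massForm w φ))) * 1))) (Set.Ici 0)
      =ᶠ[𝓝[Set.Ici (0 : ℝ)] 0] (fun lam : ℝ => -((∫ φ, weight C η w c m2 (0 : VecField P j ℝ) φ * (Real.exp (-(lam * ((∑ y : Site P j, w * ‖φ y‖ ^ 4) + 1 / 2 * δ₁ * massForm w φ) + lam ^ 2 * (1 / 2 * δ₂ * massForm w φ))) * (((∑ y : Site P j, w * ‖φ y‖ ^ 4) + 1 / 2 * δ₁ * massForm w φ) * 1)))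
          + 2 * lam * (1 / 2 * δ₂) * ∫ φ, weight C η w c m2 (0 : VecField P j ℝ) φ * (Real.exp (-(lam * ((∑ y : Site P j, w * ‖φ y‖ ^ 4) + 1 / 2 * δ₁ * massForm w φ) + lam ^ 2 * (1 / 2 * δ₂ * massForm w φ))) * (massForm w φ * 1)))
        / (∫ φ, weight C η w c m2 (0 : VecField P j ℝ) φ * (Real.exp (-(lam * ((∑ y : Site P j, w * ‖φ y‖ ^ 4) + 1 / 2 * δ₁ * massForm w φ) + lam ^ 2 * (1 / 2 * δ₂ * massForm w φ))) * 1))) := by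
    filter_upwards [Ico_mem_nhdsGE hL0] with lam hlam
    exact derivWithin_logZct_eq C η w c m2 hw hm δ₁ δ₂ hL1 hLκ hlam.1 hlam.2
  rw [hcongr.derivWithin_eq_of_mem Set.self_mem_Ici]
  exact (hasDerivWithinAt_firstDeriv_logZct C η w c m2 hw hm δ₁ δ₂).derivWithin
    (uniqueDiffOn_Ici (0 : ℝ) 0 Set.self_mem_Ici)

/-- **AT PRINT'S `δm²_{(0,1)}` THE THREE BUBBLES CANCEL: `(d/dλ)²log Z^{ct}∣_{0⁺} = Σ_{y,z}η^{2d}8N(N+2)C₀(z,y)⁴ − δ₂·Σ_zη^dN·C₀(z,z)`** —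
with `δ₁ = −4(N+2)C₀(0)` (`C₀(v,v) = C₀(0)`, `B3WTCovariance.G_diag_const`) the bubble with two tadpole loops, the bubble with one
tadpole loop and one mass vertex and the bubble of two mass vertices sum to zero (coefficients `4 − 8 + 4` of
`(N+2)²C₀(0)²·Σ2N·C₀(z,y)²`): the order-`λ²` term of (1.24) at `e = 0`, `(1/2!)λ²(∂/∂λ)²log∫…`, is the BASKETBALL plus the loop
of the vertex (1.7)·`λ²δm²_{(0,2)}` — the vacuum counterpart of `secondOrder_structure_at_dm2One`.
[cite: Balaban1983Higgs3, (1.24) p.417] [cite: GlimmJaffeQP1987, §8.4–8.5] -/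
theorem vacuum_secondOrder_at_dm2One (δ₁ δ₂ : ℝ) (y₀ : Site P j) (hδ₁ : δ₁ = -(4 * (N + 2) * G w c m2 y₀ y₀)) :
    (∑ y : Site P j, ∑ z : Site P j, w * w * (8 * (N * (N + 2)) * G w c m2 z y ^ 4))
        + (∑ y : Site P j, ∑ z : Site P j, w * w *
            (2 * (N + 2) * G w c m2 y y * (2 * (N + 2) * G w c m2 z z) * (2 * N * G w c m2 z y ^ 2)))
        + δ₁ * (∑ y : Site P j, ∑ z : Site P j, w * w * (2 * (N + 2) * G w c m2 y y * (2 * N * G w c m2 z y ^ 2)))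
        + δ₁ ^ 2 / 4 * (∑ y : Site P j, ∑ z : Site P j, w * w * (2 * N * G w c m2 z y ^ 2))
        - δ₂ * ∑ z : Site P j, w * (N * G w c m2 z z)
      = (∑ y : Site P j, ∑ z : Site P j, w * w * (8 * (N * (N + 2)) * G w c m2 z y ^ 4))
        - δ₂ * ∑ z : Site P j, w * (N * G w c m2 z z) := by
  have hz : ∀ v : Site P j, G w c m2 v v = G w c m2 y₀ y₀ := fun v => G_diag_const w c m2 v y₀
  have key : (∑ y : Site P j, ∑ z : Site P j, w * w *
            (2 * (N + 2) * G w c m2 y y * (2 * (N + 2) * G w c m2 z z) * (2 * N * G w c m2 z y ^ 2)))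
        + δ₁ * (∑ y : Site P j, ∑ z : Site P j, w * w * (2 * (N + 2) * G w c m2 y y * (2 * N * G w c m2 z y ^ 2)))
        + δ₁ ^ 2 / 4 * (∑ y : Site P j, ∑ z : Site P j, w * w * (2 * N * G w c m2 z y ^ 2)) = 0 := by
    rw [Finset.mul_sum, Finset.mul_sum, ← Finset.sum_add_distrib, ← Finset.sum_add_distrib]
    refine Finset.sum_eq_zero fun y _ => ?_
    rw [Finset.mul_sum, Finset.mul_sum, ← Finset.sum_add_distrib, ← Finset.sum_add_distrib]
    refine Finset.sum_eq_zero fun z _ => ?_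
    rw [hz y, hz z, hδ₁]
    ring
  linear_combination key

end Vacuum

end Literature.MathematicalPhysics.QuantumFieldTheory.Balaban1983to89.B3Eq123IndexZeroTwo
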